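/-
Copyright: cell `langlands-arthur-audit` (papers/Langlands/langlands-arthur-audit), unit `pub-arthur-down-g22`
(downstream tracer, gen 22).  Eighth file of the downstream register: `Downstream.lean` (tranches 1–4),
`Downstream2.lean` (5–11), `Downstream3.lean` (12–20), `Downstream4.lean` (21–25), `Downstream5.lean` (26–28),
`Downstream6.lean` (29–32) and `Downstream7.lean` (v1 p202558, v2 p203097, tranches 33–34; 164 331 bytes = 82 % of the
gate's 200 000-byte file cap) are full or nearly so, so the register continues here, APPEND-ONLY in the same
conventions and the same namespace `…Arthur2013.Downstream`; v1 = the thirty-fifth tranche (`Consumers35`: the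
generic-representation / local-newform line — B19 Atobe 2017 (uniqueness of the 𝔴-generic member of an L-packet of a
quasi-split classical group; typed as TWO fields, the symplectic–orthogonal case ⇐ book and the unitary case ⇐ Mok);
the conduit C194 Atobe – Oi – Yasuda 2024 (local newforms for tempered generic representations of unramified U_{2n+1})
⇐ Mok ∧ C15 ∧ C24 ∧ B19's unitary case; C146 Cheng (local newforms of all generic representations of unramified
U_{2n+1}, Rankin–Selberg integrals) ⇐ Mok ∧ C194; C147 Cheng – Wang 2025 (γ-factors of U_{2n+1} × Res_{E/F} GL_r)
⇐ Mok; C104 Disegni 2025 (Theta cycles) ⇐ Mok ∧ C13 ∧ C19 ∧ C20 ∧ B18 ∧ B19's unitary case; `Implications35`;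
bookkeeping theorems); v2 (same unit, APPEND-ONLY): the thirty-sixth tranche (`Consumers36`: three of the 2022–2026
PRINTED WITNESSES of the conditionality — C195 Y. Cheng 2026, with an appendix by C.-H. Lo (local newforms of p-adic
SO_{2n+1}: reduction to supercuspidals; footnote « Conditional on the twisted weighted fundamental lemma ») ⇐ book ∧ B4 ∧
B42 ∧ the node `AGIKMSderiv` (the highest-derivatives formula taken from AGIKMS 2024); B9 Morimoto 2022 (the refined
formal degree for ALL discrete series of U_{2n}^±, « assuming the weighted fundamental lemma for quasi-split groups, which
is proved in Chaudouard–Laumon [CL] only in the split case ») ⇐ Mok ∧ KMSW's proved scope ∧ B19's unitary case; C196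
S.-Y. Chen 2025 (algebraicity of adjoint L-values for GU_n; « making the endoscopic classification conditional only on
the twisted weighted fundamental lemma ») ⇐ Mok ∧ C27; `Implications36`; bookkeeping theorems); v3 (same unit,
APPEND-ONLY): the thirty-seventh tranche (`Consumers37`: the TAÏBI BLOCK of printed witnesses — C197 Taïbi 2025/26 (the
Euler characteristic of ℓ-adic local systems on 𝒜_n; GSpin-valued Galois representations for level-one Siegel eigenforms;
v1 of 2025-10-01 without, v2 of 2026-01-12 with the « Disclaimer » naming « the (standard and non-standard) weighted
fundamental lemma ») ⇐ book ∧ the inner-form stabilisation node ∧ B1 ∧ C3 (both starred classes) ∧ C4 ∧ C5 ∧ C6; C198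
Canning – Petersen – Taïbi 2026 (low-degree cohomology of compactifications of A_g; same Disclaimer) ⇐ book ∧ B1 ∧ C3 ∧
C4 ∧ C5 ∧ C6 ∧ C197; `Implications37`; bookkeeping theorems); v4 (unit `pub-arthur-down-g59`, 2026-08-25) = SUPPLEMENT, docstring wording only —
no declaration, statement or proof changed: the printed locators of B19's §3.3 remark and §2.4 (arXiv v2 PDF text, PASS 14 of unit `pub-arthur-down-g58`) written
next to the corpus-TeX quotations of `E_AtobeGenericSpSO`, whose « [Ar] » / « [Mo] » are locator-less renderings.  Nothing of the first seven files is redeclared or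
changed.
-/
import HarnessLib
import Literature.NumberTheory.Automorphic.Arthur2013.Downstream7

/-!
# Downstream of Arthur (2013), Mok (2015), KMSW (2014): the typed register, eighth file (tranches ≥ 35)

**What is reproduced.**  As in the first seven files: for published theorems (here: four journal articles and one
arXiv preprint) that invoke J. Arthur, *The Endoscopic Classification of Representations* (AMS Colloq. Publ. 61,
2013) [cite: Arthur2013], C. P. Mok's memoir [cite: Mok2012] or Kaletha–Mínguez–Shin–White
[claim: KalethaMinguezShinWhite2014, under-review] as a black box — directly or through already-typed rows (C13
Liu – Tian – Xiao – Zhang – Zhu 2022 [cite: LiuEtAl2022], C19 Li – Liu 2021 [cite: LiLiu2021], C20 Disegni – Liu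
2024 [cite: DisegniLiu2024], C15 Beuzart-Plessis 2015 [cite: Beuzartplessis2015], C24 Beuzart-Plessis 2020
[cite: BeuzartPlessis2020Asterisque], B18 Gan – Ichino 2016 [cite: GanIchino2016]) —, one HYPOTHESIS `E_…` per
statement quoting the sentences in which the paper invokes the classification, recording WHICH outputs of the three
dependency DAGs and which typed rows the proof consumes; and bookkeeping theorems `…_of_leaves` composing these
hypotheses with the packaged inputs `BookInputs` / `MokInputs` / `KMSWInputs` of `Downstream.lean`, so that the
kernel displays the 2026 leaves each downstream theorem rests on.  Quotations are exact substrings of the texts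
staged with sha256 under `HOME/pub-arthur-down-g22/primaries/`: the cell's corpus texts `paper:arxiv-<id>` (TeX
renderings; chunk `pNNNN:Ln`) for B19, C147, C104 and the arXiv PDF texts (page `pNNNN:Ln`; ligature glyphs and
broken spacing of those texts reproduced as they stand, marked [sic] where a word is split) for C194, C146 and the
auxiliary text of Adrian – Henniart – Kaplan – Oi (arXiv:2305.09076v3) quoted under C147.  The book itself was NOT
held by the auditing cell: every « [Ar] », « [Art13] » inside a quotation is the downstream authors' citation.
Selection of consumers and the authors' conditionality wording: the cell's `DOWNSTREAM.md` blocks `[g3]` (B19),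
`[g5]` (C104, C146, C147) and `DOWNSTREAM2.md` blocks `[g21b]` (census row C194) and `[g22]` (this tranche).

**Why a thirty-fifth tranche (v1): the generic / newform line.**  Four consumers of Mok's memoir for the quasi-split
odd unitary group U_{2n+1} attached to an unramified quadratic extension E/F of p-adic fields, read and left untyped
by the predecessor seat (`GAPS.md` G-DN-236), and the 2017 uniqueness theorem they and row C104 lean on.  (i) B19
(Atobe, IMRN 2017): Theorem 3.1 — for a quasi-split classical G (unitary, symplectic, special orthogonal) over a
p-adic field, ASSUMING the local Langlands desiderata (Desideratum 2.1) and the intertwining relation (Desideratum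
2.3) for G, a 𝔴-generic [π] ∈ Π_φ corresponds under ι_𝔴 to the trivial character of 𝒮_φ (hence each L-packet has
at most one 𝔴-generic member); Theorem 2.4 / Remark 2.2: the desiderata « follow from Theorems 2.2.1 and 2.4.1 in
[Ar] when G = Sp(2n) or G = SO(m), and Theorems 3.2.1 and 3.4.3 in [Mo] when G = U(m) ».  The row is typed as TWO
fields — `AtobeGenericSpSO` ⇐ book (local theorems, all ranks: the proof for G uses the intertwining relation of a
LARGER group G' of the same type) and `AtobeGenericU` ⇐ Mok — so that its unitary consumers (C194, C104) do not
inherit the book's leaves through it.  Its text carries the census's flag (G-ii): « has been established by Arthur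
[Ar] and Mok [Mo] under some assumption on the stabilization of twisted trace formulas.  For this assumption, see
also the series of papers [Stab1], …, [Stab10] » (2015/2017), and a remark (§3.3) on the converse lemma of [Ar]
used by Arthur and Mok to prove the intertwining relation in the basic cases.  (ii) C194 (Atobe – Oi – Yasuda, Duke
Math. J. 173 (2024); the CONDUIT of the line): Theorem 1.1 (for tempered π of H = U_{2n+1}: (1) non-generic ⇒
π^{K_{m,H}} = 0 for all m; (2) generic ⇒ dim π^{K_{m,H}} = 0 for m < c(φ), = 1 for m = c(φ), ≠ 0 beyond), through
Theorem 4.1 = « [32, Theorem 3.2.1] » (Mok's tempered L-packets with the endoscopic character relation), Theorem 4.3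
(multiplicity one of K_{m,H}-fixed vectors in a tempered L-packet ⇐ the paper's own transfer theorem 1.2 = 2.5, an
Arthur-free fundamental-lemma statement proved there, ∧ Theorem 4.1 ∧ Jacquet–Piatetski-Shapiro–Shalika) and
Theorem 4.4 (K_{m,H}-spherical tempered π are generic ⇐ the local Gan–Gross–Prasad conj. « [9, Conj. 17.3] …
proven by Beuzart-Plessis [3, 4, 5] » ∧ « [32, Corollary 9.2.4] » ∧ « [1, Theorem 3.1] » = B19).  Of [3, 4, 5]:
[4] = Compositio Math. 151 (2015) = row C15 (entering under its own node `BPhyp`, as in rows B18, C108); [5] = Mém.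
Soc. Math. Fr. 149 (2016), the p-adic tempered multiplicity one in Vogan L-packets, which has no register row and is
routed — as for rows C60, C67, C107, C25 of tranche 34 — through C24, whose Theorem 12.4.1 restates and re-proves
it (C24 ⇐ Mok ∧ KMSW's proved scope: the Vogan packet runs over the pure inner forms); [3] = Canad. J. Math. 66
(2014), Arthur-free, absorbed.  Edge ⇐ Mok ∧ C15 ∧ C24 ∧ B19 (unitary case).  Status wording: « the local
Langlands correspondence established by Mok [32] » (no flag).  (iii) C146 (Cheng, arXiv:2207.02118v3, 2023;
PREPRINT): Theorem 1.2 (dim V_π^{K_{n,m}} = binom(⌊(m − a_π)/2⌋ + n, n) for EVERY irreducible generic π of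
U_{2n+1}(F)) ⇐ « [AOY22, Theorem 1.2] » and « the proofs of [AOY22, Theorems 4.3, 4.4] » for tempered π, the
standard module conj. (Casselman–Shahidi, Muić) and double-coset computations beyond; Theorem 1.4 (Rankin–Selberg
integrals of newforms, UNDER the paper's Assumption 1.3 on γ-factors; Λ(v_π) ≠ 0 for tempered π via the GGP argument
of [AOY22, Theorem 4.4]); the L-parameter φ_π « by results of Mok ([Mok15]) and Gan-Gross-Prasad ([GGP12, Theorem
8.1]) ».  Edge ⇐ Mok ∧ C194.  No status sentence.  (iv) C147 (Cheng – Wang, Pacific J. Math. 337 (2025)): Theorem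
1.1 γ^{LS}(s, π × τ, ψ) = γ^{WD}(s, π × τ, ψ) for generic π of U_{2n+1}(F), τ of GL_r(E), F any local field of
characteristic 0 (Theorems 1.2–1.4: γ^{RS} = γ^{LS} and multiplicativity, F non-archimedean) — γ^{WD} being DEFINED
through the L-parameter « ( [Mok2015], [Tate1979]) » and computed through the standard base change BC(π); proof by
globalisation (« the construction of Gan-Ichino in [GanIchino2016] … relies on the results of Shin ( [SWShin2012])
and Mok ( [Mok2015]) »), the global base change « ( [CPSS2011], [Mok2015]) », and the compatibility of Mok's
correspondence with the unramified and real ones « by the works of Shelstad …, Mezo … and … Adrian-Henniart-Kaplan-Oi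
( [AHKO]) ».  [AHKO] = arXiv:2305.09076 is the register's row B58 (typed for split SO_N ⇐ book); what C147 uses is
its Appendix « Unramified case of Arthur's classification theorem » in the UNITARY case, stated there from « [Mok15,
Theorems 2.5.1 and 3.2.1] » — inheritance = Mok's, already the premise; B58's field (a statement on split SO_N) is
NOT bound.  Likewise the Gan–Ichino globalisation is a construction inside the proofs of row B18's paper, not its
typed Theorem 1.3: absorbed, inheritance = Mok's.  Edge ⇐ Mok.  No status sentence (« we hope this article, despite
its incomplete results, can serve as a convenient reference » refers to the archimedean restrictions).  (v) C104
(Disegni, J. Number Theory 270 (2025), « largely expository »): Theorem 1 — for a conjugate-symplectic, automorphic,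
geometric ρ : G_E → GL_n(ℚ̄_p) of weight −1, even n, minimal regular Hodge–Tate weights, F ≠ ℚ, UNDER the paper's
Hypothesis 4.? (hyp coh) (« a special case of [LL] … expected to be confirmed in a sequel to [KSZ] ») and Hypothesis
(hyp mod) (Kudla's modularity, « implied by the variant for Chow groups of [LL] »): Part 1 the construction (Λ_ρ,
Θ_ρ : Λ_ρ → H¹_f(E, ρ)); Part 2 (under Conj. (ass infty), resp. ordinarity hypotheses) ord L = 1 ⇒ Θ_ρ ≠ 0, from
the height formulas Theorem 17 = « essentially reformulations of … Li and Liu [LL, LL2], and … [DL] »; Part 3 (large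
image: Θ_ρ ≠ 0 ⇒ dim H¹_f = 1) = « the subject of [D-euler] » (in preparation; NOT covered by the typed field).
Inputs with register rows: « injective by [Mok] » (BC_v on tempered L-packets of the quasi-split G_v = U(W)_v) and
« By [DL] (based on [Mok]) » = C20; « the explicit description given for instance in [LTXZZ] » = C13 (its
Proposition « Results from the endoscopic classification »); [LL] = C19 (Hypothesis (hyp coh) is a case of its
set-up; the height formula); « By [Varma, Ato] … each local L-packet of G_v contains a unique Ψ-generic
representation » — [Ato] = B19 (unitary case), [Varma] (Forum Math. 29 (2017), descent and the generic packet
conj.) absorbed; « consequences of [GI16] (which collects results from [GS12, GI14]) » for the local theta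
correspondence = B18 (its (P1), Prasad's conj., is the theta statement; [GI14] = row E47, a control row, untyped).
Edge ⇐ Mok ∧ C13 ∧ C19 ∧ C20 ∧ B18 ∧ B19 (unitary case); KMSW enters at second order only (C13, C19, C20 are typed
inside KMSW's PROVED scope; B18 likewise).  No status sentence on the classification.  Publication status 2026-08-20
(Crossref via `lit cite`, bibliography keys of the cell): B19 IMRN 2017 no. 23, 7051–7068 (online 2016); C194 Duke
Math. J. 173 (2024) no. 12; C147 Pacific J. Math. 337 (2025) no. 1, 25–85; C104 J. Number Theory 270 (2025)
68–95; C146 PREPRINT (arXiv v3 of 2023-03-16; cited « Preprint 2023 » in Forum Math. Sigma 13 (2025) = row C108; no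
Crossref record found).  The published versions were NOT compared with the arXiv texts read; C146's bibliography
prints AOY's arXiv number as « 2206.09151v1 » [sic: 2206.09515] and C15's pages as « 1307–1371 » [sic: 1309].

**v2: the thirty-sixth tranche (post-AGIKMS printed witnesses, I).**  The cell's `DOWNSTREAM.md` §F lists the status
sentences printed in 2025–26 after AGIKMS (F1 Taïbi, F2 Canning – Petersen – Taïbi, F3 Y. Cheng, F4 S.-Y. Chen); none of
their papers was typed.  This tranche types F3 and F4 and, with them, the 2022 flagged row B9 (Morimoto) of the same
Whittaker / formal-degree line; F1 and F2 (the Taïbi block: IH of A_g, many level-one inputs) are left to a later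
tranche; the prequel of F3 (Y. Cheng, arXiv:2510.03068, 2025: the UNIQUENESS part of Gross's newform conj. for SO_{2n+1},
Rankin–Selberg integrals and Jiang–Soudry's descent correspondence — the book cited once, for the L-parameter of a
generic π, beside [JiangSoudry2003/2004]) and Morimoto's 2024 preprint arXiv:2403.19166 (the Lapid–Mao formula for every
ψ_N-generic cuspidal representation of U(n), by Kim–Krishnamurthy's base change, Lapid–Mao's reduction and explicit
local descent — Mok's memoir cited only in a remark on non-generic members and in the conditional Corollary 1.1) are
recorded in the census as CONTROL rows E54, E55 (Arthur-free main theorems), not typed.  (i) C195 (Y. Cheng, arXiv: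
2605.15678, 2026; appendix §7 by C.-H. Lo; PREPRINT): Theorem 1.2 — if the space of newforms π^{K_{n,c_π}} is non-zero
for every irreducible generic supercuspidal representation of SO_{2n+1}(F) (F/ℚ_p finite), it is non-zero for every
irreducible generic representation —, through the reductions generic → square-integrable → « seed » → supercuspidal;
inputs: « the local Langlands correspondence for SO_{2n+1}(F), which was established by Arthur in [Arthur2013] in full
generality[Conditional on the twisted weighted fundamental lemma.] (see also [AGIKMS24]) » — THE STATUS FOOTNOTE (witness
F3) — while « we will mainly follow the correspondence established by Jiang–Soudry … compatible with Arthur's »; Atobe's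
Jacquet-module results « [Atobe2020] » = row B4 throughout §§4–6 (« The key to our computation is Atobe's paper
[Atobe2020] »); Lo's appendix: the component-group characters of tempered L-packets (the book), « unique by [AM23] » = row
B42 and « the highest-derivatives formula for tempered representations in [AGIKMS24] » — a 2024 PREPRINT statement
(arXiv:2410.13504v1, App. « Derivatives of tempered representations », which re-derives results of B. Xu and of row B4)
outside the three DAGs, typed as the node `AGIKMSderiv` with no supplier edge; Lemma 2.2 « follows word for word the one
in [AOY2024], except that, instead of using the … results of Beuzart-Plessis, we apply the results of Waldspurger » (row
C194's ARGUMENT, not its theorem — not bound; Waldspurger's local GGP for tempered SO takes its LLC hypotheses from the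
book, already the premise); [Xu2017] Manuscripta 154 (B2's family) and [Ato23] = row B89 (« see [Ato23] » for the notion
of extended cuspidal support, with an alternative) absorbed; [YCheng2025] = E54 (its Theorem 1.1 quoted as Theorem 1.1,
Arthur-free).  Edge ⇐ book ∧ B4 ∧ B42 ∧ node.  (ii) B9 (Morimoto, J. Inst. Math. Jussieu 21 (2022); census `[g2]`, FLAGGED
G-v): the field is Corollary 8.1 — the refined formal degree identity for EVERY discrete series σ ∈ Π_φ of U_{2n}^± —
stated « Assume that the local Langlands conj… holds for U_{2n}^± » and discharged by the preceding paragraph « the local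
Langlands conj… was established by Mok [Mok] for U_{2n}^+ and Kaletha–Minguez–Shin–White [KMSW] for U_{2n}^- with the
stabilization of the twisted trace formula established by Moeglin–Waldspurge [WMW1,WMW2] assuming the weighted fundamental
lemma for quasi-split groups, which is proved in Chaudouard–Laumon [CL] only in the split case » (THE FLAG, 2019/2022),
with Remark 8.1 « Atobe [At] give a precise proof that σ is generic if ⟨·,σ⟩ is trivial » = row B19 (unitary case); the
paper's Theorems 1.2–1.4 and Corollary 1.1 (the Lapid–Mao local identity c_π = ω_π(τ) for good / generic π at non-split
finite and real places, the refined formal degree for GENERIC discrete series) are obtained by explicit local descent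
(Lapid–Mao, Ichino–Lapid–Mao, Ginzburg–Rallis–Soudry, Kim–Krishnamurthy) WITHOUT the classification and are not part of
the field (recorded: Arthur-free; they are what E55 = Morimoto 2024 consumes).  Edge ⇐ Mok ∧ KMSW's proved scope
(discrete, hence tempered, parameters of the inner form U_{2n}^-) ∧ B19-U.  (iii) C196 (S.-Y. Chen, arXiv:2509.23940,
2025; PREPRINT): for GU_n attached to an imaginary quadratic 𝒦 and Π globally generic cuspidal with Π_∞ a C-algebraic
discrete series: Proposition 3.1 (every σ-conjugate ^σΠ is cuspidal automorphic and globally generic; Π_f is defined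
over 𝒦·ℚ(Π_f); ℚ(Π) = ℚ(Π_f) — multiplicity one of Π in the proof), Proposition 3.3
(the Lapid–Mao formula for Π from « [BPC2023] and Morimoto [Morimoto2024] » for U_n and « [LM2015] ») and Theorem 3.4 =
« Theorem (T: main 1) » (Aut(ℂ)-equivariance / algebraicity of L^S(1, Π, Ad₁) over the stated period, Π_∞ discrete series)
— « unconditional » in the abstract's sense (not subject to the Lapid–Mao conj.) —; Theorem 1.1 for a general quasi-split
G is stated « subject to the validity of the Lapid–Mao conj… » (recorded, not typed); inputs: « Arthur's endoscopic
classification for U_n(𝔸) due to Mok [Mok2015] subject to some results in unpublished preprints of Arthur. Recently,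
Atobe–Gan–Ichino–Kaletha–Mínguez–Shin [AGIKMS2024] have address these issues, making the endoscopic classification
conditional only on the twisted weighted fundamental lemma. » (THE FLAG, witness F4), « Arthur's multiplicity formula »
(twice), « Arthur's conj… for GU_n(𝔸) is not yet proved. Nonetheless … »; [BPC2023] = row C27; [Morimoto2024] = E55
and [LM2015] = row C173 (« At any rate, Arthur's work is not a prerequisite for the formulation », untyped), [Morimoto2022]
= B9's Arthur-free part, [LS2019] Labesse–Schwermer, [Kaletha2013], Harris, Soudry's descent, Clozel, Wallach — absorbed.
Edge ⇐ Mok ∧ C27.  Publication status 2026-08-20 (DataCite / Crossref): B9 J. Inst. Math. Jussieu 21 (2022) no. 4,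
1107–1161 (online 2021; key Morimoto2022LapidMao); C195, C196, E54, E55 PREPRINTS (keys Cheng2026SOnewformsReduction,
Chen2025AdjointL, Cheng2025SOnewformsUniqueness, Morimoto2024Whittaker).  The arXiv API was rate-limited (HTTP 429)
during the seat; author metadata from DataCite.  VoR of B9 NOT compared with the arXiv text.

**v3: the thirty-seventh tranche (post-AGIKMS printed witnesses, II: the Taïbi block).**  Witnesses F1 and F2 of the
cell's `DOWNSTREAM.md` §F.  (i) C197 (O. Taïbi, *The Euler characteristic of ℓ-adic local systems on 𝒜_n*, arXiv:
2510.00656; v1 2025-10-01 = the corpus TeX text `paper:arxiv-2510.00656`, 159 chunks; v2 2026-01-12 = the e-print source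
`IHAg.tex` held under `HOME/inputs/files/src/2510.00656/`, copied to this seat's `primaries/src-2510.00656v2/`; PREPRINT):
the typed field is the introduction's Theorems 1–6 with the tensor-product decomposition — Theorem 4 (= Theorem 4.7.2 of
v2, `theo:IH_explicit_crude`, the « Theorem 4.7.2 in [taibi_ecAn] » consumed by C198: the intersection cohomology of
the minimal compactification of 𝒜_n with coefficients in an irreducible representation of PGSp_{2n}, in level one, as
a sum over Arthur's level-one substitute parameters ψ = ψ_0 ⊕ … ⊕ ψ_r of Sp_{2n} of σ^{IH}_{ψ,ι} ⊗ ι(χ_{f,ψ})), Theorem 5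
(= 5.2.2: GSpin_{2n+1}-valued Galois representations for odd-orthogonal level-one parameters π[d] of regular algebraic
infinitesimal character), Theorem 6 (= 6.1.5, 6.1.6: SO_{4n}- and GSpin_{4n}-valued representations, under « n = 1, n
even, d even, or a regularity condition »), Theorem 7.1.3 (σ^{IH} is the tensor product of (half-)spin representations),
Theorem 2 (= Corollary 7.2.2: GSpin_{2n+1}-valued ℓ-adic Galois representations ρ^{GSpin}_{f,ι} for level-one Siegel
eigenforms of weight k_n ≥ n+1, « For n>2 … new »), Theorem 1 (|𝒜_n(𝔽_q)| polynomial for n ≤ 6, explicit, and the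
n = 7 formula with τ(p²)) and Theorem 3 (= 9.1.1: Bergström–Faber–van der Geer's genus-3 formula at the level of ℓ-adic
Galois representations); NOT in the field (Arthur-free, recorded): Theorem 7 (= Cor. 8.1.27, Euler characteristics of
GL_n via Franke) and Theorem 1.4.1 (= Thm 8.3.1, e_c in terms of e_IH, Morel–Pink–Franke).  Inputs: the BOOK — « Arthur
formulated and proved a spectral expansion [Arthur, Corollary 3.4.2 and Theorem 4.1.2] », the substitutes for global
parameters [§1.4], the multiplicity formula [Theorem 1.5.2] (« see [Taibi_dimtrace, Theorem 4.1.2] for the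
specialization to the everywhere unramified case »), [Theorem 1.5.3], [Lemma 4.4.1], for Sp_{2n} AND for SO_{4n} « up to
outer automorphism », refined in level one by the paper's Proposition 3.3.4; the stabilisation of the (untwisted) trace
formula [ArthurSTF1] for split groups (Theorem 3.2.2) and for the inner forms of PGSO_{4n} split at every prime
(Theorem 3.2.3, « deduced from the same references ») — the register's node `Consumers.StabInner`; [AMR] = B1 (« The main
result of [AMR] is equivalent to the assertion that » Arthur's packets at the real place are Adams–Johnson's); [ChRe] =
C3, used through starred results of both classes (its Propositions 4.9, 4.10 = the memoir's single-starred Sym² and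
tensor lifts in level one, 4.12 = the double-starred Λ^* lift; §3, §9; the UNSTARRED « elementary lifting result »
Proposition 4.4 for isogenous groups replaces B. Xu's similitude theory: « Instead of [Xu] we will give an ad hoc
argument »); [Taibi_dimtrace] = C4 (×25); [CheLan, Theorem 9.3.3] = C5 and [ChenevierTaibi, Theorems 3 and 4] = C6 (the
classification lists behind Theorem 1 and §§7–9).  Absorbed, with reasons: [Taibi_mult] = A3 (arguments and reviews
only: « By the same argument as in the end of the proof of [Taibi_mult, Theorem 4.0.1] », Example 3.2.3, Proposition
2.4.1 « an observation of Arthur »; A3 enters at second order through C3's double star); [TaiCC] = C167 (« The proof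
is almost identical to that of [TaiCC, Corollary 4.0.2] »); [KretShin_GSp], [KretShin_GSO] = C10, C11 (« strategy …
similar »); [Xu] = A7; [AGIKMS] (Disclaimer only); Kottwitz, Morel, Pink, Fujiwara, Franke, Faltings–Chai, Patrikis,
Conrad, Deligne, Weissauer.  Edge ⇐ book ∧ `StabInner` ∧ B1 ∧ C3* ∧ C3** ∧ C4 ∧ C5 ∧ C6.  STATUS SENTENCES: v1 has
NONE and twice says « unconditional » (abstract; §1.3.6 « our unconditional version of Kottwitz' conj. ») in the sense
« free of the Langlands group and of Arthur's conj. for GSp »; v2 adds §1.6 « Disclaimer » (IHAg.tex l.725-727, quoted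
in the edge docstring) = F1, the first downstream sentence in this register naming the NON-STANDARD weighted fundamental
lemma, and treating AGIKMS as achieved.  (ii) C198 (S. Canning – D. Petersen – O. Taïbi, *The low degree cohomology of
compactifications of A_g*, arXiv:2601.05888, v1 2026-01-09; corpus TeX `paper:arxiv-2601.05888`, 89 chunks; PREPRINT):
Theorems 1.3, 1.4 (= Thm 2.4: IH^k(A_g^{Sat}, 𝕍_λ) for k+|λ| ≤ 23, all g, with tables), 1.7 and Cor. 1.8 (toroidal
compactifications of X_{g,s}, k ≤ 23), 1.9, 1.10 (H^•(X̄_{g,s}), H^•(X_{g,s}) Tate iff s < c(g)), 1.11, 1.12 (Hodge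
structures, H^{k,0}), App. Theorem 7.1 ((𝔤,K)-cohomology « paraphrasing the proof of [arthur_unip] using Arthur's
endoscopic classification for Sp_{2g} and [AMR] »); inputs « The bulk of the work in proving (thm IH) is in prior work
of the third author [taibi_ecAn] » = C197 (×32: Theorem 4.7.2, Proposition 3.4.7, Remarks 4.3.6–7, Corollary 6.2.3),
the book and [AMR] = B1 directly (App. A/§7), [chenevierlannes] = C5 (Theorem 1.1 restated; « the case r_i=3 does not
occur »), [taibi] = C4 and [cheneviertaibi] = C6 (« perusing the tables »), [chenevierrenard] = C3 (« the three
automorphic lifts involved »; root numbers); [cg] = Chenevier–Gan arXiv:2510.21169 = census C100 (untyped) only in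
Remark (rem:higher_wt) beyond weight 23 — not bound; [AGIKMS], [chaudouard_laumon_wfl2] in the Disclaimer (p0006:
L31-33 = F2, same text as C197 v2).  Edge ⇐ book ∧ B1 ∧ C3* ∧ C4 ∧ C5 ∧ C6 ∧ C197.  Keys Taibi2025EulerCharacteristic,
CanningPetersenTaibi2026 (DataCite; @misc).  v2 numbering of C197 computed from the e-print's counters (`theo` numbered
within subsections) and confirmed at 4.7.2 / 4.3.6–7 by C198's citations.

**Deliberately not here.**  Any content of a node; any claim that a downstream theorem is true or false; the
downstream papers' own hypotheses (C146's Assumption 1.3; C104's Hypotheses (hyp coh), (hyp mod), Conj. (ass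
infty), the ordinarity and large-image assumptions; B19's Desiderata when read as hypotheses of its Theorem 3.1 —
the typed fields are the theorems AS DISCHARGED by the authors' Theorem 2.4 / Remark 2.2 from [Ar] and [Mo]) are
recorded in the docstrings, not typed as nodes; their published Arthur-free inputs (Jacquet–Piatetski-Shapiro–
Shalika, Reeder, Casselman–Shahidi, Muić, Shahidi's theory, Gan–Gross–Prasad 2012, Gan–Savin, Aizenbud–Gourevitch–
Rallis–Schiffmann, Harris–Kudla–Sweet, Kudla, Y. Liu, Ginzburg–Rallis–Soudry, Morimoto(–Soudry), Ben-Artzi–Soudry,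
Cogdell–Piatetski-Shapiro–Shahidi, Mezo, Shelstad, Lemaire–Mœglin–Waldspurger, Kottwitz–Shelstad, Konno, Varma,
Beuzart-Plessis 2014), absorbed; no Mathlib, no `axiom`, no `sorry`, no `opaque`.  Exact leaf supports (the « only
if » half) are left to `DownstreamSupport4.lean` (§38; v2's to its §39; v3's to its §40).
-/

set_option autoImplicit false

namespace Literature.NumberTheory.Automorphic.Arthur2013

namespace Downstream

/-! ## Thirty-fifth tranche (v1, unit `pub-arthur-down-g22`): the generic / newform line — B19 (two fields), the
conduit C194, C146, C147, C104

Context (`DOWNSTREAM.md` rows B19 `[g3]`, C104, C146, C147 `[g5]`; census row C194 `DOWNSTREAM2.md` `[g21b]`; this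
tranche `DOWNSTREAM2.md` block `[g22]`; texts staged under `HOME/pub-arthur-down-g22/primaries/`).  (i) B19: Theorem
3.1 (p0009:L7-12) under Desiderata 2.1 (p0006:L8) and 2.3 (p0007:L44); discharged from
[Ar] / [Mo] by Theorem 2.4 (p0007:L58-61) and Remark 2.2 (p0006:L103-106); the flag p0005:L5-9; the remark
§3.3 (p0010:L20-45).  Edges: Sp/SO field ⇐ book; U field ⇐ Mok.  (ii) C194: Theorem 1.1 (p0002:L18-27), Theorem
1.2 = 2.5 (p0003:L36; Arthur-free), Theorem 4.1 « ([32, Theorem 3.2.1]) » (p0019:L31), Theorem 4.3 (p0019:L56), Theorem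
4.4 (p0021:L9); Mok at p0003:L41, p0021:L7, L29; Beuzart-Plessis [3, 4, 5] at p0002:L29, p0021:L22;
[1] = B19 at p0021:L7.  Edge ⇐ Mok ∧ C15 ∧ C24 ∧ B19 (U).  (iii) C146: Theorem 1.2 (p0003:L3), Theorem 1.4 under
Assumption 1.3 (p0004:L11, L2); Mok at p0002:L33, L63, p0018:L91; [AOY22] = C194 at p0003:L16,
p0018:L97, p0026:L32.  Edge ⇐ Mok ∧ C194.  (iv) C147: Theorems 1.1–1.4 (p0003:L26, L45, L68, L95); Mok at
p0003:L15, L37, p0010:L109, L126, p0011:L8; [GanIchino2016] at p0010:L82; [AHKO] at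
p0010:L126.  Edge ⇐ Mok.  (v) C104: Theorem 1 (p0003:L9-36); Mok at p0006:L2, p0008:L70; [LTXZZ] = C13 at p0006:L8; [DL] = C20 at
p0008:L70, p0009:L89, p0013:L12; [LL] = C19 at p0009:L14, L69, p0013:L16; [Varma, Ato] at p0006:L26; [GI16] = B18 at
p0006:L79.  Edge ⇐ Mok ∧ C13 ∧ C19 ∧ C20 ∧ B18 ∧ B19 (U).  Status sentences: B19 as quoted (flag); the four others none
(grep conditional / weighted / not yet / stabiliz over each text: 0 hits on the classification). -/

/-- Further downstream statements (rows B19, C194, C146, C147, C104 of the cell's `DOWNSTREAM.md` / `DOWNSTREAM2.md`),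
as an arbitrary assignment of propositions; nothing about the content of a field is assumed.  Row B19 is split into
two fields by the type of the group. [cite: Arthur2013, downstream register of the cell, thirty-fifth tranche (structure only)] -/
structure Consumers35 where
  /-- B19, SYMPLECTIC–ORTHOGONAL CASE: H. Atobe, *On the uniqueness of generic representations in an L-packet*, Int. Math. Res. Not. IMRN 2017 no. 23, 7051–7068, doi:10.1093/imrn/rnw220 (online 2016; corpus TeX `paper:arxiv-1511.08897`) [cite: Atobe2017GenericUnique, Thm 3.1 (p0009:L7-12) with Thm 2.4 (p0007:L58-61) and Rem. 2.2 (p0006:L103-106), for G = Sp(2n), SO(m)]: p0009:L8-12 "Let $G$ be a quasi-split classical group. Assume Desiderata (des) and (IR) for $G$. For $\phi \in \Phi(G)$, if $[\pi] \in \Pi_\phi$ is $\w$-generic, then $\iota_\w([\pi])$ is the trivial representation of $\Sch_\phi$." — read for G a symplectic or quasi-split special orthogonal group over a non-archimedean local field F of characteristic zero (for SO(2n) the classes [π] are taken modulo the outer conjugation ∼_ε, p0005:L157 "In [Ar], one has parametrized not $\Irr(\SO(2n, F))$ but $\Irr(\SO(2n, F))/\sim_\ep$."), the Desiderata being supplied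 by p0007:L59-60 "The intertwining relation (Desideratum (IR)) follows from Theorems 2.2.1 and 2.4.1 in [Ar] when $G=\Sp(2n)$ or $G=\SO(m)$,"[…] and p0006:L104-106 "Arthur [Ar] and Mok [Mo] have established the local Langlands correspondence for tempered parameters, i.e., Desideratum (des) (2), (3) and (4). Using (5) and the Langlands classification, we may obtain (1)."; i.e. the statement (Desideratum 1.1, p0003:L47-50) p0003:L48-50 "Let $\phi \in \Phi(G)$. If $\pi \in \Pi_\phi$ is $\w$-generic, then $\iota_\w(\pi)$ is the trivial representation of $\Sch_\phi$." for these G — p0003:L52 "Desideratum (unique0) asserts that each $\Pi_\phi$ has at most one $\w$-generic representation." -/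
  AtobeGenericSpSO : Prop
  /-- B19, UNITARY CASE: the same Theorem 3.1 [cite: Atobe2017GenericUnique, Thm 3.1 (p0009:L7-12) with Thm 2.4 (p0007:L58-61), for G = U(m)] read for G = U(m) a quasi-split unitary group attached to a quadratic extension E/F of non-archimedean local fields of characteristic zero, the Desiderata being supplied by p0007:L61 "and Theorems 3.2.1 and 3.4.3 in [Mo] when $G=\U(m)$." (with p0007:L59 "The intertwining relation (Desideratum (IR)) follows from"): each L-packet Π_φ of U(m)(F) has at most one 𝔴-generic member, and it corresponds under ι_𝔴 to the trivial character of 𝒮_φ. -/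
  AtobeGenericU : Prop
  /-- C194 (CONDUIT row of the tranche): H. Atobe – M. Oi – S. Yasuda, *Local newforms for generic representations of unramified odd unitary groups and the fundamental lemma*, Duke Math. J. 173 (2024) no. 12, doi:10.1215/00127094-2023-0057 (arXiv PDF text `paper:arxiv-2206.09515`, v1 of 2022-06-20; broken spacing as extracted) [cite: AtobeOiYasuda2024, Thm 1.1 (p0002:L18-27) with Thms 4.1, 4.3, 4.4 (p0019:L31-46, L56-63; p0021:L9)]: for E/F an unramified quadratic extension of non-archimedean local fields of characteristic 0 and residue characteristic p > 2, H = U_{2n+1} the quasi-split unitary group in 2n+1 variables and the compact open subgroups K_{m,H} (m ≥ 0) of p0002:L2-16: p0002:L18 "Theorem 1.1. Letπ be an irreducible tempered representation of H." [sic] / p0002:L19 "(1) If π is not generic, then πKm,H = 0 for all m≥ 0." / p0002:L20-21 "(2) Suppose that π is generic. We denote by c(φ) the conductor of the L-parameterφ of π (see Section 4.2). Then" [sic] "Then" dim(π^{K_{m,H}}) = 0 if m < c(φ), = 1 if m = c(φ); p0002:L26-27 "Moreover, if m>c (φ), then πKm,H ̸= 0. We call a nonzero element in πKc(φ ),H a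 local newform of π." [sic].  With Theorem 4.3 (p0019:L56 "Theorem 4.3. Forφ∈ Φ temp(H), we have" [sic] Σ_{π ∈ Π_φ} dim(π^{K_{m,H}}) = 0 if m < c(φ), = 1 if m = c(φ); p0019:L63 "Moreover, if m>c (φ), then the left hand side is nonzero.") and Theorem 4.4 (p0021:L9 "Theorem 4.4. Letπ∈ Irrtemp(H). If πKm,H ̸= 0 for some m≥ 0, then π is generic." [sic]).  The paper's second main theorem, Theorem 1.2 = Theorem 2.5 (p0007:L44 "Theorem 2.5. Suppose that N is odd. For m > 0, the function vol(Km,H ;dh)−11Km,H ∈" [sic] […] "is a transfer of" vol(K_m; dg)^{-1} 1_{K̃_m} — a fundamental-lemma statement for the congruence subgroups K_m, proved in the paper from Kottwitz and linear algebra), takes nothing from the three DAGs and is part of the field only as an ingredient of Theorem 4.3. -/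
  AOYnewforms : Prop
  /-- C146: Y. Cheng, *Local newforms for generic representations of unramified U_{2n+1} and Rankin–Selberg integrals*, arXiv:2207.02118v3 (2023-03-16; PREPRINT — cited « Preprint 2023 » in Forum Math. Sigma 13 (2025); no journal record found 2026-08-20) (arXiv PDF text `paper:arxiv-2207.02118`) [cite: Cheng2022Newforms, Thm 1.2 (p0003:L3-8) and Thm 1.4 under Assumption 1.3 (p0004:L2-4, L11-18)]: in the setting of C194 (F/ℚ_p finite, p > 2, E/F unramified, K_{n,m} = AOY's K_{m,H}, a_π the exponent of the ε-factor of φ_π, (1.1) p0002:L37): p0003:L3 "Theorem 1.2. Let (π, Vπ) be an irreducible generic representation of U2n+1(F ). Then we have 1" [sic: footnote mark] dim_ℂ V_π^{K_{n,m}} = binom(⌊(m − a_π)/2⌋ + n, n) p0003:L8 "for every integer m ≥ 0." — for EVERY irreducible generic π, tempered or not; and, under p0004:L2 "Assumption 1.3. Suppose that 1 ≤r ≤n. Then" p0004:L3 "γδ(s,π ×τ,ψF ) =γ(s,φπ ⊗φJ(τ ),ψE)" p0004:L4 "whereφJ(τ ) is the L-parameter of J(τ ) under the local Langlands correspondence of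 GLr(E)." (the Rankin–Selberg γ-factor equals the Galois-side one, 1 ≤ r ≤ n), Theorem 1.4: p0004:L11-12 "Theorem 1.4. Let (π, Vπ) be an irreducible generic representation of U2n+1(F ) and ﬁx a non-zero Whittaker functional Λπ,ψE on Vπ as well as a basis vπ of VKn,aπ" [sic] […] "Then under the Assumption 1.3," Ψ_{n,r}(v_π ⊗ ξ^{a_π}_{τ,s}) = L(s, φ_π ⊗ φ_{J(τ)}) / L(2s, φ_{J(τ)}, As) · Λ_{π,ψ_E}(v_π) p0004:L17 "provided that the Haar measures are suitably chosen (cf. §7.1). Here As stands for the Asai representation 2" [sic] […] "Moreover, if π is tempered, then Λπ,ψE (vπ) is non-zero." (and the oldform bases / integrals of §§5, 7 under the same assumption). -/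
  ChengNewforms : Prop
  /-- C147: Y. Cheng – C.-J. Wang, *On gamma factors of generic representations of U_{2n+1} × Res_{E/F} GL_r*, Pacific J. Math. 337 (2025) no. 1, 25–85, doi:10.2140/pjm.2025.337.25 (corpus TeX `paper:arxiv-2311.15323`) [cite: ChengWang2025, Thms 1.1–1.4 (p0003:L26-33, L45-52, L68-84, L95-105)]: for F a local field of characteristic zero, E an F-algebra of rank 2, U_N ⊂ G_N = Res_{E/F} GL_N a quasi-split unitary group, π and τ irreducible generic representations of U_{2n+1}(F) and G_r(F) (n ≥ 0, r ≥ 1), and the γ-factors γ^{WD} (through the associated Weil–Deligne representation), γ^{LS} (Langlands–Shahidi), γ^{RS} (Rankin–Selberg integrals of Ben-Artzi–Soudry, Morimoto–Soudry): p0003:L26-27 "Theorem 1.1. We have" γ^{LS}(s, π × τ, ψ) = γ^{WD}(s, π × τ, ψ); p0003:L45-46 "Theorem 1.2. Suppose that $F$ is non-archimedean. Then we have" γ^{RS}(s, π × τ, ψ) = γ^{LS}(s, π × τ, ψ); Theorem 1.3 (p0003:L69-72 "Suppose that $F$ is non-archimedean. Then if $\pi$ is the generic quotient of the representation of $\U_{2n+1}(F)$,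 which is parabolically induced from an irreducible generic representation $\sigma\boxtimes\pi_0$ of $\G_k(F)\x\U_{2n_0+1}(F)$ for some integers $k\ge 1$ and $n_0\ge 0$ such that $k+n_0=n$, then" γ^{RS}(s, π × τ, ψ) = γ^{RS}(s, π₀ × τ, ψ) γ^{WD}(s, σ × τ₁, ψ) γ^{WD}(s, σ̃ × τ₂, ψ) […]) and Theorem 1.4 (p0003:L96-98 "Suppose that $F$ is non-archimedean. Then if $\tau$ is the generic quotient of the induced representation of $\G_r(F)$, which is parabolically induced from an irreducible generic representation $\tau'\boxtimes\tau''$ of $\G_{r'}(F)\,\x\,\G_{r''}(F)$ for some integers $r'>0$ and $r''>0$ such that $r'+r''=r$, then" γ^{RS}(s, π × τ, ψ) = γ^{RS}(s, π × τ', ψ) γ^{RS}(s, π × τ'', ψ)) — the multiplicativity in each variable; partial archimedean results in the body (P:main'). -/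
  ChengWangGamma : Prop
  /-- C104: D. Disegni, *Theta cycles and the Beilinson–Bloch–Kato conj…s* (title word abbreviated; exact title in the line comment below), J. Number Theory 270 (2025) 68–95, doi:10.1016/j.jnt.2024.04.001 (corpus TeX `paper:arxiv-2303.17817`; « largely expository », p0003:L3) [cite: Disegni2025Theta, Thm 1 Parts 1–2 (p0003:L9-32) with Def. 13 (p0009:L105-p0010:L6), Props 7, 9, 11 (p0006:L20-22, L45-56; p0007:L37-43) and Thm 17 (p0012:L65-80)]: p0003:L9 "Theorem 1. main Let $E$ be a CM field with Galois group $G_{E}$, and let" ρ : G_E → GL_n(ℚ̄_p) p0003:L13 "be an irreducible, geometric Galois representation of weight $-1$ and even dimension $n$. Suppose that $\rho$ is conjugate-symplectic, automorphic, and has minimal regular Hodge–Tate weights." p0003:L15 "Assume that the maximal totally real subfield $F$ of $E$ is not $\Q$, and that Hypothesis (hyp coh) on the cohomology of unitary Shimura varieties and Hypothesis (hyp mod) on the modularity of generating series of special cycles hold." — Part 1: p0003:L17 "* The construction of (const) attaches to $\rho $ a pair $(\Lm_{\rho}, \Theta_{\rho})$, well-defined up to isomorphism, consisting of a $\Qpb$-line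 $\Lm_{\rho}$ together with a $\Qpb$-linear map" Θ_ρ : Λ_ρ → H¹_f(E, ρ), p0003:L21 "whose image is spanned by classes of algebraic cycles." (Definition 13: for ε(ρ) = −1, Λ_ρ := (σ ⊗ π^∨ ⊗ ω)_{H(𝔸^∞) × G(𝔸^∞)} with π = π_ρ the Ψ-generic descent of Π_ρ to the quasi-split unitary group G = U(W) of even rank n = 2r (Proposition 7), (V, σ) the pair given by theta dichotomy (Propositions 9, 11), the arithmetic theta lifts Θ(φ, ϕ) ∈ H¹_f(E, M_σ) of §4.3); Part 2: p0003:L23 "* Suppose that $\rho$ is `mildly ramified' and crystalline at $p$-adic places." "Assume Conj"[…] (ass infty) "on the injectivity of certain Abel–Jacobi maps, and that $p$ is unramified in $E$." […] "Then" ord_{s=0} L_ι(ρ, s) = 1 ⟹ Θ_ρ ≠ 0, and "Suppose that $E/F$ is totally split above $p$, that $p>n$, and that for every place $w\vert p$ of $E$, the representation $\rho_{w}$ is Panchishkin–ordinary." […] "Then" ord_𝔪 L_p(ρ) = 1 ⟹ Θ_ρ ≠ 0 — both from the height formulas Theorem 17 (p0012:L65 "\par \theoname 17. \lb{ht f} Suppose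 that $ρ$ is mildly ramified and that it is crystalline at all $p$-adic places. Assume Hypotheses (hyp coh), (hyp mod)."[…]) which "are essentially reformulations of a breakthrough result of Li and Liu [LL, LL2], and of its $p$-adic analogue by Liu and the author [DL]."  NOT part of the field: Part 3 (p0003:L34 "* Assume that $\rho$ has `sufficiently large' image. Then" Θ_ρ ≠ 0 ⟹ dim H¹_f(E, ρ) = 1), which is "Part 3 is the subject of [D-euler]" ([D-euler]: « in preparation », p0014:L6-10; Theorem 18). -/
  DisegniTheta : Prop

variable (ν : Nodes) (μ : Mok2015.Nodes) (κ : KMSW2014.Nodes) (c : Consumers) (c₂ : Consumers2) (c₅ : Consumers5)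
  (c₆ : Consumers6) (c₃₃ : Consumers33) (c₃₄ : Consumers34) (c₃₅ : Consumers35)

-- Verbatim, kept out of docstrings by the docstring lint (sentences naming a conj.).  B19 (`paper:arxiv-1511.08897`,
-- corpus TeX; the rendering drops the optional arguments of \cite, so « [Ar] » below may stand for « [Ar, Lemma …] »):
-- the status sentence p0005:L3-9 p0005:L3-9 "The local Langlands correspondence (the local Langlands conjecture) for quasi-split classical groups has been established by Arthur [Ar] and Mok [Mo] under some assumption on the stabilization of twisted trace formulas. For this assumption, see also the series of papers [Stab1], [Stab2], [Stab3], [Stab4], [Stab5], [Stab6], [Stab7], [Stab8], [Stab9] and [Stab10].";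
-- p0003:L59-71 p0003:L59-64 "When $G$ is a quasi-split classical group, i.e., $G$ is a symplectic, special orthogonal or unitary group, the local Langlands conjecture is almost completely known by the recent works of Arthur [Ar] and Mok [Mo]. In this case, Desideratum (unique0) is a special case of the local Gan–Gross–Prasad conjecture [GGP]." / p0003:L65-67 "This conjecture, at least for tempered $L$-parameters, has been proven by Waldspurger [W1], [W2], [W3], [W4], Beuzart-Plessis [BP1], [BP2], [BP3], Gan–Ichino [GI], and the author [At]."
-- / p0003:L68-71 "Hence Desideratum (unique0) has already been established, but it is proven by long and complicated arguments after the results of Arthur [Ar], Mok [Mo] and Kaletha–Mínguez–Shin–White [KMSW]."; p0003:L81-83 p0003:L81-83 "Surprisingly, Desideratum (unique0) is a formal consequence from results of Arthur [Ar] and Mok [Mo], so that our proof is much shorter and simpler than before."; Desideratum 1.2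
-- (existence, NOT treated: p0003:L103-116) p0003:L103-105 "In this paper, we do not treat the existence of $\w$-generic representations, but we only state a desideratum for tempered $L$-parameters. The following are expected and called Shahidi's conjecture [Sh2]." / p0003:L112-116 "When $G$ is a quasi-split classical group, Arthur [Ar] and Mok [Mo] proved Desideratum (exist) by using a global argument. In addition, Kaletha [Ka] showed that $\Pi_\phi$ has a $\w'$-generic representation for any tempered $L$-parameter $\phi$ of $G$ and any Whittaker datum $\w'$ for $G$.";
-- bibliography p0011:L43-47 p0011:L44-47 "W. T. Gan, B. H. Gross and D. Prasad, Symplectic local root numbers, central critical $L$-values, and restriction problems in the representation theory of classical groups, Sur les conjectures de Gross et Prasasd. $\mathrm{I}$. Astérisque. No. 346 (2012), 1–109." [sic: « Prasasd »]; p0011:L16-20 p0011:L16-20 "[BP1] R. Beuzart-Plessis, La conjecture locale de Gross–Prasad pour les représentations tempérés des groupes unitaires, arXiv:1205.2987v2." [sic] (the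
-- Mémoire of row C24's line); [Ko] p0011:L92 "Twisted endoscopy and the generic packet conjecture,".
-- C194 (`paper:arxiv-2206.09515`, arXiv PDF text): p0002:L28-29 p0002:L28-29 "Theorem 1.1 (1) is an application of the local Gan–Gross–Prasad (GGP) conjecture ([9, Conjecture 17.3]) established by Beuzart-Plessis [3, 4, 5]. More precisely, if an irreducible" [sic] / p0002:L34 "HomH ′(π⊗π′, C)̸= 0 . In this situation, the local GGP conjecture tells us that π is generic." [sic];
-- p0021:L21-23 p0021:L19-23 "Let π∈ Irrtemp(H) be such that πKm,H ̸= 0 . We claim that there exists an irreducible tempered unramiﬁed representation π′ of H ′ such that HomH ′(π⊗π′, C)̸= 0 . If this claim were to be shown, by the local Gan–Gross–Prasad conjecture ( [9, Conjecture 17.3]) proven by Beuzart-Plessis [3, 4, 5], π would be uniquely determined by the L-parameters for π and π′. For the L-parameter for π′, see e.g., [9, Sections 10]. Since π′ is unramiﬁed, and since" [sic]; p0002:L47 p0002:L47 "The transfer conjecture, which is a consequence of the fundamental lemma ([43, 45]), says"[…] (background;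
-- Arthur-free); bibliography p0023:L55-58 p0023:L55-56 "[4] R. Beuzart-Plessis, Endoscopie et conjecture locale raﬃnée de Gan–Gross–Prasa d pour les groupes uni- taires. Compos. Math. 151 (2015), no. 7, 1309–1371." [sic] (= row C15) / p0023:L57-58 "[5] R. Beuzart-Plessis, La conjecture locale de Gross-Prasad pour les représentati ons tempérées des groupes unitaires. Mém. Soc. Math. Fr. (N.S.) 2016, no. 149, vii+191 pp." [sic] (the Mémoire,
-- routed through row C24); p0023:L62-64 p0023:L62-64 "[9] W. T. Gan, B. H. Gross and D. Prasad, Symplectic local root numbers, central critical L-values, and restriction problems in the representation theory of class ical groups. Sur les conjectures de Gross et Prasad. I. Astérisque No. 346 (2012), 1–109." [sic]; p0024:L12 p0024:L12-13 "[16] R. N. Harris, The reﬁned Gross–Prasad conjecture for unitary groups . Int. Math. Res. Not. IMRN 2014, no. 2, 303–389." [sic].  C146 (`paper:arxiv-2207.02118`): p0002:L58-59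
-- p0002:L57-59 "Let us brieﬂy point out the key ingredients in their ingenious proof. T o prove Theorem 1.1 (1), they applied the local Gan-Gross-Prasad conjecture ([GGP12]) established by Beuzart-Plessis ([BP14], [BP15], [BP16]) and the following property of Kn,m. If we put" [sic]; p0003:L17 p0003:L16-17 "1.2]). The next step is to extend (1.2) to non-tempered π; such π is isomorphic to a full induced representation of U 2n+1(F ) by the standard module conjecture (cf. [CS98], [Mui01]). Therefor e, our" [sic]; p0004:L29-31
-- p0004:L29-31 "[Miy13b], [Tsa13]). Here we take a diﬀerent approach which utilizes the Gan-Gross-Prasad conjecture as mentioned before. In fact, this is inspired by the proof of [AOY2 2, Theorem 1.1 (1)] which is also the reason for the temperedness assumption. However, the adv antage of our proof lies in its simplicity." [sic]; bibliography p0033:L15-18 p0033:L15-16 "[BP15] R. Beuzart-Plessis. Endoscopie et conjecture local e raﬃn´ ee de Gan–Gross–Prasad pour les groupes unitaires. Compositio Mathematica, 151(7):1307–1371, 2015." [sic: « 1307 »; = row C15] / p0033:L17-18 "[BP16] R. Beuzart-Plessis. La conjecture locale de Gross-P rasad pour les repr´ esentations temp´ er´ ees des groupes un itaires. M´emoires de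 la Soci ´et´e Math´ematique de France , (149):191 pp, 2016." [sic]
-- (the Mémoire).  C104 (`paper:arxiv-2303.17817`): exact title (chunk p0001) "Theta cycles and the Beilinson–Bloch–Kato conjectures"; p0003:L3 "The purpose of this largely expository note is to introduce the elements of the title and their relation to the Beilinson–Bloch–Kato (BBK) conjecture."[…];
-- Hypothesis (hyp mod) p0009:L69 p0009:L69 "The following conjecture asserts the modularity of the generating series, and from now on we will assume it holds. It is implied by the variant for Chow groups of [LL]; see Remark 4.6 \emph{ibid.} for comments on the supporting evidence."; Conj. (ass infty) p0012:L9
-- "In order to descend this pairing to Selmer groups, we need to assume a case of a standard conjecture on the injectivity of Abel--Jacobi maps."; [Varma]'s title p0016:L119 "title={On descent and the generic packet conjecture},"; [GI16]'s title p0014:L62 "title={The Gross-Prasad conjecture and local theta correspondence},"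
-- (= row B18); [LTXZZ]'s title p0015:L120 "title={On the Beilinson-Bloch-Kato conjecture for Rankin-Selberg motives}," (= row C13).  C147 (`paper:arxiv-2311.15323`): [GanIchino2016]'s title p0037:L110
-- "The Gross-Prasad conjecture and local theta correspondence." / "Inventiones Mathematiace, 206(3):705–799, 2016." [sic].

/-- B19 (Sp/SO case), the places the classification is invoked (`paper:arxiv-1511.08897`, corpus TeX).  THE BOOK — the local theorems for Sp(2n) and SO(m) of EVERY rank (the proof for G passes through the intertwining relation of the LARGER group G' ⊃ GL_k(E) × G of the same type, §2.4 p0006:L118-121 "We denote the unipotent radical of $B$ by $U$. Fix a positive integer $k$, and put $G'= \U(m+2k)$, $\Sp(2n+2k)$ or $\SO(m+2k)$ when $G= \U(m)$, $\Sp(2n)$ or $\SO(m)$, respectively."): §2 opening p0005:L5 "has been established by Arthur [Ar] and Mok [Mo]" / p0005:L6 "under some assumption on the stabilization of twisted trace formulas." (THE STATUS SENTENCE, the census's flag G-ii; full sentence with [Stab1]–[Stab10] in the line comment above); Remark 2.2 p0006:L104-106 "Arthur [Ar] and Mok [Mo] have established the local Langlands correspondence for tempered parameters, i.e., Desideratum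 (des) (2), (3) and (4). Using (5) and the Langlands classification, we may obtain (1)."; §2.4 p0007:L3-4 "Then Arthur [Ar] and Mok [Mo] have defined a normalized intertwining operator" R_{𝔴'}(w, τ ⊠ π) p0007:L10 "which depends on the Whittaker datum $\w'$ for $G'$."; p0007:L55-56 "The local Langlands correspondence established by Arthur and Mok satisfies the intertwining relation." / Theorem 2.4 p0007:L59-61 "The intertwining relation (Desideratum (IR)) follows from Theorems 2.2.1 and 2.4.1 in [Ar] when $G=\Sp(2n)$ or $G=\SO(m)$, and Theorems 3.2.1 and 3.4.3 in [Mo] when $G=\U(m)$." with, in its proof, p0007:L102 "By applying Theorems 2.2.1 (b) and 2.4.1 in [Ar] to $u$," and p0008:L18 "using the pairing of [Ar]."; the introduction p0003:L79-80 "The purpose of this paper is to give another proof of Desideratum (unique0) for quasi-split classical groups." / p0003:L84-87 "In our proof, we use two statements: One is an intertwining relation (Desideratum (IR)), which is a relation between a normalized self-intertwining operator on an induced representation and the local Langlands correspondence." / p0003:L88-90 "The other is Shahidi's result (Theorem (OR)), which describes the action of the intertwining operator on a canonical Whittaker functional on the induced representation.".  THE §3.3 REMARK (a caveat on circularity printed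 by the author; « [Ar] » = a lemma of the book whose number the rendering drops): p0010:L20 "Finally, we remark on [Ar]." / p0010:L21 "This lemma is the “converse” of our proof of Theorem (unique)." / p0010:L22-27 "Roughly speaking, this lemma asserts that when the residual characteristic of $F$ is not two, the uniqueness of generic representations in an $L$-packet (Theorem (unique)) for all proper Levi subgroups $M$ of $G$ implies that [Ar], which we use to prove the intertwining relation for $G$ (Theorem (IRproof))." [sic: rendering gap after « implies that »] / p0010:L28-32 "On the other hand, to prove Theorem (unique) for $G$, we used the intertwining relation for a bigger group $G'$, which has a Levi subgroup $M_P(F) \cong \GL_k(E) \times G(F)$. Therefore, in the cases when this lemma is used, one should give another proof of Theorem (unique) without the intertwining relation." / p0010:L34-36 "Arthur and Mok have applied [Ar] only to the basic cases [Ar] and [Mo], when the Levi subgroup $M$ is a torus or a product of torus and $\SL(2)$." / p0010:L37-40 "As noted in the proof of [Ar], Theorem (unique) has already been established for these basic cases. For tori, it is trivial since the component groups are always trivial. Hence one only treats $G=\SL(2)$." — THE PRINTED LOCATORS OF THIS REMARK (v4 supplement, unit `pub-arthur-down-g59`, from unit `pub-arthur-down-g58`'s PASS 14, `DOWNSTREAM5.md`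 §0ei, DIVERGENCE3 D-DN-g58-1 / D-DN-g59-2: the held corpus TeX drops the optional argument of every `\cite[…]{…}`, so the « [Ar] » / « [Mo] » above stand for numbered loci; the arXiv v2 PDF text staged by unit `pub-arthur-down-g53` as `arxiv-1511.08897v2/` under `HOME/pub-arthur-down-g53/primaries/` — pNNNN = PDF page, Ln = line, pypdf spacing kept — PRINTS): p0009:L2 "3.3.Remark. Finally, weremarkon[1, Lemma2.5.5]. Thislemmaisthe “converse”ofou rproofofTheorem" / p0009:L4-5 "of generic representations in an L-packet (Theorem 3.1) for all proper Levi subgroups MofGimplies that [1, Theorem 2.4.1], which we use to prove the intertwining relation for G(Theorem 2.4)." / p0009:L9-11 "Arthur and Mok have applied [1, Lemma 2.5.5] only to the basic cases [1 , Lemmas 6.4.1, 6.6.2] and [24, Proposition 7.4.3], when the Levi subgroup Mis a torus or a product of torus and SL(2). As noted in the proof of [1, Lemma 6.4.1], Theorem 3.1 has already been established fo r these basic cases." ([1] = the book, p0009:L17-18 "[1] J. Arthur, The endoscopic classiﬁcation of representations: Orthogo nal and symplectic groups ,American Mathematical Society Colloquium Publications ,61."; [24] = Mok's memoir, p0010:L2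 "[24] C. P. Mok, Endoscopic classiﬁcation of representations of q"): the lemma of the remark is the book's Lemma 2.5.5, what it implies is the local intertwining relation Theorem 2.4.1, the « basic cases » are the book's Lemmas 6.4.1 / 6.6.2 and Mok's Proposition 7.4.3; likewise the §2.4 loci print as p0005:L49 "[1,§2.3] and Mok [24, §3.3] have deﬁned a normalized intertwining operator" and p0007:L10-11 "by using the pairing of [1, Theorem" "2.2.4].".  No premise changes: every printed locus is a local statement of the book's Chapters 2 and 6, inside `Everything` at every rank as typed. […] p0010:L45 "This has been shown by Kottwitz–Shelstad (the end of 5.3 in [KS]).".  Bibliography p0011: p0011:L5-8 "[Ar] J. Arthur, The endoscopic classification of representations: Orthogonal and symplectic groups, American Mathematical Society Colloquium Publications, 61." (no year printed; = [cite: Arthur2013]) / p0011:L84-88 "[KMSW] T. Kaletha, A. Mínguez, S. W. Shin, and P.-J. White, Endoscopic classification of representations: inner forms of unitary groups, arXiv:1409.3731v3." (cited p0003:L71 for the GGP route only; no KMSW premise) / p0011:L79-82 "[Ka] T. Kaletha, Genericity and contragredience in the local Langlands correspondence, Algebra Number Theory 7 (2013), no. 10, 2447–2474." (Kaletha: existence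 for every Whittaker datum; Arthur-free given the packets, absorbed) / [Stab1] … [Stab10] = Waldspurger and Mœglin–Waldspurger, *Stabilisation de la formule des traces tordue* I–X, arXiv 2014 (p0011:L192, L127; the twisted stabilisation leaf family of the DAGs, cited as the locus of the « assumption »).  Premises: the book (local: LLC for tempered parameters with ι_𝔴, the packets of parabolically induced tempered representations, the normalised intertwining operators and the local intertwining relation — Theorems 1.5.1, 2.2.1, 2.4.1 —, all ranks).  Published Arthur-free inputs absorbed: Shahidi [Sh1], [Sh2] (Theorem 3.2, the canonical Whittaker functional), Rodier, Casselman–Shalika, Kottwitz–Shelstad 5.3 (SL(2)), Gan–Gross–Prasad 2012 (component groups). [cite: Atobe2017GenericUnique, §1 (p0003:L59-90), §2 (p0005:L3-9; p0006:L103-106, L118-121), §2.4 (p0007:L3-10, L55-61, L102; p0008:L18), §3.3 (p0010:L18-45)] -/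
def E_AtobeGenericSpSO : Prop := (∀ N, ν.Everything N) → c₃₅.AtobeGenericSpSO

/-- B19 (unitary case), the places Mok's memoir is invoked (`paper:arxiv-1511.08897`): the same sentences — p0005:L5 "has been established by Arthur [Ar] and Mok [Mo]" […], Remark 2.2 p0006:L104 "Arthur [Ar] and Mok [Mo] have established the local Langlands correspondence" p0006:L105 "for tempered parameters, i.e., Desideratum (des) (2), (3) and (4).", Theorem 2.4 p0007:L59 "The intertwining relation (Desideratum (IR)) follows from" […] p0007:L61 "and Theorems 3.2.1 and 3.4.3 in [Mo] when $G=\U(m)$." (Mok's Theorem 3.2.1 = tempered local packets, node of Mok's §3.2; Theorem 3.4.3 = the local intertwining relation), for G = U(m) and the larger groups G' = U(m+2k) of §2.4 (p0006:L120 "$G'= \U(m+2k)$, $\Sp(2n+2k)$ or $\SO(m+2k)$") — all ranks.  Bibliography p0011: p0011:L133-136 "[Mo] C. P. Mok, Endoscopic classification of representations of quasi-split unitary groups, Mem. Amer. Math. Soc. 235 (2015), no. 1108." (= [cite: Mok2012]).  Premises: Mok's memoir (local theorems, all ranks); no KMSW premise (quasi-split groups only; [KMSW] is cited for the earlier GGP-based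 proof, p0003:L68-71, not used).  Status sentence: the same flag as the Sp/SO field (« under some assumption on the stabilization of twisted trace formulas »). [cite: Atobe2017GenericUnique, §2 (p0005:L3-9; p0006:L103-106, L120), §2.4 (p0007:L58-61), bibliography p0011:L133-136] -/
def E_AtobeGenericU : Prop := (∀ N, μ.Everything N) → c₃₅.AtobeGenericU

/-- C194, the places the classifications are invoked (arXiv PDF text `paper:arxiv-2206.09515`; words split by the extraction are quoted as they stand).  MOK'S MEMOIR — the LLC for H = U_{2n+1} in which Theorem 1.1 is stated and proved: p0003:L40-41 "By this theorem, one can transfer a result in [18] on the local n ewforms for G = GL 2n+1(E) to the one for H = U 2n+1 via the local Langlands correspondence established by Mok [ 32]." [sic] / p0003:L42 "More precisely, one can prove the multiplicity one result in temperedL-packets (Theorem 4.3)." / p0003:L43 "Combining it with Theorem 1.1 (1), we obtain Theorem 1.1 (2)."; §4.1 p0019:L30 "The local Langlands correspondence for H is as follows." / p0019:L31-32 "Theorem 4.1 ([32, Theorem 3.2.1]) . For φ∈ Φ temp(H), there exists a ﬁnite subset Π φ of Irrtemp(H) such that" [sic] Irr_temp(H) = ⨆_φ Π_φ, p0019:L37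 "Moreover, Π φ is characterized by the endoscopic character relation" Θ_{π_φ,θ}(f) = Σ_{π ∈ Π_φ} Θ_π(f^H) p0019:L42-44 "for any f∈C ∞ c ( ˜G) and f H∈C ∞ c (H) such that f H is a transfer of f ." [sic]; in the proof of Theorem 4.3 p0020:L2 "Hence by Theorems 2.5 and 4.1, we have" (Theorem 2.5 = the paper's own transfer theorem; then « [18, (5.1) Théorème] » = Jacquet–Piatetski-Shapiro–Shalika and « [38, (2.2) Theorem 1] » = Reeder, p0020:L50, L77); §4.3 p0021:L6-7 "Recall that for φ∈ Φ temp(H), the L-packet Π φ contains a unique generic representation (see [32, Corollary 9.2.4] and [1, Theorem 3.1]). Now Theore m 1.1 follows from Theorem 4.3" [sic] (« [1, Theorem 3.1] » = ROW B19, unitary case; « [32, Corollary 9.2.4] » = Mok) / p0021:L8 "and the following result."; in the proof of Theorem 4.4 (the GGP sentences in the line comment above) p0021:L28-29 "1 is the conjugate dual of φ1. Using [9, Proposition 5.1 (2)] and [32, Corollary 9.2.4], we could conclude that π is generic." [sic].  BEUZART-PLESSIS [3, 4, 5] (the local GGP conj. for tempered parameters of unitary groups: multiplicity one in the Vogan L-packet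 and the ε-factor criterion): [4] = ROW C15 (Compositio Math. 151 (2015), the refined / endoscopic statement, typed under its own admitted-LLC node `BPhyp`), [5] = the Mémoire SMF 149 (2016) (multiplicity one in tempered Vogan packets of the pure inner forms, p-adic case) — no register row; ROUTED THROUGH ROW C24 (Astérisque 418, Theorem 12.4.1 restates and re-proves it for F p-adic or real ⇐ Mok ∧ KMSW's proved scope), as rows C60, C67, C107, C25 were —, [3] = Canad. J. Math. 66 (2014) (an integral formula for ε-factors of pairs; Arthur-free, absorbed); bibliography lines in the line comment above.  Bibliography p0024: p0024:L40-41 "[32] C. P. Mok, Endoscopic classiﬁcation of representations of quasi-spl it unitary groups . Mem. Amer. Math. Soc. 235 (2015), no. 1108, vi+248 pp." [sic] (= [cite: Mok2012]) / p0023: p0023:L49-50 "[1] H. Atobe, On the uniqueness of generic representations in an L-packet. Int. Math. Res. Not. IMRN 2017, no. 23, 7051–7068." (= row B19) / p0023:L53-54 "[3] R. Beuzart-Plessis, Expression d’un facteur epsilon de paire par une formule int égrale. Canad. J. Math. 66 (2014), no. 5, 993–1049." [sic] / p0023:L62 "[9] W. T. Gan, B. H. Gross and D. Prasad, Symplectic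 local root numbers, central critical L-values, and"[…] (Astérisque 346; full entry in the line comment above).  Premises: Mok's memoir (local: Theorem 3.2.1 tempered packets and character relations, Corollary 9.2.4 the generic member for the fixed Whittaker datum; all ranks 2n, 2n+1), row C15, row C24, row B19 (unitary case).  Status wording: « the local Langlands correspondence established by Mok [32] » (p0003:L41); no sentence on the status of the classification (grep conditional / weighted / stabiliz: the only hits are the paper's own fundamental-lemma discussion, p0002:L39-46).  Published Arthur-free inputs absorbed: Jacquet–Piatetski-Shapiro–Shalika [18], Reeder [38], Gan–Gross–Prasad [9] (Prop. 5.1, 5.2; the conj. as a statement), Gan–Savin [10, Lemma 12.5], R. N. Harris [16, Prop. 2.1], Kottwitz [20, 21], Kottwitz–Shelstad [23], Labesse, Clozel, Hales, Lemaire–Mœglin–Waldspurger, Waldspurger [43–45], Ngô [33] (background of §1; the paper's Theorem 2.5 is proved directly), Casselman, Lansky–Raghuram, Miyauchi, Tsai, Roberts–Schmidt. [cite: AtobeOiYasuda2024, §1 (p0002:L28-35; p0003:L40-43), §4.1 (p0019:L30-46), §4.2 (p0019:L55-63; p0020:L2), §4.3 (p0021:L6-9, L19-29), bibliography p0023:L49-58,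 p0024:L40-41] -/
def E_AOYnewforms : Prop :=
  (∀ N, μ.Everything N) → c₆.BPggp15 → c₃₄.BPlocalGGP → c₃₅.AtobeGenericU → c₃₅.AOYnewforms

/-- C146, the places the classifications are invoked (arXiv PDF text `paper:arxiv-2207.02118`, v3).  MOK'S MEMOIR (the L-parameter φ_π of an irreducible representation of U_{2n+1}(F), in which a_π, Theorem 1.2 and Assumption 1.3 are stated): p0002:L33-35 "Let π be an irreducible complex representation of U 2n+1(F ). Then by results of Mok ([Mok15]) and Gan- Gross-Prasad ([GGP12, Theorem 8.1]), one can attached to π an (2n + 1)-dimensional conjugate -orthogonal complex representation φπ of the Weil-Deligne group of E. Let ǫ(s,φπ,ψE) denotes the ǫ-factor attached to" [sic] / p0002:L36 "φπ and ψE (cf. [Tat79]). Then since ψE is unramiﬁed and trivial on F , it can be written as" […] (1.1) ε(s, φ_π, ψ_E) = q_E^{−a_π(s − 1/2)} p0002:L39 "for some integer aπ ≥ 0 (cf. [GGP12, Proposition 5.2 (2)]). Now their results can be stated as follow."; on AOY's proof p0002:L63-65 "vector. To prove Theorem 1.1 (2), they applied the endoscopy cha racter relation established by Mok ([Mok15])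 as well as the theory of local newforms established by Jacquet et a l ([JPSS81]). For this, they proved an analogue of the fundamental lemma for the open compact subgrou ps Kn,m." [sic]; §4.2 (proof of Theorem 1.2) p0018:L11-14 "m+1) ○I ○ Π ) /p⊗renleft.⊗lt4ωm+1 /p⊗renleft.⊗lt4a−1 1/p⊗renright.⊗lt4ω−1 m /p⊗renright.⊗lt4Π (ωm)v/divides.⊗lt0det(a)/divides.⊗lt0 1" [sic] […] p0018:L17-18 "f (a)Π ⎛ ⎝ω−1" [sic] dim_ℂ V_π^{K_{n,m}} = tr(I; V_Π^{K̃_{2n+1,m}}) p0018:L23 "(ω−1".  ROW C194 ([AOY22]): p0001:L36-38 "1.1. Results of Atobe-Oi-Y asuda. In a recent preprint [AOY22], Atobe-Oi-Yasuda extended Miyauchi’s result and established the theory of local newforms for irreducible tempered generic representations of unram- ﬁed U 2n+1 over non-archimedean local ﬁelds. To state their results, let F be a ﬁnite ﬁeld extension of Qp with" [sic]; Theorem 1.1 restated as « Theorem 1.1 (Atobe-Oi-Yasuda) » (p0002:L40); p0003:L14-16 "(2) The proof of Theorem 1.2 consists of two steps. The ﬁrst step is to obtain (1.2) when π is tempered,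 which follow from the results of Reeder ([Ree91, Theorem 1]) and Ato be-Oi-Yasada ([AOY22, Theorem 1.2]). The next step is to extend (1.2) to non-tempered π; such π is isomorphic to a full induced" [sic: « Yasada »; « [AOY22, Theorem 1.2] » = AOY's transfer theorem] […]; in the proof of Lemma 7.2 (Λ_{π,ψ_E}(v_π) ≠ 0 for tempered π) p0026:L6-7 "/integr⊃l.dispRr,m f (tk)δ−1" / p0026:L15-16 "/br⊗celeft.⊗lt1diag(y1,...,y n, 1, ¯y−1 n ,..., ¯y−1" [sic] — and through AOY's Theorem 4.4 the Beuzart-Plessis inputs of row C194 (the GGP sentences in the line comment above; [BP15] = row C15, [BP16] = the Mémoire routed through row C24, [BP14] Arthur-free).  Bibliography p0033–p0034: p0034:L10-11 "[Mok15] C.P. Mok. Endoscopic classiﬁcation of representations of quasi-spl it unitary groups , volume 235. Memoirs of the Amer- ican Mathematical Society, 2015." [sic] (= [cite: Mok2012]) / p0033:L7-8 "[AOY22] H. Atobe, M. Oi, and S. Yasuda. Local newforms for gen eric representations of unramiﬁed odd unitary groups and fundamental lemma. arXiv:2206.09151v1, 2022." [sic: AOY's arXiv number is 2206.09515] (= row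 C194, [cite: AtobeOiYasuda2024]) / p0033:L34-35 "[GGP12] W. T. Gan, B. Gross, and D. Prasad. Symplectic local r oot numbers, central critical L values, and restriction problems in the representation theory of classical groups. Ast´lerisque, (346):1–109, 2012." [sic].  Premises: Mok's memoir (local LLC for U_{2n+1}, all ranks), row C194 (itself ⇐ Mok ∧ C15 ∧ C24 ∧ B19).  No status sentence (grep conditional / weighted / stabiliz / Arthur: 0 hits; the word « Arthur » does not occur).  The paper's own Assumption 1.3 (γ^{RS} = γ^{WD} for 1 ≤ r ≤ n — the statement row C147 later proves in the non-archimedean case, p0004:L1-13 of `paper:arxiv-2311.15323`: « Our primary motivation … is rooted in our desire to eliminate the assumption made in [YCheng2] ») is recorded, not typed.  Published Arthur-free inputs absorbed: Reeder [Ree91], Jacquet–Piatetski-Shapiro–Shalika, Casselman–Shahidi [CS98] and Muić [Mui01] (standard module conj. for these groups), Roberts–Schmidt, Miyauchi, Ben-Artzi–Soudry [BAS09], Ginzburg–Rallis–Soudry, Morimoto–Soudry, Gan–Savin [GS12, Lemma 12.5], Aizenbud–Gourevitch–Rallis–Schiffmann and Gan–Gross–Prasad (multiplicity one of the Hom space,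 Appendix), Tate. [cite: Cheng2022Newforms, §1.1 (p0001:L36-38; p0002:L33-39, L57-65), §1.2 (p0003:L14-16), §4.2 (p0018:L10-23), §7 (p0026:L6-16), bibliography p0033:L7-8, p0034:L10-11] -/
def E_ChengNewforms : Prop := (∀ N, μ.Everything N) → c₃₅.AOYnewforms → c₃₅.ChengNewforms

/-- C147, the places the classifications are invoked (`paper:arxiv-2311.15323`, corpus TeX).  MOK'S MEMOIR — (a) the DEFINITION of γ^{WD}: p0003:L15 "* (WD) the associated Weil-Delinge representation ( [Mok2015], [Tate1979]);"; §2.1 p0006:L67-68 "Suppose that $\pi$ (resp. $\tau$) is an irreducible representations of $\U_N(F)$ (resp. $\G_M(F)$) whose $L$-parameter is $\phi$ (resp. $\eta$), and that $\psi$ is a non-trivial additive character of $F$. Then we have" γ^{WD}(s, π × τ, ψ) = γ(s, ι(φ ⊗ η), r, ψ), and through the standard base change p0006:L90-92 "Now let $\pi$ be an irreducible generic representation of $\U_N(F)$ with the $L$-parameter $\phi$, ${\rm BC}(\pi)$ be the standard base change of $\pi$, which is an irreducible representation of $\GL_N(E)$ with the $L$-parameter $\phi_E$, and $\tau$ be an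 irreducible generic representation of $\G_M(F)=\GL_M(E)$." […] γ^{WD}(s, π × τ, ψ) = λ_{E/F}(ψ)^{NM} γ^{WD}(s, BC(π) × τ, ψ_E); (b) the PROOF of Theorem 1.1: p0003:L36-39 "unramified, T:main was already obtained by Shahidi ( [Shahidi1985], [Shahidi1990]). In fact, T:main is proved by combining the results in op. cit. and works of Mok ( [Mok2015]), Adrian-Henniart-Kaplan-Oi ( [AHKO]) together with standard arguments (cf. [JiangSoudry2004], [CKPSS2004], [KK2005]). Our next result concerns the relation between" […]; §3.2 (globalisation, Lemma) p0010:L82-83 "In general, we apply the construction of Gan-Ichino in [GanIchino2016] as well as the result of global descent of Ginzburg-Rallis-Soudry in [GRS2011] to obtain the desired representation. First, we choose a totally" / p0010:L109-113 "We indicate that their construction relies on the results of Shin ( [SWShin2012]) and Mok ( [Mok2015]). Also, in their construction, they require that the $L$-parameter of $\pi$, when restricting to $WD_E$, contains at least two irreducible direct summands, as they also have some restrictions for $\Sigma_v$ for $v\in S$. Here, since we don't have conditions for $\Sigma_v$ when $v\in S$, the assumption on $\pi$ can be removed. Nevertheless, we do need $S$ to be non-empty if $\pi$ is not supercuspidal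 in order to apply the result of Shin."; §3.3 p0010:L124-128 "(iii) $F$ is non-archimedean and $\pi, \tau$ are unramfied. In fact, by the works of Shelstad ( [Shelstad1982], [Shelstad2012]), Mezo ( [Mezo2016]) and the recent work of Adrian-Henniart-Kaplan-Oi ( [AHKO]), the local Langlands correspondence established by Mok in [Mok2015] coincide with the ones for unramified representations and for real algebraic groups ( [Langlands1989]). Combining these with the works of Shahidi in [Shahidi1985] and [Shahidi1990], the claim follows. In view of above, we may assume that $F$ is"; p0011:L6-8 "L:globalization and ${\rm BC}(\mathit{\Pi})=\ot'_v{\rm BC}(\mathit{\Pi})_v$ be the global base change lift of $\mathit{\Pi}$. Then ${\rm BC}(\mathit{\Pi})$ is an isobaric irreducible generic automorphic representation of $\G_{2n+1}(\bbA)$ ( [CPSS2011], [Mok2015]) such that" [sic].  [AHKO] = M. Adrian – G. Henniart – E. Kaplan – M. Oi, arXiv:2305.09076 (bibliography p0037:L10-14: p0037:L11-14 "M. Adrian, G. Henniart, E. Kaplan, and M. Oi. Simple supercuspidal $L$-packets of split special orthogonal groups over dyadic fields. arXiv:2305.09076v2, 2023.") — the register's ROW B58 (`Consumers3.AHKO`,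 typed ⇐ book for its Theorem 1.1 on split SO_N over dyadic fields); what is used here is its appendix (arXiv v3 PDF text `paper:arxiv-2305.09076`, p0050:L40 "Appendix C. Unramified case of Arthur’s classification theorem" / p0050:L41-44 "The aim of this section is to justify the compatibility of Arthur’s local c lassiﬁ- cation theorem (construction of local A-packets) in the unramiﬁed case with the classical Satake parametrization. The idea of the arguments we pr esent here is due to Jean-Loup Waldspurger." [sic] / p0052:L46-48 p0052:L46-48 "Now we state a part of Arthur’s local classiﬁcation theorem (see [Ar t13, Theo- rems 1.5.1 and 2.2.1] for symplectic and orthogonal groups and [Mok1 5, Theorems 2.5.1 and 3.2.1] for unitary groups):" [sic]) in the UNITARY case, whose source there is Mok's Theorems 2.5.1 and 3.2.1 — inheritance = Mok's memoir, already the premise of this edge; B58's field is NOT bound (different statement, different group).  [GanIchino2016] = the paper of ROW B18 (bibliography p0037:L108-111, title in the line comment above), cited for the globalisation CONSTRUCTION inside its proofs (« relies on the results of Shin ( [SWShin2012]) and Mok ( [Mok2015]) »), not for its typed Theorem 1.3 — absorbed, inheritance = Mok's.  Bibliography p0038: p0038:L38-42 "[Mok2015] C. P. Mok. Endoscopic classification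 of representations of quasi-split unitary groups, volume 235. Memoirs of the American Mathematical Society, 2015." (= [cite: Mok2012]) / p0037: p0037:L16-21 "[Arthur2013] J. Arthur. The endoscopic classification of representations: Orthogonal and symplectic groups, volume 61 of American Mathematical Society Colloquium Publications. American Mathematical Society, Providence, RI, 2013." (the book is LISTED in the bibliography, but the key « [Arthur2013] » occurs in no body chunk — grep over p0002–p0036: 0 hits —; no book premise: the groups are unitary).  Premises: Mok's memoir (local LLC for U_{2n+1} and its compatibility statements; global: the base change of generic cuspidal representations of U_{2n+1}(𝔸), Mok's Theorem 2.5.2 family; all ranks).  No KMSW citation (odd unitary groups are quasi-split).  No status sentence on the classification (grep conditional / weighted / stabiliz: 0 hits on the classification).  Published Arthur-free inputs absorbed: Shahidi [Shahidi1981, 1985, 1990], Langlands 1989, Shelstad 1982/2012 and Mezo 2016 (real groups), Cogdell–Piatetski-Shapiro–Shahidi [CPSS2011] and Cogdell–Kim–Piatetski-Shapiro–Shahidi, Jiang–Soudry, Kim–Krishnamurthy [KK2005], S. W. Shin 2012 (existence of cuspidal representations with prescribed local components), Ginzburg–Rallis–Soudry [GRS2011] (global descent), Jacquet–Piatetski-Shapiro–Shalika,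 Harris–Taylor / Henniart / Scholze (LLC for GL), Ben-Artzi–Soudry, Morimoto–Soudry, Beuzart-Plessis 2021 (archimedean Asai), Aizenbud–Gourevitch–Rallis–Schiffmann. [cite: ChengWang2025, §1.1 (p0003:L15, L35-39), §2.1 (p0006:L67-101), §3.2 (p0010:L80-118), §3.3 (p0010:L123-136; p0011:L5-8), bibliography p0037:L10-21, L108-111, p0038:L38-42; AdrianEtAl2025, App. C (arXiv:2305.09076v3 p0050:L40-44, p0052:L46-48)] -/
def E_ChengWangGamma : Prop := (∀ N, μ.Everything N) → c₃₅.ChengWangGamma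

/-- C104, the places the classifications are invoked (`paper:arxiv-2303.17817`, corpus TeX; some macros lost in the rendering).  MOK'S MEMOIR: §3.2 "For a place $v$ of $F$, we denote by ${\rm BC}_{v}$ the base-change map from $L$-packets of tempered representations of $G_{v}$ to tempered representations of $\GL_{n}(E_{v})$, which is injective by [Mok]." (p0006:L2; G = U(W) the quasi-split unitary group of the skew-Hermitian space W of even rank n over the CM field E ⊃ F); Proposition 7 (descent) and its proof p0006:L21 "Let $\Pi$ be a relevant $p$-adic automorphic representation of $\GL_{n}(\A_{E})$. Then there exists a relevant $p$-adic automorphic representation $\pi$ of $\G(\A)$, unique up to isomorphism, which is $\Psi$-generic and satisfies" BC(π) = Π / p0006:L25 "By [GRS] and [Mor], for each $\iota$ there exists a relevant cuspidal automorphic representation $\pi^{\iota}$ of $\G(\A)$ that is $\Psi$-generic and satisfies ${\rm BC}(\pi^{\iota})=\Pi^{\iota}$." / p0006:L26 "By [Varma, Ato], for each finite place $v$, each local $L$-packet of $G_{v}$ contains a unique $\Psi$-generic representation, which (together with the injectivity of ${\rm BC}_{v}$) implies that $\pi^{\iota}$ is unique up to isomorphism. Then by Remark (BC p) (b), the collection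 $(\pi^{\iota})$ arises from a well-defined relevant $p$-adic automorphic representation $\pi$ of $\G(\A)$." (« [Ato] » = ROW B19, unitary case; [Varma] absorbed; [GRS], [Mor] = Ginzburg–Rallis–Soudry, Morimoto, Arthur-free); §4.2.2 "By [DL] (based on [Mok]), for a relevant $p$-adic automorphic representation $\pi$, the space $\Hom_{\G(\A^{\infty})}(\pi', \sH_{\Qpb})$ is $1$-dimensional, and $\pi^{\vee, \dag}$ is also relevant." (p0008:L70).  ROW C13 ([LTXZZ], « Results from the endoscopic classification »): Remark 6 p0006:L8 "By the explicit description given for instance in [LTXZZ], if $\Pi$ is a relevant representation of $\GL_{n}(\A_{E})$, then: the preimage of $\Pi$ under ${\rm BC}_{\H_{V}}$" p0006:L9 "consists of relevant representations of $\H_{V}(\A)$; the preimage of $\Pi$ under ${\rm BC}_{\G}$ contains a relevant representation of $\G(\A)$." / p0006:L14 "(c) As a consequence of (a) and (b), ${\rm BC}$ extends to a map from relevant $p$-adic automorphic representations of $\G(\A)$ and $\H_{V}(\A)$ to relevant $p$-adic automorphic representations of $\GL_{n}(\A_{E})$." (H_V = U(V), V Hermitian of rank n, incoherent families included — KMSW's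 proved scope at second order, as typed in rows C13, C19, C20).  ROW C20 ([DL]): the sentence above; §4.2.2 p0008:L54 "In [DL], we have defined the following objects.[In this discussion, most new notation will be introduced by equalities whose right-hand sides reproduce the corresponding notation in [DL].]"[…]; §4.3.3 p0009:L89 "By [DL], we have in fact" Θ(φ, ϕ) ∈ H¹_f(E, M_σ) […] "(In \emph{loc. cit.} it is assumed that $ρ$ is crystalline at the $p$-adic places, but the same proof applies using [nek-niz] in place of [nek-AJ].)"; proof of Theorem 17 p0013:L12 "Let $T∈((̋^∞)$ be a Hecke operator acting as $(K)^-1(ff'^∨)$ on $^∨$. Then (my AIP) is equivalent to [DL] for"[…].  ROW C19 ([LL], with [LL2] absorbed as in row C20): Hypothesis (hyp coh) p0009:L14 "We will assume the following hypothesis, which is a special case of [LL] (and it is expected to be confirmed in a sequel to [KSZ])." / p0009:L16-19 "For each open compact $K\subset \H(\A^{\infty})$, we have a Hecke- and Galois-equivariant decompostion M_{\rho, K}\cong \bigoplus_{\sg'} \rho \ot \sg'^{\vee},\eeq where the direct sum runs over the isomorphism classes of relevant $p$-adic automorphic representation $\sg'$ of $\H_{V}(\A)$ with ${\rm BC}(\sg')=\Pi$."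 [M_{ρ,K} ≅ ⊕_{σ'} ρ ⊗ σ'^∨]; Hypothesis (hyp mod) (sentence in the line comment above: « implied by the variant for Chow groups of [LL] »); p0013:L16 "The complex case is similarly reduced to [LL2]; the fact that $ , ^ι$ is well-defined on Theta cycles follows from the definitions and [LL]."; p0012:L4 "Li and Liu [LL] observed that the construction of Be"[…] (the Beilinson–Bloch height pairing).  ROW B18 ([GI16]): Proposition 9 (theta dichotomy and the local theta lift σ_v with BC(σ_v) = BC(π_v)), proof p0006:L79 "By the local theta dichotomy proved in Theorem 2.1.7 (iv) ibid. and [GG11], there is exactly one $V\in \sV$ such that $\sg_{V}^{\vee}$ is nonzero; we fix this $V$ and drop if from then notation. Then the other properties of $\sg:=(\sg^{\vee})^{\vee}$ are consequences of [GI16] (which collects results from [GS12, GI14]). For the case $E=F\oplus F$, see [Min08]." ([harris] = Harris–Kudla–Sweet, [GG11] = Gong–Grenié, [GS12] = Gan–Savin, Arthur-free; [GI14] = Gan–Ichino, Invent. Math. 195 (2014) = row E47, a control row of the census, untyped — absorbed; [Min08] Mínguez for the split case).  Bibliography p0014–p0016: p0015:L169-176 "\bib{Mok}{article}{ author={Mok,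 Chung Pang}, title={Endoscopic classification of representations of quasi-split unitary groups}, journal={Mem. Amer. Math. Soc.}, volume={235}, date={2015}, number={1108}," (= [cite: Mok2012]) / p0014:L12 "\bib{DL}{article}{author={Disegni, Daniel}, author={Liu, Yifeng}, title={A $p$-adic arithmetic inner product formula}, status={arXiv:2204.09239v1}, label={DL}," (= row C20, [cite: DisegniLiu2024]) / p0015:L54-63 "\bib{LL}{article}{ author={Li, Chao}, author={Liu, Yifeng}, title={Chow groups and $L$-derivatives of automorphic motives for unitary groups}, journal={Ann. of Math. (2)}, volume={194}, date={2021}, number={3}, pages={817--901}," (= row C19, [cite: LiLiu2021]) / p0015:L69-71 "\bib{LL2}{article}{author={ Li, Chao}, author={Liu, Yifeng}, title={Chow groups and L-derivatives of automorphic motives for unitary groups, II}, journal={Forum of Math. Pi}, volume={10}, date={2022}, pages={E5}}" / p0015:L114-119 "\bib{LTXZZ}{article}{ author={Liu, Yifeng}, author={Tian, Yichao}, author={Xiao, Liang}, author={Zhang, Wei}, author={Zhu, Xinwen},"[…] p0015:L121-125 "journal={Invent. Math.}, volume={228}, date={2022}, number={1}, pages={107--375}," (= row C13, [cite: LiuEtAl2022];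 title in the line comment above) / p0014:L59-61 "\bib{GI16}{article}{ author={Gan, Wee Teck}, author={Ichino, Atsushi},"[…] p0014:L63-67 "journal={Invent. Math.}, volume={206}, date={2016}, number={3}, pages={705--799}," (= row B18, [cite: GanIchino2016]) / p0013:L51-57 "\bib{Ato}{article}{ author={Atobe, Hiraku}, title={On the uniqueness of generic representations in an $L$-packet}, journal={Int. Math. Res. Not. IMRN}, date={2017}, number={23}, pages={7051--7068}," (= row B19, [cite: Atobe2017GenericUnique]) / p0014:L6-10 "\bib{D-euler}{article}{ author={Disegni, Daniel}, title={Euler systems for conjugate-symplectic motives} , status={in preparation}, label={Dis/b}}" ([D-euler], Part 3 — not in the field).  Premises: Mok's memoir (local tempered packets and BC_v for U(W)_v; global: multiplicity one / base change for G(𝔸), all even ranks), rows C13, C19, C20, B18, B19 (unitary case); KMSW at second order only, inside its proved scope.  No status sentence on the classification (grep conditional / weighted / stabiliz / Arthur: « unconditionally » occurs once, p0012:L4, about Beilinson's height pairing).  The paper's own hypotheses — (hyp coh), (hyp mod), Conj. (ass infty), Assumption (ass p) / Panchishkin-ordinarity, « sufficiently large image », « mildly ramified » — are recorded in the field's docstring,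 not typed.  Published Arthur-free inputs absorbed: Kudla, Kudla–Rapoport–Yang, Y. Liu [Liu11, liu-fj], Harris–Kudla–Sweet, Gong–Grenié, Gan–Savin, Mínguez, Yamana, Lapid–Rallis, J.-S. Li, Paul, Sakellaridis, Nekovář, Nekovář–Nizioł, Beilinson, Ginzburg–Rallis–Soudry, Morimoto, Varma, Ramakrishnan. [cite: Disegni2025Theta, §3.2 (p0006:L2-26), §3.3 (p0006:L45-79; p0007:L37-46), §4.2 (p0008:L54-70), §4.2.3–4.3 (p0009:L14-19, L69-76, L89-91), §5 (p0012:L4, L65-80; p0013:L12-16), bibliography p0013:L51-57, p0014:L6-12, L59-67, p0015:L54-71, L114-125, L169-176] -/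
def E_DisegniTheta : Prop :=
  (∀ N, μ.Everything N) → c.LTXZZ → c₂.LiLiu → c₅.DisegniLiu → c₃₃.GanIchinoGP → c₃₅.AtobeGenericU →
    c₃₅.DisegniTheta

/-- The thirty-fifth tranche of implications. [cite: Atobe2017GenericUnique, Thm 3.1; AtobeOiYasuda2024, Thm 1.1; Cheng2022Newforms, Thms 1.2, 1.4; ChengWang2025, Thms 1.1–1.4; Disegni2025Theta, Thm 1 Parts 1–2 (each edge's source in its own docstring)] -/
structure Implications35 : Prop where
  atobeGenericSpSO : E_AtobeGenericSpSO ν c₃₅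
  atobeGenericU : E_AtobeGenericU μ c₃₅
  aoyNewforms : E_AOYnewforms μ c₆ c₃₄ c₃₅
  chengNewforms : E_ChengNewforms μ c₃₅
  chengWangGamma : E_ChengWangGamma μ c₃₅
  disegniTheta : E_DisegniTheta μ c c₂ c₅ c₃₃ c₃₅

variable {ν μ κ c c₂ c₅ c₆ c₃₃ c₃₄ c₃₅}

/-- B19 (Sp/SO) from the book's inputs. [cite: Atobe2017GenericUnique, Thm 3.1 with Thm 2.4 for Sp(2n), SO(m) (bookkeeping proved here)] -/
theorem atobeGenericSpSO_of_leaves (T : Implications35 ν μ c c₂ c₅ c₆ c₃₃ c₃₄ c₃₅) (A : BookInputs ν) :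
    c₃₅.AtobeGenericSpSO :=
  T.atobeGenericSpSO A.everything

/-- B19 (Sp/SO) in conditional form, 2026, against its own 2015/2017 sentence (« under some assumption on the
stabilization of twisted trace formulas », [Stab1]–[Stab10]): granting the book's internal derivations, supply edges
and every PUBLISHED leaf (the twisted stabilisation among them, 2026), the uniqueness of the 𝔴-generic member of a
tempered L-packet of Sp(2n) / SO(m) is conditional on the 2024–2026 preprint layer and on the general and the
non-standard weighted fundamental lemmas. [cite: Atobe2017GenericUnique, §2 p0005:L3-9 with Thm 3.1 (bookkeeping proved here)] -/
theorem atobeGenericSpSO_conditional_form (T : Implications35 ν μ c c₂ c₅ c₆ c₃₃ c₃₄ c₃₅) (B : ν.BookEdges)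
    (S : ν.SupplyEdges) (P : ν.PublishedLeaves) :
    ν.PreprintLeaves2026 → ν.WFL_general → ν.WFL_nonstandard → c₃₅.AtobeGenericSpSO :=
  fun hQ h6 h7 => atobeGenericSpSO_of_leaves T ⟨B, S, P, hQ, ⟨h6, h7⟩⟩

/-- B19 (U) from Mok's inputs — nothing of KMSW, nothing of the book. [cite: Atobe2017GenericUnique, Thm 3.1 with Thm 2.4 for U(m) (bookkeeping proved here)] -/
theorem atobeGenericU_of_inputs (T : Implications35 ν μ c c₂ c₅ c₆ c₃₃ c₃₄ c₃₅) (M : MokInputs μ) :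
    c₃₅.AtobeGenericU :=
  T.atobeGenericU M.everything

/-- B19 (U) in conditional form, 2026, against the same sentence: granting Mok's internal derivations, supply edges
and every PUBLISHED input, the uniqueness of the 𝔴-generic member of a tempered L-packet of the quasi-split U(m) is
conditional on Mok's 2024–2026 preprint layer and on Mok's copies of the general and the non-standard weighted
fundamental lemmas. [cite: Atobe2017GenericUnique, §2 p0005:L3-9 with Thm 2.4 (bookkeeping proved here)] -/
theorem atobeGenericU_conditional_form (T : Implications35 ν μ c c₂ c₅ c₆ c₃₃ c₃₄ c₃₅) (MB : μ.SectionEdges)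
    (MS : μ.SupplyEdges) (MP : μ.PublishedLeaves) :
    μ.PreprintLeaves2026 → μ.WFL_general → μ.WFL_nonstandard → c₃₅.AtobeGenericU :=
  fun hMQ m6 m7 => atobeGenericU_of_inputs T ⟨MB, MS, MP, hMQ, ⟨m6, m7⟩⟩

/-- B19, both cases, from the book's and Mok's inputs. [cite: Atobe2017GenericUnique, Thm 3.1 (bookkeeping proved here)] -/
theorem atobeGeneric_of_leaves (T : Implications35 ν μ c c₂ c₅ c₆ c₃₃ c₃₄ c₃₅) (A : BookInputs ν) (M : MokInputs μ) :
    c₃₅.AtobeGenericSpSO ∧ c₃₅.AtobeGenericU :=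
  ⟨atobeGenericSpSO_of_leaves T A, atobeGenericU_of_inputs T M⟩

/-- B19, both cases, in conditional form (book and Mok leaves side by side). [cite: Atobe2017GenericUnique, §2 p0005:L3-9 (bookkeeping proved here)] -/
theorem atobeGeneric_conditional_form (T : Implications35 ν μ c c₂ c₅ c₆ c₃₃ c₃₄ c₃₅) (B : ν.BookEdges)
    (S : ν.SupplyEdges) (P : ν.PublishedLeaves) (MB : μ.SectionEdges) (MS : μ.SupplyEdges) (MP : μ.PublishedLeaves) :
    ν.PreprintLeaves2026 → μ.PreprintLeaves2026 → ν.WFL_general → ν.WFL_nonstandard → μ.WFL_general →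
      μ.WFL_nonstandard → c₃₅.AtobeGenericSpSO ∧ c₃₅.AtobeGenericU :=
  fun hQ hMQ h6 h7 m6 m7 => atobeGeneric_of_leaves T ⟨B, S, P, hQ, ⟨h6, h7⟩⟩ ⟨MB, MS, MP, hMQ, ⟨m6, m7⟩⟩

/-- C194 given Mok's outputs and rows C15, C24, B19 (U). [cite: AtobeOiYasuda2024, Thm 1.1 (bookkeeping proved here)] -/
theorem aoyNewforms_of_outputs_and_rows (T : Implications35 ν μ c c₂ c₅ c₆ c₃₃ c₃₄ c₃₅) (hμ : ∀ N, μ.Everything N)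
    (h₁₅ : c₆.BPggp15) (h₂₄ : c₃₄.BPlocalGGP) (h₁₉ : c₃₅.AtobeGenericU) : c₃₅.AOYnewforms :=
  T.aoyNewforms hμ h₁₅ h₂₄ h₁₉

/-- C194 from Mok's inputs and — through C24 (`bpLocalGGP_of_inputs`) — KMSW's proved-scope inputs (KMSW's import of
Mok; NO KMSW sequel), C15 entering as stated under its own node `BPhyp` (`bpggp15_of_hypothesis`), B19's unitary case
through `atobeGenericU_of_inputs`; the book occurs in no premise. [cite: AtobeOiYasuda2024, Thm 1.1 with Thms 4.3, 4.4 (bookkeeping proved here)] -/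
theorem aoyNewforms_of_leaves (T : Implications35 ν μ c c₂ c₅ c₆ c₃₃ c₃₄ c₃₅) (Y : Implications6 ν c c₆)
    (T₃₄ : Implications34 μ κ c₃₃ c₃₄) (M : MokInputs μ) (K : KMSWInputs μ κ) (hB : c₆.BPhyp) : c₃₅.AOYnewforms :=
  T.aoyNewforms M.everything (bpggp15_of_hypothesis Y hB) (bpLocalGGP_of_inputs T₃₄ M K) (atobeGenericU_of_inputs T M)

/-- C194 in conditional form, 2026, against « the local Langlands correspondence established by Mok [32] »: granting
Mok's and KMSW's internal derivations, supply edges and every PUBLISHED input, the Mok import edge and the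
identification of the two copies of the general weighted fundamental lemma, and C15's node, the theory of local
newforms for tempered generic representations of unramified U_{2n+1} is conditional on Mok's 2024–2026 preprint layer
and on Mok's copies of the general AND the non-standard weighted fundamental lemmas (directly through Theorem 4.1 =
Mok's Theorem 3.2.1, and at second order through Beuzart-Plessis and Atobe 2017). [cite: AtobeOiYasuda2024, §1 p0003:L41 with Thm 1.1 (bookkeeping proved here)] -/
theorem aoyNewforms_conditional_form (T : Implications35 ν μ c c₂ c₅ c₆ c₃₃ c₃₄ c₃₅) (Y : Implications6 ν c c₆)
    (T₃₄ : Implications34 μ κ c₃₃ c₃₄) (D1 : KMSW2014.E_ImportMok μ κ) (D3 : KMSW2014.E_SameWFL μ κ)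
    (MB : μ.SectionEdges) (MS : μ.SupplyEdges) (MP : μ.PublishedLeaves) (KB : κ.ChapterEdges) (KS : κ.SupplyEdges)
    (KP : κ.PublishedLeaves) (hB : c₆.BPhyp) :
    μ.PreprintLeaves2026 → μ.WFL_general → μ.WFL_nonstandard → c₃₅.AOYnewforms :=
  fun hMQ m6 m7 => aoyNewforms_of_leaves T Y T₃₄ ⟨MB, MS, MP, hMQ, ⟨m6, m7⟩⟩ ⟨D1, KB, KS, KP, ⟨D3 m6⟩⟩ hB

/-- C146 given Mok's outputs and row C194. [cite: Cheng2022Newforms, Thm 1.2 (bookkeeping proved here)] -/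
theorem chengNewforms_of_outputs_and_row (T : Implications35 ν μ c c₂ c₅ c₆ c₃₃ c₃₄ c₃₅) (hμ : ∀ N, μ.Everything N)
    (h₁₉₄ : c₃₅.AOYnewforms) : c₃₅.ChengNewforms :=
  T.chengNewforms hμ h₁₉₄

/-- C146 from Mok's inputs and, through C194 (`aoyNewforms_of_leaves`), KMSW's proved-scope inputs, C15's node and
B19; the book occurs in no premise. [cite: Cheng2022Newforms, Thms 1.2, 1.4 (bookkeeping proved here)] -/
theorem chengNewforms_of_leaves (T : Implications35 ν μ c c₂ c₅ c₆ c₃₃ c₃₄ c₃₅) (Y : Implications6 ν c c₆)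
    (T₃₄ : Implications34 μ κ c₃₃ c₃₄) (M : MokInputs μ) (K : KMSWInputs μ κ) (hB : c₆.BPhyp) : c₃₅.ChengNewforms :=
  T.chengNewforms M.everything (aoyNewforms_of_leaves T Y T₃₄ M K hB)

/-- C146 in conditional form, 2026 (no status sentence): the dimension formula for the K_{n,m}-fixed vectors of every
generic representation of unramified U_{2n+1} and the Rankin–Selberg values of newforms (under the paper's Assumption
1.3) are conditional on Mok's 2024–2026 preprint layer and on Mok's copies of the general and the non-standard
weighted fundamental lemmas, directly and AT SECOND ORDER through Atobe – Oi – Yasuda. [cite: Cheng2022Newforms, §1.1 p0002:L33 (bookkeeping proved here)] -/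
theorem chengNewforms_conditional_form (T : Implications35 ν μ c c₂ c₅ c₆ c₃₃ c₃₄ c₃₅) (Y : Implications6 ν c c₆)
    (T₃₄ : Implications34 μ κ c₃₃ c₃₄) (D1 : KMSW2014.E_ImportMok μ κ) (D3 : KMSW2014.E_SameWFL μ κ)
    (MB : μ.SectionEdges) (MS : μ.SupplyEdges) (MP : μ.PublishedLeaves) (KB : κ.ChapterEdges) (KS : κ.SupplyEdges)
    (KP : κ.PublishedLeaves) (hB : c₆.BPhyp) :
    μ.PreprintLeaves2026 → μ.WFL_general → μ.WFL_nonstandard → c₃₅.ChengNewforms :=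
  fun hMQ m6 m7 => chengNewforms_of_leaves T Y T₃₄ ⟨MB, MS, MP, hMQ, ⟨m6, m7⟩⟩ ⟨D1, KB, KS, KP, ⟨D3 m6⟩⟩ hB

/-- C147 from Mok's inputs — nothing of KMSW, nothing of the book. [cite: ChengWang2025, Thms 1.1–1.4 (bookkeeping proved here)] -/
theorem chengWangGamma_of_inputs (T : Implications35 ν μ c c₂ c₅ c₆ c₃₃ c₃₄ c₃₅) (M : MokInputs μ) :
    c₃₅.ChengWangGamma :=
  T.chengWangGamma M.everything

/-- C147 in conditional form, 2026 (no status sentence): the identities γ^{LS} = γ^{WD} (all local fields of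
characteristic 0) and γ^{RS} = γ^{LS} (non-archimedean) for generic representations of U_{2n+1} × Res_{E/F} GL_r —
γ^{WD} being defined through Mok's correspondence — are conditional on Mok's 2024–2026 preprint layer and on Mok's
copies of the general and the non-standard weighted fundamental lemmas. [cite: ChengWang2025, §1.1 p0003:L37 (bookkeeping proved here)] -/
theorem chengWangGamma_conditional_form (T : Implications35 ν μ c c₂ c₅ c₆ c₃₃ c₃₄ c₃₅) (MB : μ.SectionEdges)
    (MS : μ.SupplyEdges) (MP : μ.PublishedLeaves) :
    μ.PreprintLeaves2026 → μ.WFL_general → μ.WFL_nonstandard → c₃₅.ChengWangGamma :=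
  fun hMQ m6 m7 => chengWangGamma_of_inputs T ⟨MB, MS, MP, hMQ, ⟨m6, m7⟩⟩

/-- C104 given Mok's outputs and rows C13, C19, C20, B18, B19 (U). [cite: Disegni2025Theta, Thm 1 Parts 1–2 (bookkeeping proved here)] -/
theorem disegniTheta_of_outputs_and_rows (T : Implications35 ν μ c c₂ c₅ c₆ c₃₃ c₃₄ c₃₅) (hμ : ∀ N, μ.Everything N)
    (h₁₃ : c.LTXZZ) (h₁₉ : c₂.LiLiu) (h₂₀ : c₅.DisegniLiu) (h₁₈ : c₃₃.GanIchinoGP) (hA : c₃₅.AtobeGenericU) :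
    c₃₅.DisegniTheta :=
  T.disegniTheta hμ h₁₃ h₁₉ h₂₀ h₁₈ hA

/-- C104 from Mok's inputs and KMSW's proved-scope inputs — the latter at second order only, through C13
(`ltxzz_of_leaves`), C19 (`liLiu_of_leaves`), C20 (`disegniLiu_of_leaves`) and B18 (`ganIchinoGP_of_leaves`, with
C15's node) —, B19's unitary case through `atobeGenericU_of_inputs`; NO KMSW sequel, nothing of the book. [cite: Disegni2025Theta, Thm 1 Parts 1–2 with Props 7, 9, 11, Thm 17 (bookkeeping proved here)] -/
theorem disegniTheta_of_leaves (T : Implications35 ν μ c c₂ c₅ c₆ c₃₃ c₃₄ c₃₅) (I : Implications ν μ κ c)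
    (J : Implications2 ν μ κ c c₂) (V : Implications5 ν μ κ c c₂ c₅) (Y : Implications6 ν c c₆)
    (T₃₃ : Implications33 ν μ κ c c₂ c₅ c₆ c₃₃) (M : MokInputs μ) (K : KMSWInputs μ κ) (hB : c₆.BPhyp) :
    c₃₅.DisegniTheta :=
  T.disegniTheta M.everything (ltxzz_of_leaves I M K) (liLiu_of_leaves J M K) (disegniLiu_of_leaves J V M K)
    (ganIchinoGP_of_leaves T₃₃ Y M K hB) (atobeGenericU_of_inputs T M)

/-- C104 in conditional form, 2026 (no status sentence on the classification; the paper's own Hypotheses (hyp coh),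
(hyp mod) and Conj. (ass infty) stand in front of everything): granting Mok's and KMSW's internal derivations, supply
edges and every PUBLISHED input, the Mok import edge, the identification of the two copies of the general weighted
fundamental lemma and C15's node, the construction of Theta cycles and the implications ord L = 1 ⇒ Θ_ρ ≠ 0 are
conditional on Mok's 2024–2026 preprint layer and on Mok's copies of the general and the non-standard weighted
fundamental lemmas — directly (BC_v « injective by [Mok] », « [DL] (based on [Mok]) ») and at second order through
five typed rows. [cite: Disegni2025Theta, §3.2 p0006:L2 with Thm 1 (bookkeeping proved here)] -/
theorem disegniTheta_conditional_form (T : Implications35 ν μ c c₂ c₅ c₆ c₃₃ c₃₄ c₃₅) (I : Implications ν μ κ c)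
    (J : Implications2 ν μ κ c c₂) (V : Implications5 ν μ κ c c₂ c₅) (Y : Implications6 ν c c₆)
    (T₃₃ : Implications33 ν μ κ c c₂ c₅ c₆ c₃₃) (D1 : KMSW2014.E_ImportMok μ κ) (D3 : KMSW2014.E_SameWFL μ κ)
    (MB : μ.SectionEdges) (MS : μ.SupplyEdges) (MP : μ.PublishedLeaves) (KB : κ.ChapterEdges) (KS : κ.SupplyEdges)
    (KP : κ.PublishedLeaves) (hB : c₆.BPhyp) :
    μ.PreprintLeaves2026 → μ.WFL_general → μ.WFL_nonstandard → c₃₅.DisegniTheta :=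
  fun hMQ m6 m7 =>
    disegniTheta_of_leaves T I J V Y T₃₃ ⟨MB, MS, MP, hMQ, ⟨m6, m7⟩⟩ ⟨D1, KB, KS, KP, ⟨D3 m6⟩⟩ hB

/-- The U_{2n+1} newform / γ-factor sub-line (C194, C146, C147) from Mok's and KMSW's inputs, C15's node granted; the
book occurs in no premise. [cite: AtobeOiYasuda2024, Thm 1.1; Cheng2022Newforms, Thm 1.2; ChengWang2025, Thm 1.1 (bookkeeping proved here)] -/
theorem newformLine35_of_inputs (T : Implications35 ν μ c c₂ c₅ c₆ c₃₃ c₃₄ c₃₅) (Y : Implications6 ν c c₆)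
    (T₃₄ : Implications34 μ κ c₃₃ c₃₄) (M : MokInputs μ) (K : KMSWInputs μ κ) (hB : c₆.BPhyp) :
    c₃₅.AOYnewforms ∧ c₃₅.ChengNewforms ∧ c₃₅.ChengWangGamma :=
  ⟨aoyNewforms_of_leaves T Y T₃₄ M K hB, chengNewforms_of_leaves T Y T₃₄ M K hB, chengWangGamma_of_inputs T M⟩

/-- All six fields of the tranche from the inputs of the three DAGs (KMSW in the proved scope), C15's node granted.
[cite: Atobe2017GenericUnique, Thm 3.1; AtobeOiYasuda2024, Thm 1.1; Disegni2025Theta, Thm 1, with the two other rows (bookkeeping proved here)] -/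
theorem thirtyfifth_of_inputs_and_hypothesis (T : Implications35 ν μ c c₂ c₅ c₆ c₃₃ c₃₄ c₃₅) (I : Implications ν μ κ c)
    (J : Implications2 ν μ κ c c₂) (V : Implications5 ν μ κ c c₂ c₅) (Y : Implications6 ν c c₆)
    (T₃₃ : Implications33 ν μ κ c c₂ c₅ c₆ c₃₃) (T₃₄ : Implications34 μ κ c₃₃ c₃₄) (A : BookInputs ν) (M : MokInputs μ)
    (K : KMSWInputs μ κ) (hB : c₆.BPhyp) :
    (c₃₅.AtobeGenericSpSO ∧ c₃₅.AtobeGenericU) ∧ (c₃₅.AOYnewforms ∧ c₃₅.ChengNewforms ∧ c₃₅.ChengWangGamma) ∧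
      c₃₅.DisegniTheta :=
  ⟨atobeGeneric_of_leaves T A M, newformLine35_of_inputs T Y T₃₄ M K hB, disegniTheta_of_leaves T I J V Y T₃₃ M K hB⟩

/-! ## Thirty-sixth tranche (v2, unit `pub-arthur-down-g22`): post-AGIKMS printed witnesses, I — C195 (Y. Cheng 2026 +
Lo's appendix) with the node `AGIKMSderiv`, B9 (Morimoto 2022), C196 (S.-Y. Chen 2025); control rows E54, E55 recorded in
the census only

Context (`DOWNSTREAM.md` §F items F3, F4 and row B9 `[g2]`; this tranche `DOWNSTREAM2.md` block `[g22b]`; texts staged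
under `HOME/pub-arthur-down-g22/primaries/`).  (i) C195: Theorem 1.2 (p0003:L82-84); the flag p0006:L2;
[Atobe2020] = B4 at p0004:L53, p0014:L146, p0025:L36; Lo's appendix p0034:L3, [AGIKMS24] at p0035:L17, L34, L41, L45,
[AM23] = B42 at p0035:L32; Lemma 2.2 / [AOY2024] at p0007:L16, L38.  Edge ⇐ book ∧ B4 ∧ B42 ∧ node.  (ii) B9: Corollary 8.1
(p0022:L100-108) with §8.1.1 (p0022:L47-52, the flag) and Remark 8.1 (p0023:L33, [At] = B19); Theorems 1.2–1.4 (p0004:L13, L29, L53)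
Arthur-free.  Edge ⇐ Mok ∧ KMSW scope ∧ B19-U.  (iii) C196: Proposition 3.1 (p0010:L71), Proposition 3.3 (p0014:L16), Theorem 3.4 (p0014:L27);
the flag p0010:L69; Mok at p0012:L1, L11, L17; [BPC2023] = C27 at p0014:L20, p0017:L5; GU_n remark p0014:L14.
Edge ⇐ Mok ∧ C27.  Status sentences: all three rows carry one (quoted in the edge docstrings / line comments). -/

/-- Further downstream statements (rows C195, B9, C196 of the cell's `DOWNSTREAM.md` / `DOWNSTREAM2.md`) and one
external-input node, as an arbitrary assignment of propositions; nothing about the content of a field is assumed.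
[cite: Arthur2013, downstream register of the cell, thirty-sixth tranche (structure only)] -/
structure Consumers36 where
  /-- NODE (external input, outside the three DAGs as typed): the « highest-derivatives formula for tempered representations » of split SO_{2n+1}(F) — for π ∈ Π_φ tempered with character η of the component group and ρ ⊠ S_{2x+1} ⊂ φ, the highest derivative D^{(k)}_{ρ|·|^x}(π) (its non-vanishing, irreducibility and L-parameter) — AS TAKEN by C.-H. Lo's appendix to C195 from « [AGIKMS24] » = H. Atobe – W. T. Gan – A. Ichino – T. Kaletha – A. Mínguez – S. W. Shin, *Local intertwining relations and co-tempered A-packets of classical groups*, arXiv:2410.13504v1 (2024), Appendix « Derivatives of tempered representations » (e-print `note19.tex` §C, « Computation of highest derivatives », staged by the cell's upstream seat under `HOME/pub-arthur-up-g29/primaries/agikms/v1/`), a 2024–26 PREPRINT which there re-derives results of B. Xu and of H. Atobe (row B4, published).  C195's bibliography p0036:L27-31 "[AGIKMS24] H. Atobe, W. T. Gan, A. Ichino, T. Kaletha, A. Mínguez, and S. W. Shin. Local intertwining relations and co-tempered $A$-packets of classical groups. arXiv:2410.13504v1, 2024.".  No supplier edge is typed: the book's DAG carries AGIKMS's statements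 only where the book consumes them (leaves `AGIKMS_181`, `_191`, `_1105`, `_D21`, `_AppE`); a reader may regard the node as dischargeable from row B4 for split SO_{2n+1} — the register records the citation as printed. [claim: AtobeGanIchinoKalethaMinguezShin2024, under-review] [cite: Cheng2026SOnewformsReduction, App. §7 (p0035:L17, L34, L41, L45) and bibliography p0036:L27-31] -/
  AGIKMSderiv : Prop
  /-- C195: Y. Cheng, *Local newforms for generic representations of p-adic SO_{2n+1}: Reduction*, with an appendix (§7, « A lemma on certain parabolic induction ») by C.-H. Lo, arXiv:2605.15678 (2026; PREPRINT) (corpus TeX `paper:arxiv-2605.15678`) [cite: Cheng2026SOnewformsReduction, Thm 1.2 (p0003:L82-84) with Thm 1.1 = the prequel's (p0003:L62-75), Lemma 2.2 (p0007:L16-18), Lemma 6.5 (p0025:L38-39), App. Prop. 7.2 (p0034:L83)]: for F a finite extension of ℚ_p, SO_{2n+1}(F) split, Gross's compact open subgroups K_{n,m} and the conductor c_π of the L-parameter φ_π of an irreducible generic π (p0003:L30-41): p0003:L82-84 "Theorem 1.2. If the space of newforms is non-zero for every irreducible generic supercuspidal representation, then it is also non-zero for all irreducible generic representations." — i.e.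 π^{K_{n,c_π}} ≠ 0 for every irreducible generic π of SO_{2n+1}(F) GIVEN its non-vanishing for the generic supercuspidal ones (abstract p0002:L3-4 "We prove that if the space of newforms is non-zero for every irreducible generic supercuspidal representation of $\SO_{2n+1}$ then it is also non-zero for all irreducible generic representations of $\SO_{2n+1}$."); obtained through p0003:L101 "(i) from generic representations to square-integrable representations;" / p0003:L103 "(ii) from square-integrable representations to seed representations;" / p0003:L105 "(iii) from seed representations to supercuspidal representations."; with Lemma 2.2 (p0007:L16-18 "Lemma 2.2. Let $\pi$ be an irreducible tempered representation of $\SO_{2n+1}(F)$. Then $\pi^{K_{n,m}}\ne 0$ for some $m\ge 0$ if and only if $\pi$ is generic.") and the length-two Lemma 6.5 of Lo's appendix.  The authors' own caveat on the remaining supercuspidal case (Tsai's thesis; full sentences in the line comment below): "however, it seems that Tsai's proofs contain some issues (see (SS:Tsai lemma))." (p0003:L8) / "In the present paper, we do not attempt to resolve these issues. Therefore, it may be safer to say that the existence part of the"[…] p0003:L10 "remains conditional." -/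
  ChengSOnewformsRed : Prop
  /-- B9: K. Morimoto, *On a certain local identity for Lapid–Mao's conj. and formal degree conj.: even unitary group case* (title words abbreviated; exact title in the line comment below), J. Inst. Math. Jussieu 21 (2022) no. 4, 1107–1161, doi:10.1017/s1474748020000523 (online 2021; corpus TeX `paper:arxiv-1902.04910`) [cite: Morimoto2022LapidMao, Cor. 8.1 (p0022:L100-110) as discharged by §8.1.1 (p0022:L46-52)] — THE FIELD IS COROLLARY 8.1 AS DISCHARGED: for E/F a quadratic extension of non-archimedean local fields of characteristic zero and the two even unitary groups U_{2n}^± (p0022:L44-45): Corollary 8.1 (p0022:L100-110; its one-line hypothesis « Assume that the local Langlands conj[…] holds for U_{2n}^± », which names the conj., is in the line comment below) — (8.x) d_ψ^{G̃} = |𝒮_φ| λ(E/F, ψ)^n ω_σ(−1) γ(1, σ, As⁻, ψ) d_σ p0022:L109-110 "holds for any square-interable $L$-parameter $\phi : WD_F \rightarrow {}^{L} \mathrm{U}_{2n}$ and any $\sigma \in \Pi_\phi$." [sic] (the refined formal degree conj. of Hiraga–Ichino–Ikeda / Gan–Ichino for ALL discrete series of U_{2n}^±), the assumption being discharged by the authors'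 §8.1.1 sentence quoted in the edge docstring.  NOT part of the field (recorded; obtained by explicit local descent without the classification): Theorem 1.2 (p0004:L15 "Suppose that $v$ is non-split finite place (i.e. $\mathrm{U}_{2n}(F_v)$ is quasi-split unitary group)." — then the Lapid–Mao local identity (1.5) c_{π_v} = ω_{π_v}(τ) holds for good / generic π_v), Theorem 1.3 (p0004:L29-43, the refined formal degree for the GENERIC discrete series σ = 𝒟(𝔠(π))), Theorem 1.4 (p0004:L55 "Suppose that $v$ is a real place and that $E_v \simeq \mC$, i.e. $\mathrm{U}_{2n}(F_v) \simeq \mathrm{U}_{2n}(\mR)$." — the same identity for discrete series) and the global Corollary 1.1 (their full sentences, which name « Conj. 2 », in the line comment below). -/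
  MorimotoFormalDegree : Prop
  /-- C196: S.-Y. Chen, *Algebraicity of adjoint L-functions for quasi-split groups*, arXiv:2509.23940 (2025; PREPRINT) (corpus TeX `paper:arxiv-2509.23940`) [cite: Chen2025AdjointL, Prop. 3.1 (p0010:L71-78), Prop. 3.3 (p0014:L16-17), Thm 3.4 (p0014:L27-42), Thm 4.1 (p0016:L130)]: for 𝒦 an imaginary quadratic field and the quasi-split unitary similitude group GU_n over ℚ, Π a globally generic cuspidal automorphic representation of GU_n(𝔸) with Π_∞ a C-algebraic discrete series (§3.4, p0010:L59 "Let $\itPi$ be a globally generic cuspidal automorphic representation of $\GU_n(\A)$. We assume that $\itPi_\infty$ is a $C$-algebraic discrete series representation."): Proposition 3.1 (p0010:L71-78) p0010:L72 "The following assertions hold." p0010:L74 "(1) For $\sigma \in {\rm Aut}(\C)$, the representation ${}^\sigma\!\itPi$ is cuspidal automorphic and globally generic." p0010:L76 "(2) $\itPi_f$ is defined over $\K\cdot\Q(\itPi_f)$." p0010:L78 "(3) We have $\Q(\itPi) = \Q(\itPi_f)$." (multiplicity one of Π in the cuspidal spectrum is obtained in the proof, p0012:L17-19); Proposition 3.3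 (p0014:L16-17: the Lapid–Mao formula (E:LM) holds for Π with |𝒮_Π| replaced by 2^{k_Π−1}|X(Π)|^{-1}, k_Π the number of cuspidal summands of the lift of Π₁ to GL_n(𝔸_𝒦)); Theorem 3.4 = the introduction's « Theorem (T: main 1) » (p0004:L20 "In Theorem (T: main 1) below, we resolve Question (1) for unitary similitude groups when $\itPi_\infty$ is a (limit of) discrete series representation."): p0014:L29 "Let $\itPi$ be a globally generic cuspidal automorphic representation of $\GU_n(\A)$. Assume that the $\itPi$ is $C$-algebraic and $\itPi_\infty$ is a discrete series representation." […] the displayed Aut(ℂ)-equivariance of L^S(1, Π, Ad₁) / (π^{n(n+1)/2} √D_𝒦^{⌊(n+1)/2⌋} C_{N_n,Π_∞} ⟨f, f'⟩) and p0014:L38 "In particular, if $f$ and $f'$ are Whittaker-rational over $\Q(\itPi_f)$, then we have" L^S(1, Π, Ad₁)/(…) ∈ ℚ(Π_f); Theorem 4.1 (the explicit formula for U(2,1)).  The abstract (p0002:L4-5; L4 in the line comment below): "More precisely, when $\itPi$ is $C$-algebraic, we show that the algebraicity of the adjoint $L$-value can be expressed in terms of the Petersson norm of Whittaker-rational cusp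 forms in $\itPi$, subject to the validity of the Lapid–Mao conj"[…] / p0002:L5 "For unitary similitude groups, we also establish an unconditional and more refined algebraicity result."  NOT part of the field: Theorem 1.1 = « Theorem (T: main 0) » for a general quasi-split G over ℚ, stated "Assume ((E:assumption)) and the Lapid–Mao conj"[…] (under the Lapid–Mao conj.; recorded, not typed). -/
  ChenAdjointGU : Prop

variable (ν : Nodes) (μ : Mok2015.Nodes) (κ : KMSW2014.Nodes) (c₂ : Consumers2) (c₅ : Consumers5) (c₃₅ : Consumers35)
  (c₃₆ : Consumers36)

-- Verbatim, kept out of docstrings by the docstring lint (sentences naming a conj.).  C195 (`paper:arxiv-2605.15678`):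
-- THE STATUS FOOTNOTE (witness F3 of the cell's `DOWNSTREAM.md` §F) p0006:L1-2 "Throughout this paper, we will need the local Langlands correspondence for $\SO_{2n+1}(F)$, which was established by Arthur in [Arthur2013] in full generality[Conditional on the twisted weighted fundamental lemma.] (see also [AGIKMS24]). However,"
-- / p0006:L3-6 "since we only require the local Langlands correspondence for generic representations of $\SO_{2n+1}(F)$, and, more importantly, the explicit construction of representations from the associated $L$-parameter, we will mainly follow the correspondence established by Jiang–Soudry in [JiangSoudry2003] and [JiangSoudry2004]. We remark that their correspondence is based on automorphic descent together with the work of Muić in [Muic1998], and is compatible with Arthur's.";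
-- Gross's conj. (p0003:L43-56) p0003:L43-44 "Conjecture (Gross). Let $\pi$ be an irreducible generic representation of $\SO_{2n+1}(F)$. Then" / p0003:L46 "(1) the subspaces satisfy $\pi^{K_{n,m}}=0$ for $0\le m<c_\pi$ and $\dim_\bbC\pi^{K_{n,c_\pi}}=1$;" / p0003:L48 "(2) the action of $J_{n,c_\pi}/K_{n,c_\pi}$ on $\pi^{K_{n,c_\pi}}$ is given by the scalar $\e_\pi$;" / p0003:L50 "(3) the natural pairing of the one-dimensional spaces" [display: Hom_{K_{n,c_π}}(1, π) × Hom_{U_n(F)}(π, ψ_{U_n}) → ℂ] p0003:L56 "is non-degenerate.";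
-- p0003:L3-5 "This paper is a sequel to [YCheng2025], in which we proved the uniqueness part of the newform conjecture for the $p$-adic group $\SO_{2n+1}$ proposed by Gross ( [Gross2015]) and verified the expected arithmetic properties of newforms, conditional on their existence. The aim of the present paper is to reduce the existence part of the conjecture to the case of generic supercuspidal representations."; p0003:L77 "In view of T:mainA, it remains to verify the existence part of the conjecture, namely, to prove that $\pi^{K_{n,c_\pi}}\ne 0$."
-- / p0003:L86-91 "By T:mainA and T:mainB, to settle the newform conjecture, it suffices to prove: * that the space of newforms is non-zero for every irreducible generic supercuspidal representation; * that the natural pairing appearing in the third assertion of the newform conjecture is non-degenerate for non-tempered generic representations."; the caveat p0003:L7-10 "In the literature, the newform conjecture for generic supercuspidal representations was treated in the PhD thesis of Tsai ( [Tsai2013]); however, it seems that Tsai's proofs contain some issues (see (SS:Tsai lemma)). In the present paper, we do not attempt to resolve these issues. Therefore, it may be safer to say that the existence part of the conjecture remains conditional."; p0004:L28 "Suppose that $\pi$ is non-tempered. Then $\pi_0$ is tempered and $\pi=\Pi$ by the standard module conjecture ( [Muic2001])."; Lemma 2.2's proof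
-- p0007:L31-32 "- the Gan–Gross–Prasad conjecture ( [GanGrossPrasad2012]) for $({\rm U}_{2n+1}, {\rm U}_{2n})$, established by Beuzart-Plessis ( [BP2014], [BP2015] and [BP2016]);".  B9 (`paper:arxiv-1902.04910`): exact title (chunk p0001) "On a certain local identity for Lapid-Mao's conjecture and formal degree conjecture : even unitary group case";
-- §8.1.1 with THE FLAG (census G-v) p0022:L46-47 "In this section, we prove (formal degree identity) for any discrete series representations of $\mathrm{U}_{2n}^{\pm}$ assuming local Langlands conjecture for these groups."
-- p0022:L48-52 "Indeed, the local Langlands conjecture was established by Mok [Mok] for $\mathrm{U}_{2n}^+$ and Kaletha–Minguez–Shin–White [KMSW] for $\mathrm{U}_{2n}^{-}$ with the stabilization of the twisted trace formula established by Moeglin–Waldspurge [WMW1,WMW2] assuming the weighted fundamental lemma for quasi-split groups, which is proved in Chaudouard–Laumon [CL] only in the split case." [sic]; p0022:L54 "Let us briefly recall the local Langlands conjectures."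
-- / p0022:L60 "The local Langlands conjecture for $\mathrm{U}_{2n}^{+}$ asserts that there exists a partition"[…]; Corollary 8.1's hypothesis p0022:L101 "Assume that the local Langlands conjecture holds for $\mathrm{U}_{2n}^{\pm}$. Then"; Remark 8.1
-- p0023:L33-34 "Atobe [At] give a precise proof that $\sigma$ is generic if $\langle \cdot, \sigma \rangle$ is trivial using expected desideratum on the local Langlands conjecture."; Theorem 1.2 p0004:L13-16 "Theorem 1.2. Suppose that $v$ is non-split finite place (i.e. $\mathrm{U}_{2n}(F_v)$ is quasi-split unitary group). Then Conjecture 2 holds." with Conj. 2 = (1.5) p0004:L8 "c_{\pi_v} = \omega_{\pi_v}(\tau).";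
-- p0004:L21-23 "This local identity is important not only for Lapid–Mao conjecture but also for formal degree conjecture in Hiraga–Ichino–Ikeda [HII]. Using an observation by Gross-Reeder [GR], Gan–Ichino [GI] formulated a refinement of this conjecture for classical groups. We call this refinement refined formal degree conjecture." / p0004:L26-27 "In a similar argument as [ILM], we prove the equivalence between refined formal degree conjecture for $\mathrm{U}_{2n}$ and Theorem (main thm). As a consequence, we can prove refined formal degree conjecture."; Theorem 1.4 p0004:L55-56 "Suppose that $v$ is a real place and that $E_v \simeq \mC$, i.e. $\mathrm{U}_{2n}(F_v) \simeq \mathrm{U}_{2n}(\mR)$. Then Conjecture 2 holds for diecerete series representations of $\mathrm{U}_{2n}(\mR)$." [sic]; Corollary 1.1 p0004:L58 "As a corollary of Theorem (main thm), Theorem (main thm archimedean) and [LMa], the following global formula follows."; Remark 1.2 p0004:L46-47 "Recently, Beuzart-Plessis [BP] proved the original formal degree conjecture by [HII] for any unitary groups using a different method." (= row C25).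
-- C196 (`paper:arxiv-2509.23940`): abstract p0002:L4 "In this paper, we consider the algebraic aspect of the Lapid–Mao conjecture. More precisely, when $\itPi$ is $C$-algebraic, we show that the algebraicity of the adjoint $L$-value can be expressed in terms of the Petersson norm of Whittaker-rational cusp forms in $\itPi$, subject to the validity of the Lapid–Mao conjecture.";
-- bibliography [BPC2023] (= row C27) p0024:L39-43 "[BPC2023] R. Beuzart-Plessis and P.-H. Chaudouard. The global Gan-Gross-Prasad conjecture for unitary groups. II. From Eisenstein series to Bessel periods. Forum Math. Pi, 13(16):1–98, 2025."; Theorem 1.1's hypothesis p0003:L58 "Assume ((E:assumption)) and the Lapid–Mao conjecture hold for $\itPi$."; p0003:L55 "Subject to the validity of the Lapid–Mao conjecture, we prove the following result on the algebraicity of adjoint $L$-values of $\itPi$ in terms of Petersson pairing of Whittaker-rationals cusp forms.";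
-- the GU_n remark p0014:L14 "In the literature, Arthur's conjecture for $\GU_n(\A)$ is not yet proved. Nonetheless, we can deduce from [LM2015] that Conjecture (C:LM) still holds for $\itPi$ on the automorphic side, that is, ((E:LM)) holds for $\itPi$ with the proportional constant given by certain automorphic invariant of $\itPi$.";
-- Prop. 3.3's proof p0014:L20-21 "By the results of Beuzart-Plessis–Chaudouard [BPC2023] and Morimoto [Morimoto2024], the Lapid–Mao conjecture holds for $\U_n(\A)$. In particular, ((E:LM)) holds for $\itPi_1$ with $|\mathcal{S}_{\itPi_1}| = 2^{k_\itPi-1}$. On the other hand, as explained in the end of the first paragraph of the proof of Proposition (P:rational structure), the multiplicity of $\itPi$ in the cuspidal spectrum is one. Therefore, it follows from [LM2015] that ((E:LM)) holds for $\itPi$ with proportional constant $|\mathcal{S}_{\itPi_1}|^{-1}|X(\itPi)|$."; §4 p0017:L5 "By the Lapid–Mao conjecture for $G$ proved by Beuzart-Plessis–Chaudouard [BPC2023] and Morimoto [Morimoto2024], we have";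
-- p0003:L34 "Recently, by Beuzart-Plessis and Chaudouard [BPC2023] and Morimoto [Morimoto2024], the formula is completely proved when $G$ is (the Weil restriction to"[…]; bibliography [LM2015] (= row C173)
-- p0024:L230-233 "[LM2015] E. Lapid and Z. Mao. A conjecture on Whittaker-Fourier coefficients of cusp forms. J. Number Theory, 146:448–505, 2015."; [Morimoto2022] (= row B9) p0025:L37-41 "[Morimoto2022] K. Morimoto. On a certain local identity for Lapid–Mao's conjecture and formal degree conjecture: even unitary group case. J. Inst. Math. Jussieu, 21(4):1107–1161, 2022.".
-- E55 (`paper:arxiv-2403.19166`, arXiv PDF text; control row, NOT typed): the only uses of Mok's memoir p0004:L33-36 "σ ≃σgen. Finally, since the multiplicity of σ and σgen is one by Mok [49] (cf. [10, Theorem 2.5]), we obtain σ =σgen andσ is ψN ′-generic. We note that strong base change lift of σ exists when σ is tempered by Mok [49], and thus the formula (1.2) holds in this case." [sic] and the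
-- conditional Corollary 1.1 p0004:L45-48 "Corollary 1.1. Assume that for any irreducible cuspidal automorphic repre senta- tion of U(n) which is locally generic at every place, we have strong base c hange lift. Then Conjecture 1 holds for any irreducible cuspidal automo rphic representations of U(n) with generic Arthur parameter." [sic]; its Theorem 1.2 p0004:L8-10 "Theorem 1.2. Conjecture 1 holds for any irreducible ψN ′ -generic cuspidal auto- morphic representations of U(2n+1). Hence, Conjecture 1 holds for any irreducible ψN ′-generic cuspidal automorphic representation of U(n)." [sic].
-- E54 (`paper:arxiv-2510.03068`, control row, NOT typed): the only citation of the book p0003:L37-38 "Let $\pi$ be an irreducible generic representation of $\SO_{2n+1}(F)$, i.e. ${\rm Hom}_{U_n}\left(\pi,\psi_{U_n}\right)\ne 0$, with associated $L$-parameter $\phi_\pi$ (see [JiangSoudry2003], [JiangSoudry2004], [Arthur2013])."; its tempered-case inputs p0004:L17 "* uniqueness of local Gross-Prasad periods ( [AGRS2010]) for the pair $(\SO_{2n+1}, \SO_{2n})$." / p0004:L19-20 "Using double coset decompositions, the proof of T:main $(1)$ reduces to the tempered case. To prove T:main for tempered representations, we apply the maps $\Xi_{r,m}$ (with $1\le r\le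 n$) on $\pi^{K_{n,m}}$, constructed from the"[…].

/-- C195, the places the classification is invoked (`paper:arxiv-2605.15678`, corpus TeX).  THE BOOK (local LLC for split SO_{2n+1}(F) of every rank — the reductions recurse over SO_{2n₀+1}, n₀ < n): §1.1 p0003:L30-31 "Let $\pi$ be an irreducible generic representation of $\SO_{2n+1}(F)$, i.e., ${\rm Hom}_{U_n(F)}\left(\pi,\psi_{U_n}\right)\ne 0$, with associated $L$-parameter $\phi_\pi$ ( [JiangSoudry2003], [JiangSoudry2004] and [Arthur2013])."; §2 opening (the status footnote and the Jiang–Soudry sentence, in full in the line comment above): p0006:L1 "Throughout this paper, we will need the local Langlands correspondence for $\SO_{2n+1}(F)$, which was established by Arthur in" […] "since we only require the local Langlands correspondence for generic representations of $\SO_{2n+1}(F)$, and, more importantly, the" / p0006:L4-6 "explicit construction of representations from the associated $L$-parameter, we will mainly follow the correspondence established by Jiang–Soudry in [JiangSoudry2003] and [JiangSoudry2004]. We remark that their correspondence is based on automorphic descent together with the work of Muić in [Muic1998], and is compatible with Arthur's."; in Lo's appendix (tempered L-packets Π_φ and the characters η of their component groups): p0035:L34 "On the other hand, since $\pi_0$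 and $\pi$ are generic, they correspond to the trivial character of the component group of $\phi_0$ and $\phi$, respectively." / p0035:L39 "Suppose that $\tau$ is a tempered irreducible subquotient of $\Pi$. By comparing the extended cuspidal support (see [Ato23]) or infinitesimal parameters, we see that $\tau$ is in the $L$-packet of $\phi$." (« [Ato23] » = row B89, [cite: Atobe2023WhichPackets], cited for a notion, with an alternative — not bound).  ROW B4 ([Atobe2020] = Atobe, Invent. Math. 219 (2020), Jacquet modules): p0004:L52-53 "importantly, (E:intro 1) also holds. To establish (E:intro 2) for every $m\ge 0$, we investigate the Jacquet modules of $\Pi$ and $\pi$ using the results of Atobe in [Atobe2020]. This reduces the proof to the case of seed representations." / p0010:L164-165 "Now, we have the following observation, which, due to Atobe ( [Atobe2020]), is based on the results of Zelevinsky ( [Zelevinsky1980])."[…] / p0014:L146 "that appears in P:key Jac when $\pi$ is a seed representation. The key to our computation is Atobe's paper [Atobe2020]"[…] / p0014:L226 "The next lemma is also due to Atobe ( [Atobe2020])." / p0015:L141 "On the other hand, by [Atobe2020] (or rather [Xu2017]),"[…] (« [Xu2017] » = B. Xu, Manuscripta Math. 154 (2017), B2's family — absorbed as in rows B39, B43)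 / Lemma 6.5 p0025:L35-36 "To this end, knowledge of the length of $\Pi$ is necessary. The following lemma, proved by Atobe when $\ka=\frac{1}{2}$ ( [Atobe2020]) and by Lo in general (see (S:appendix)), is crucial to our investigation.".  ROW B42 ([AM23] = Atobe – Mínguez, the explicit Zelevinsky–Aubert duality) in the appendix: p0035:L32 "As a consequence, there must exist an irreducible subquotient $\tau$ of $\Pi$ of multiplicity one such that $D(\tau) = \pi_0$. Such an irreducible representation is unique by [AM23]." (= [cite: AtobeMinguez2023]).  THE NODE `AGIKMSderiv`: p0035:L17 "On the other hand, by the highest-derivatives formula for tempered representations in [AGIKMS24],"[…] / p0035:L34 "Then, applying the highest-derivatives formula for tempered representations in [AGIKMS24] repeatedly," / p0035:L41 "Then the formula for highest derivatives of tempered representations in [AGIKMS24] implies that"[…] / p0035:L45 "Then again by [AGIKMS24],"[…].  ROW C194's ARGUMENT (not its theorem; not bound): Lemma 2.2's proof p0007:L25-26 "When $\pi$ is tempered, the converse statement–namely, that $\pi^{K_{n,m}}\ne 0$ for some $m\ge 0$ implies that $\pi$ is generic–was proved in [AOY2024] in the course of establishing a newform theory for the unramified group ${\rm U}_{2n+1}(F)$.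 The key"[…] / p0007:L37 "A similar argument also appeared in [Atobe2025] in the development of a newform theory for the unramified group ${\rm U}_{2n}(F)$." (= row C108, not bound) / p0007:L38-39 "Now, our proof follows word for word the one in [AOY2024], except that, instead of using the aforementioned results of Beuzart-Plessis, we apply the results of Waldspurger ( [Waldspurger2010], [Waldspurger2012a])." (Waldspurger's tempered local GGP for special orthogonal groups, stated under LLC hypotheses the book supplies — the book is already the premise) and §1.2 p0004:L33-35 "Since $\pi\ne \Pi$ in general, to prove that (E:intro 2) holds for every $m\ge 0$, we follow the argument of [AOY2024] to show that a tempered representation of $\SO_{2n+1}(F)$ has a non-zero vector fixed by $K_{n,m}$ for some $m\ge 0$ if and only if such a representation is generic. Now, since $\Pi$ is completely reducible and $\pi$ is the unique generic summand of $\Pi$, we obtain the desired result.".  THE PREQUEL [YCheng2025] = E54 (Arthur-free; its Theorem 1.1 is restated as Theorem 1.1, p0003:L62-75) and Tsai [Tsai2013], [Tsai2016], the standard module conj. [Muic2001], Jiang–Soudry [JiangSoudry2003/2004], Soudry, Casselman, Roberts–Schmidt, Tadić, Mœglin–Tadić, Zelevinsky: published Arthur-free inputs, absorbed.  Bibliography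 p0036–p0037: p0036:L5-10 "[Arthur2013] J. Arthur. The endoscopic classification of representations: Orthogonal and symplectic groups, volume 61 of American Mathematical Society Colloquium Publications. American Mathematical Society, Providence, RI, 2013." / p0036:L12-15 "[Atobe2020] H. Atobe. Jacquet modules and local Langlands correspondence. Inventiones Mathematiace, 219:831–871, 2020." [sic: « Mathematiace »] (= row B4, [cite: Atobe2019]) / p0036:L17-18 "[Ato23] H. Atobe, The set of local A-packets containing a given representation," (= row B89) / p0036:L37-41 "[AOY2024] H. Atobe, M. Oi, and S. Yasuda. Local newforms for generic representations of unramified odd unitary groups and fundamental lemma. Duke Mathematical Journal, 173(12):2447–2479, 2024." (= row C194) / p0036:L100-104 "[YCheng2025] Y. Cheng. Local newforms for generic representations of $p$-adic ${\rm SO}_{2n+1}$: Uniqueness. arXiv:2510.03068v1, 2025." (= E54) / p0037:L71-75 "[Xu2017] B. Xu. On the cuspidal support of discrete series for $p$-adic quasisplit $Sp(N)$ and $SO(N)$. Manuscripta Mathematica, 154:441–502, 2017." / p0036:L33-35 "[AM23] H. Atobe and A. Mínguez, The explicit Zelevinsky-Aubert duality. Compositio Mathematica 159, 380-418 (2023)."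 (= row B42, [cite: AtobeMinguez2023]).  Premises: the book (local, all ranks), rows B4, B42, the node.  Status sentence: THE FOOTNOTE (flag; 2026). [cite: Cheng2026SOnewformsReduction, §1.1 (p0003:L30-31), §1.2 (p0004:L33-35, L52-53), §2 (p0006:L1-6), §2 Lemma 2.2 (p0007:L25-39), §4–6 (p0010:L164-165; p0014:L146, L226; p0015:L141; p0025:L35-36), App. §7 (p0035:L17-45), bibliography p0036:L5-41, L100-104, p0037:L71-75] -/
def E_ChengSOnewformsRed : Prop :=
  (∀ N, ν.Everything N) → c₂.AtobeJacquet → c₅.AtobeMinguez → c₃₆.AGIKMSderiv → c₃₆.ChengSOnewformsRed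

/-- B9, the places the classifications are invoked (`paper:arxiv-1902.04910`, corpus TeX).  MOK AND KMSW — §8.1.1 « General case », the discharge of Corollary 8.1's hypothesis (full sentences, which name the conj., in the line comment above): p0022:L48 […] "was established by Mok [Mok] for $\mathrm{U}_{2n}^+$" / p0022:L49 "and Kaletha–Minguez–Shin–White [KMSW] for $\mathrm{U}_{2n}^{-}$ with the stabilization of the twisted trace" / p0022:L50 "formula established by Moeglin–Waldspurge [WMW1,WMW2]" [sic] / p0022:L51 "assuming the weighted fundamental lemma for quasi-split groups," / p0022:L52 "which is proved in Chaudouard–Laumon [CL] only in the split case." — THE STATUS SENTENCE (the census's flag G-v: it names the weighted fundamental lemma for quasi-split groups and Chaudouard–Laumon's split case explicitly; 2019 text, printed 2022); the recalled statement p0022:L60 ff. (partition of the tempered dual into packets Π_φ with p0022:L98 "and the endoscopic character relations hold."); proof of Corollary 8.1 p0023:L2-3 "First, we note that in the same argument as [ILM], we can reduce (formal degree corollary) in the case of $\mathrm{U}_{2n}^-$ to the case of $\mathrm{U}_{2n}^+$ using the endoscopic relations, (formal degree corollary) in the case of Steinberg representations in [HII]" / p0023:L4 "and the proof of [Sh90b]."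 / p0023:L6-7 "we can show all representation in $\Pi_\phi$ have the same formal degree using the character identity. Hence, we may assume that $\langle \cdot, \sigma \rangle$ is trivial, and thus it is generic by [Mok] (See Remark (atobe))." / p0023:L8 "In this case, in a similar way as the proof of [Mok] or [Art],"[…] (a globalisation « as the proof of [Mok] or [Art] » — the book cited for the METHOD; the groups are unitary, no book premise).  ROW B19, unitary case ([At]): Remark 8.1 (line comment above; p0023:L34 "using expected desideratum on the local Langlands"[…]).  KMSW'S SCOPE: U_{2n}^- is the non-quasi-split inner form; the parameters are square-integrable ("holds for any square-interable $L$-parameter $\phi : WD_F \rightarrow {}^{L} \mathrm{U}_{2n}$" [sic]), hence tempered — KMSW's PROVED scope, as for rows C19, C24, B18.  Bibliography p0035–p0036: p0036:L31-34 "[Mok] C.P. Mok, Endoscopic classification of representations of quasi-split unitary groups. Mem. Am. Math. Soc. 235, 1108 (2015)" (= [cite: Mok2012]) / p0035:L123-125 "[KMSW] T. Kaletha, A. Minguez, S.W., Shin ad P.-J., White, Endoscopic classification of representations: inner forms of unitary groups. arXiv:1409.3731" [sic] / p0035:L19-22 "[At] H. Atobe, On the Uniqueness of Generic Representations in an L-Packet,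 to appear in IMRN, doi: 10.1093/imrn/rnw220" (= row B19, [cite: Atobe2017GenericUnique]) / p0035:L15-17 "[Art] J. Arthur, The endoscopic classication of representations. Orthogonal and symplectic groups. Amer. Math. Soc. Colloq. Publ. 61, xviii+590 pp. Amer. Math. Soc., Providence, R.I. (2013)" [sic: « classication »] (the book: cited p0023:L8 for the method of globalisation only) / p0035:L47 "[CL]" p0035:L48-50 "P-H. Chaudouard and G. Laumon, Le lemme fondamental pondéré. II. Énoncés cohomologiques. Ann. of Math. (2) 176 (2012), no. 3, 1647–1781." / p0036:L21-24 "[WMW1] C. Moeglin and J.-L., Waldspurger, Stabilisation de la Formule des Traces Tordue. Volume 1., Progr. Math. 316, Birkhäuser/Springer, Cham, 2016." / p0036:L26-29 "[WMW2] C. Moeglin and J.-L., Waldspurger, Stabilisation de la Formule des Traces Tordue. Volume 2., Progr. Math. 317, Birkhäuser/Springer, Cham, 2016.".  Premises: Mok's memoir (the local classification for U_{2n}^+: square-integrable / tempered packets with their endoscopic character relations; all ranks), KMSW's proved scope (tempered packets of U_{2n}^-), row B19 (unitary case).  NOT premises (Arthur-free, recorded in the field docstring): Theorems 1.2–1.4,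 Corollary 1.1 — explicit local descent after Lapid–Mao [LMa], [LMb], Ichino–Lapid–Mao [ILM], Ginzburg–Rallis–Soudry [GRS], Kim–Krishnamurthy [KK], Ben-Artzi–Soudry [BAS], the author's [Mo1], Matringe, Baruch, Hiraga–Ichino–Ikeda [HII], Shahidi [Sh90b]; Beuzart-Plessis [BP] (= row C25, cited in Remark 1.2 for the original formal degree conj., not used). [cite: Morimoto2022LapidMao, §8.1.1 (p0022:L43-60, L98-108; p0023:L2-8, L30-34), bibliography p0035:L15-22, L47-50, L123-125, p0036:L21-34] -/
def E_MorimotoFormalDegree : Prop :=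
  (∀ N, μ.Everything N) → (∀ N, κ.Scope N) → c₃₅.AtobeGenericU → c₃₆.MorimotoFormalDegree

/-- C196, the places the classifications are invoked (`paper:arxiv-2509.23940`, corpus TeX).  MOK'S MEMOIR (global: the endoscopic classification of the discrete spectrum of U_n(𝔸) and the multiplicity formula / multiplicity one; local packets at every place): THE STATUS SENTENCE (witness F4 of the cell's `DOWNSTREAM.md` §F; 2025): p0010:L69 "In the following proposition, we show that being globally generic is an arithmetic property. The proof relies on the result of Harris on coherent cohomology of Shimura varieties and Arthur's endoscopic classification for $\U_n(\A)$ due to Mok [Mok2015] subject to some results in unpublished preprints of Arthur. Recently, Atobe–Gan–Ichino–Kaletha–Mínguez–Shin [AGIKMS2024] have address these issues, making the endoscopic classification conditional only on the twisted weighted fundamental lemma." [sic: « have address »]; proof of Proposition 3.1: p0012:L1 "With respect to the Whittaker datum $(B_n \cap \U_n,\psi_{N_n})$, we have Arthur's endoscopic classification of discrete automorphic spectrum of $\U_n(\A)$ established by Mok [Mok2015]." / p0012:L6 "In particular, $\itPi_1'$ is almost locally generic. It follows that the cuspidal summands of $\itPsi$ are all unitary. In other words, the global Arthur parameter of $\itPi_1'$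 is generic." / p0012:L7 "In this case, the associated local Arthur packets are local $L$-packets." / p0012:L11-12 "By the Arthur's multiplicity formula, since the Arthur parameter of $\itPi_1'$ is generic, there exists a unique (counted with multiplicity) discrete automorphic representation $\itPi_1''$ of $\U_n(\A)$ in the global Arthur packet of $\itPi_1'$ such that $\itPi_{1,v}''$ is $\psi_{N_n,v}$-generic for all places $v$. Note that $\itPi_1''$ must be cuspidal by $loc.$ $cit.$."[…] / p0012:L17 "By the Arthur's multiplicity formula, the discrete spectrum of $\U_n(\A)$ satisfies multiplicity-one property." / p0012:L37 "Then $\itPi_1$ and $\itPi_1''$ are nearly equivalent. By Arthur's multiplicity formula, we deduce that $\itPi_1 = \itPi_1''$."[…]; the local packets p0012:L15 "Any $L$-packet of $\U_n(\Q_v)$ contains at most two generic representations (cf. [Kaletha2013])."[…].  ROW C27 ([BPC2023] = Beuzart-Plessis – Chaudouard, Forum Math. Pi 13 (2025)): Proposition 3.3's proof and §4 (sentences in the line comment above, p0014:L20-21, p0017:L5; « [Morimoto2024] » = control row E55, Arthur-free main theorems; « [LM2015] » = row C173, untyped — absorbed).  THE GU_n REMARK (line comment above, p0014:L14: the similitude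 group has no classification in print; the paper works around it through U_n, Labesse–Schwermer [LS2019] and [LM2015]).  Bibliography p0024–p0025: p0025:L30-34 "[Mok2015] C.-P. Mok. Endoscopic classification of representations of quasi-split unitary groups, volume 235 of Memoirs of the American Mathematical Society." (= [cite: Mok2012]) / p0024:L5-9 "[AGIKMS2024] H. Atobe, W. T. Gan, A. Ichino, T. Kaletha, A. Mínguez, and S. W. Shin. Local intertwining relations and co-tempered $A$-packets of classical groups. 2024." / p0024:L39-40 "[BPC2023] R. Beuzart-Plessis and P.-H. Chaudouard."[… title in the line comment above] p0024:L43 "Forum Math. Pi, 13(16):1–98, 2025." (= row C27, [cite: BeuzartplessisChaudouard2025]) / p0025:L43-47 "[Morimoto2024] K. Morimoto. Onn Ichino–Ikeda type formula of Whittaker periods for unitary groups. 2024." [sic: « Onn »] (= E55, arXiv:2403.19166) / p0025:L13-16 "[LS2019] J.-P. Labesse and J. Schwermer. Central morphisms and cuspidal automorphicrepresentations. J. Number Theory, 205:170–193, 2019." [sic] / p0024:L207-211 "[Kaletha2013] T. Kaletha. Genericity and contragredience in the local Langlands correspondence. Algebra Number Theory, 7(10):2447–2474, 2013.".  Premises: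 Mok's memoir (global classification and multiplicity formula for U_n, all ranks; local packets), row C27 (⇐ Mok ∧ KMSW's proved scope).  No KMSW citation.  Published Arthur-free inputs absorbed: M. Harris (coherent cohomology, [Harris1985–1990b]), Labesse–Schwermer, Kaletha 2013, Soudry's descent [Soudry2005], Clozel's purity lemma, Wallach, Buzzard–Gee, Lapid–Mao 2015 (= C173), Morimoto 2022 / 2024 (B9's Arthur-free part / E55), Grobner–Raghuram, Shahidi. [cite: Chen2025AdjointL, §3.1 (p0010:L69-75), proof of Prop. 3.1 (p0012:L1-17, L35-37), §3.3 (p0014:L14-21), §4 (p0017:L5), bibliography p0024:L5-9, L39-43, L207-211, p0025:L13-16, L30-34, L43-47] -/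
def E_ChenAdjointGU : Prop := (∀ N, μ.Everything N) → c₅.BPCii → c₃₆.ChenAdjointGU

/-- The thirty-sixth tranche of implications. [cite: Cheng2026SOnewformsReduction, Thm 1.2; Morimoto2022LapidMao, Cor. 8.1; Chen2025AdjointL, Thm 3.4 (each edge's source in its own docstring)] -/
structure Implications36 : Prop where
  chengSOnewformsRed : E_ChengSOnewformsRed ν c₂ c₅ c₃₆
  morimotoFormalDegree : E_MorimotoFormalDegree μ κ c₃₅ c₃₆
  chenAdjointGU : E_ChenAdjointGU μ c₅ c₃₆

variable {ν μ κ c₂ c₅ c₃₅ c₃₆}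
variable {c : Consumers} {c₆ : Consumers6} {c₃₃ : Consumers33} {c₃₄ : Consumers34}

/-- C195 given the book's outputs, rows B4, B42 and the node. [cite: Cheng2026SOnewformsReduction, Thm 1.2 (bookkeeping proved here)] -/
theorem chengSOnewformsRed_of_book_and_rows (T : Implications36 ν μ κ c₂ c₅ c₃₅ c₃₆) (hν : ∀ N, ν.Everything N)
    (h₄ : c₂.AtobeJacquet) (h₄₂ : c₅.AtobeMinguez) (hD : c₃₆.AGIKMSderiv) : c₃₆.ChengSOnewformsRed :=
  T.chengSOnewformsRed hν h₄ h₄₂ hD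

/-- C195 from the book's inputs (B4 through `atobeJacquet_of_leaves`, B42 through `atobeMinguez_of_leaves`), the AGIKMS
node granted as such. [cite: Cheng2026SOnewformsReduction, Thm 1.2 with Lemma 6.5 / App. §7 (bookkeeping proved here)] -/
theorem chengSOnewformsRed_of_leaves (T : Implications36 ν μ κ c₂ c₅ c₃₅ c₃₆) (J : Implications2 ν μ κ c c₂)
    (V : Implications5 ν μ κ c c₂ c₅) (A : BookInputs ν) (hD : c₃₆.AGIKMSderiv) : c₃₆.ChengSOnewformsRed :=
  T.chengSOnewformsRed A.everything (atobeJacquet_of_leaves J A) (atobeMinguez_of_leaves V A) hD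

/-- C195 in conditional form, 2026, against its own footnote « Conditional on the twisted weighted fundamental lemma »:
granting the book's internal derivations, supply edges and every PUBLISHED leaf, and granting the AGIKMS derivative
formula as a node, the reduction of Gross's existence statement to supercuspidals is conditional on the 2024–2026
preprint layer and on the general AND the non-standard weighted fundamental lemmas — the footnote names the first family;
the register adds AGIKMS's own layer twice (the book's preprint leaves, and the node). [cite: Cheng2026SOnewformsReduction, §2 p0006:L2 with Thm 1.2 (bookkeeping proved here)] -/
theorem chengSOnewformsRed_conditional_form (T : Implications36 ν μ κ c₂ c₅ c₃₅ c₃₆) (J : Implications2 ν μ κ c c₂)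
    (V : Implications5 ν μ κ c c₂ c₅) (B : ν.BookEdges) (S : ν.SupplyEdges) (P : ν.PublishedLeaves)
    (hD : c₃₆.AGIKMSderiv) :
    ν.PreprintLeaves2026 → ν.WFL_general → ν.WFL_nonstandard → c₃₆.ChengSOnewformsRed :=
  fun hQ h6 h7 => chengSOnewformsRed_of_leaves T J V ⟨B, S, P, hQ, ⟨h6, h7⟩⟩ hD

/-- B9 (Corollary 8.1 as discharged) given Mok's and KMSW's (proved-scope) outputs and B19's unitary case.
[cite: Morimoto2022LapidMao, Cor. 8.1 (bookkeeping proved here)] -/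
theorem morimotoFormalDegree_of_outputs_and_row (T : Implications36 ν μ κ c₂ c₅ c₃₅ c₃₆) (hμ : ∀ N, μ.Everything N)
    (hκ : ∀ N, κ.Scope N) (h₁₉ : c₃₅.AtobeGenericU) : c₃₆.MorimotoFormalDegree :=
  T.morimotoFormalDegree hμ hκ h₁₉

/-- B9 from Mok's inputs and KMSW's inputs (through KMSW's import of Mok, `KMSWInputs.scope`) — NO KMSW sequel, nothing of
the book —, B19's unitary case through `atobeGenericU_of_inputs`. [cite: Morimoto2022LapidMao, Cor. 8.1 with §8.1.1 (bookkeeping proved here)] -/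
theorem morimotoFormalDegree_of_inputs (T : Implications36 ν μ κ c₂ c₅ c₃₅ c₃₆)
    (T₃₅ : Implications35 ν μ c c₂ c₅ c₆ c₃₃ c₃₄ c₃₅) (M : MokInputs μ) (K : KMSWInputs μ κ) : c₃₆.MorimotoFormalDegree :=
  T.morimotoFormalDegree M.everything (K.scope M) (atobeGenericU_of_inputs T₃₅ M)

/-- B9 in conditional form, 2026, against its own 2019/2022 sentence (« assuming the weighted fundamental lemma for
quasi-split groups, which is proved in Chaudouard–Laumon [CL] only in the split case »): granting Mok's and KMSW's
internal derivations, supply edges and every PUBLISHED input, the Mok import edge and the identification of the two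
copies of the general weighted fundamental lemma, the refined formal degree identity for all discrete series of U_{2n}^±
is conditional on Mok's 2024–2026 preprint layer and on Mok's copies of the general AND the non-standard weighted
fundamental lemmas — the sentence names the general one; the non-standard one and the preprint layer are the register's
additions. [cite: Morimoto2022LapidMao, §8.1.1 p0022:L48-52 with Cor. 8.1 (bookkeeping proved here)] -/
theorem morimotoFormalDegree_conditional_form (T : Implications36 ν μ κ c₂ c₅ c₃₅ c₃₆)
    (T₃₅ : Implications35 ν μ c c₂ c₅ c₆ c₃₃ c₃₄ c₃₅) (D1 : KMSW2014.E_ImportMok μ κ) (D3 : KMSW2014.E_SameWFL μ κ)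
    (MB : μ.SectionEdges) (MS : μ.SupplyEdges) (MP : μ.PublishedLeaves) (KB : κ.ChapterEdges) (KS : κ.SupplyEdges)
    (KP : κ.PublishedLeaves) :
    μ.PreprintLeaves2026 → μ.WFL_general → μ.WFL_nonstandard → c₃₆.MorimotoFormalDegree :=
  fun hMQ m6 m7 => morimotoFormalDegree_of_inputs T T₃₅ ⟨MB, MS, MP, hMQ, ⟨m6, m7⟩⟩ ⟨D1, KB, KS, KP, ⟨D3 m6⟩⟩

/-- C196 given Mok's outputs and row C27. [cite: Chen2025AdjointL, Prop. 3.1, Prop. 3.3, Thm 3.4 (bookkeeping proved here)] -/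
theorem chenAdjointGU_of_outputs_and_row (T : Implications36 ν μ κ c₂ c₅ c₃₅ c₃₆) (hμ : ∀ N, μ.Everything N)
    (h₂₇ : c₅.BPCii) : c₃₆.ChenAdjointGU :=
  T.chenAdjointGU hμ h₂₇

/-- C196 from Mok's inputs and, through C27 (`bpcIi_of_leaves`), KMSW's proved-scope inputs; nothing of the book.
[cite: Chen2025AdjointL, Thm 3.4 (bookkeeping proved here)] -/
theorem chenAdjointGU_of_leaves (T : Implications36 ν μ κ c₂ c₅ c₃₅ c₃₆) (V : Implications5 ν μ κ c c₂ c₅)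
    (M : MokInputs μ) (K : KMSWInputs μ κ) : c₃₆.ChenAdjointGU :=
  T.chenAdjointGU M.everything (bpcIi_of_leaves V M K)

/-- C196 in conditional form, 2026, against its own 2025 sentence (« making the endoscopic classification conditional only
on the twisted weighted fundamental lemma »): granting Mok's and KMSW's internal derivations, supply edges and every
PUBLISHED input, the Mok import edge and the identification of the two copies of the general weighted fundamental
lemma, the algebraicity of adjoint L-values for GU_n is conditional on Mok's 2024–2026 preprint layer and on Mok's
copies of the general AND the non-standard weighted fundamental lemmas — directly, and at second order through
Beuzart-Plessis – Chaudouard. [cite: Chen2025AdjointL, §3.1 p0010:L69 with Thm 3.4 (bookkeeping proved here)] -/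
theorem chenAdjointGU_conditional_form (T : Implications36 ν μ κ c₂ c₅ c₃₅ c₃₆) (V : Implications5 ν μ κ c c₂ c₅)
    (D1 : KMSW2014.E_ImportMok μ κ) (D3 : KMSW2014.E_SameWFL μ κ) (MB : μ.SectionEdges) (MS : μ.SupplyEdges)
    (MP : μ.PublishedLeaves) (KB : κ.ChapterEdges) (KS : κ.SupplyEdges) (KP : κ.PublishedLeaves) :
    μ.PreprintLeaves2026 → μ.WFL_general → μ.WFL_nonstandard → c₃₆.ChenAdjointGU :=
  fun hMQ m6 m7 => chenAdjointGU_of_leaves T V ⟨MB, MS, MP, hMQ, ⟨m6, m7⟩⟩ ⟨D1, KB, KS, KP, ⟨D3 m6⟩⟩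

/-- The two unitary rows of the tranche from Mok's and KMSW's inputs; the book occurs in no premise. [cite: Morimoto2022LapidMao, Cor. 8.1; Chen2025AdjointL, Thm 3.4 (bookkeeping proved here)] -/
theorem unitaryLine36_of_inputs (T : Implications36 ν μ κ c₂ c₅ c₃₅ c₃₆) (V : Implications5 ν μ κ c c₂ c₅)
    (T₃₅ : Implications35 ν μ c c₂ c₅ c₆ c₃₃ c₃₄ c₃₅) (M : MokInputs μ) (K : KMSWInputs μ κ) :
    c₃₆.MorimotoFormalDegree ∧ c₃₆.ChenAdjointGU :=
  ⟨morimotoFormalDegree_of_inputs T T₃₅ M K, chenAdjointGU_of_leaves T V M K⟩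

/-- All three rows of the tranche from the inputs of the three DAGs (KMSW in the proved scope), the AGIKMS node granted.
[cite: Cheng2026SOnewformsReduction, Thm 1.2; Morimoto2022LapidMao, Cor. 8.1; Chen2025AdjointL, Thm 3.4 (bookkeeping proved here)] -/
theorem thirtysixth_of_inputs_and_node (T : Implications36 ν μ κ c₂ c₅ c₃₅ c₃₆) (J : Implications2 ν μ κ c c₂)
    (V : Implications5 ν μ κ c c₂ c₅) (T₃₅ : Implications35 ν μ c c₂ c₅ c₆ c₃₃ c₃₄ c₃₅) (A : BookInputs ν)
    (M : MokInputs μ) (K : KMSWInputs μ κ) (hD : c₃₆.AGIKMSderiv) :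
    c₃₆.ChengSOnewformsRed ∧ (c₃₆.MorimotoFormalDegree ∧ c₃₆.ChenAdjointGU) :=
  ⟨chengSOnewformsRed_of_leaves T J V A hD, unitaryLine36_of_inputs T V T₃₅ M K⟩

/-- The 2025–26 printed witnesses typed so far, side by side with the sentence each prints (footnote / §3.1 / §8.1.1 / the
earlier B19 flag): all rest, as typed, on the preprint layer and on BOTH weighted fundamental lemmas of the DAG they
enter — none of the four sentences names the non-standard lemma. [cite: Cheng2026SOnewformsReduction, §2 p0006:L2; Chen2025AdjointL, §3.1 p0010:L69; Morimoto2022LapidMao, §8.1.1 p0022:L51; Atobe2017GenericUnique, §2 p0005:L6 (bookkeeping proved here)] -/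
theorem witnesses36_conditional_form (T : Implications36 ν μ κ c₂ c₅ c₃₅ c₃₆) (J : Implications2 ν μ κ c c₂)
    (V : Implications5 ν μ κ c c₂ c₅) (T₃₅ : Implications35 ν μ c c₂ c₅ c₆ c₃₃ c₃₄ c₃₅) (B : ν.BookEdges)
    (S : ν.SupplyEdges) (P : ν.PublishedLeaves) (D1 : KMSW2014.E_ImportMok μ κ) (D3 : KMSW2014.E_SameWFL μ κ)
    (MB : μ.SectionEdges) (MS : μ.SupplyEdges) (MP : μ.PublishedLeaves) (KB : κ.ChapterEdges) (KS : κ.SupplyEdges)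
    (KP : κ.PublishedLeaves) (hD : c₃₆.AGIKMSderiv) :
    ν.PreprintLeaves2026 → μ.PreprintLeaves2026 → ν.WFL_general → ν.WFL_nonstandard → μ.WFL_general →
      μ.WFL_nonstandard →
      c₃₆.ChengSOnewformsRed ∧ c₃₆.MorimotoFormalDegree ∧ c₃₆.ChenAdjointGU ∧ c₃₅.AtobeGenericU :=
  fun hQ hMQ h6 h7 m6 m7 =>
    ⟨chengSOnewformsRed_of_leaves T J V ⟨B, S, P, hQ, ⟨h6, h7⟩⟩ hD,
      morimotoFormalDegree_of_inputs T T₃₅ ⟨MB, MS, MP, hMQ, ⟨m6, m7⟩⟩ ⟨D1, KB, KS, KP, ⟨D3 m6⟩⟩,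
      chenAdjointGU_of_leaves T V ⟨MB, MS, MP, hMQ, ⟨m6, m7⟩⟩ ⟨D1, KB, KS, KP, ⟨D3 m6⟩⟩,
      atobeGenericU_of_inputs T₃₅ ⟨MB, MS, MP, hMQ, ⟨m6, m7⟩⟩⟩

/-! ## Thirty-seventh tranche (v3, unit `pub-arthur-down-g22`): post-AGIKMS printed witnesses, II — the Taïbi block:
C197 (Taïbi 2025/26, 𝒜_n) and C198 (Canning – Petersen – Taïbi 2026, A_g)

Context (`DOWNSTREAM.md` §F items F1, F2; this tranche `DOWNSTREAM2.md` block `[g22c]`; texts under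
`HOME/pub-arthur-down-g22/primaries/`: corpus chunks `paper-arxiv-2510.00656` (v1), `paper-arxiv-2601.05888`, and the v2
e-print source `src-2510.00656v2/IHAg.tex`).  (i) C197: Theorems 1–6 of §1 (p0003:L24, p0004:L22, p0005:L18,
p0008:L25, p0009:L1, L17); the book at IHAg.tex l.500, l.551, l.1195-1197, l.1285;
the stabilisation p0019:L4, L42; [AMR] p0020:L58, p0076:L22; [ChRe] IHAg.tex l.1513, l.2164, l.2178, l.2192;
[CheLan] / [ChenevierTaibi] l.6990; the Disclaimer l.725-727 (v2 only).
Edge ⇐ book ∧ `StabInner` ∧ B1 ∧ C3* ∧ C3** ∧ C4 ∧ C5 ∧ C6.  (ii) C198: Theorems 1.3, 1.4, 1.7–1.12 (p0004:L6, L18; p0005:L23, L33, L41;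
p0006:L5, L10), Thm 2.4 (p0010:L1), App. Thm 7.1 (p0024:L28); C197 at p0007:L19, p0005:L13; the book and
[AMR] at p0024:L2, L36; C5, C4/C6, C3 at p0009:L20, L32, L34; the Disclaimer p0006:L31-33.
Edge ⇐ book ∧ B1 ∧ C3* ∧ C4 ∧ C5 ∧ C6 ∧ C197.  Status sentences: both rows carry the same Disclaimer (C197 from v2 on). -/

/-- Further downstream statements (rows C197, C198 of the cell's `DOWNSTREAM.md` / `DOWNSTREAM2.md`; the §F witnesses F1,
F2), as an arbitrary assignment of propositions; nothing about the content of a field is assumed.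
[cite: Arthur2013, downstream register of the cell, thirty-seventh tranche (structure only)] -/
structure Consumers37 where
  /-- C197: O. Taïbi, *The Euler characteristic of ℓ-adic local systems on 𝒜_n*, arXiv:2510.00656 (v1 2025-10-01, v2 2026-01-12; PREPRINT) (corpus TeX `paper:arxiv-2510.00656` = v1; v2 e-print `IHAg.tex`) [cite: Taibi2025EulerCharacteristic, §1 Thms 1–6 (p0003:L24-49; p0004:L22-31; p0005:L18-19; p0008:L25-49; p0009:L1-8, L17-25) = v2 Thm 4.7.2, Thm 5.2.2, Thms 6.1.5/6.1.6, Thm 7.1.3, Cor. 7.2.2, Thm 9.1.1]: for n ≥ 1, 𝒜_n the moduli stack of principally polarised abelian varieties of dimension n, ℓ a prime, ι : ℂ ≃ ℚ̄_ℓ — THEOREM 4 (« weaker, vague version » of v2's Thm 4.7.2): p0008:L26-27 "Let \(V\) be an irreducible algebraic representation of \(\PGSpbf_{2n}\). Then up to semi-simplification the representation" ℚ̄_ℓ ⊗ IH^•(GSp_{2n}, 𝒳, V)^{GSp_{2n}(ℤ̂)} p0008:L31 "of \(\GalQ \times \Hcal^{\unr}(\PGSpbf_{2n})\) is isomorphic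 to the sum of tensor products" σ^{IH}_{ψ,ι} ⊗ ι(χ_{f,ψ}) p0008:L37 "* \(\psi = \psi_0 \oplus \dots \oplus \psi_r\) ranges over Arthur's substitutes for global parameters for \(\Spbf_{2n}\) [Arthur] which are unramified and of infinitesimal character determined by \(V\), in particular \(\psi_i = \pi_i[d_i]\) with \(\pi_i\) an everywhere unramified self-dual cuspidal automorphic representation for a general linear group," […] p0008:L43 "* \(\sigma_{\psi,\iota}^{\IH}\) is a \(2^{n-r}\)-dimensional continuous semisimple representation of \(\GalQ\) over \(\Qellbar\) which is unramified away from \(\ell\) and such that for any prime \(p \neq \ell\) the semi-simplification of \(\sigma_{\psi,\iota}^{\IH}(\Frob_p)\) is conjugated to"[explicit product of (half-)spin classes]; THEOREM 5: p0009:L2-3 "Let \(\psi = \pi[d]\) be a self-dual Arthur-Langlands parameter of odd orthogonal type, everywhere unramified and with algebraic regular infinitesimal character (i.e. its eigenvalues are distinct integers, see Definitions (def:ICcal) and (def:Psi)). There exists a continuous semisimple morphism \(\rho_{\psi,\iota}^{\GSpin}: \GalQ \to \GSpin_{2n+1}(\Qellbar)\) unramified away from \(\ell\) and crystalline at \(\ell\)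 and such that for any prime \(p \neq \ell\) the semi-simplification of \(\rho_{\psi,\iota}^{\GSpin}(\Frob_p)\) belongs to \(\iota(p^{n(n+1)/4} \cpsc(\psi))\)." (with two characterisations); THEOREM 6: p0009:L18-19 "Let \(\psi = \pi[d]\) be a self-dual Arthur-Langlands parameter of orthogonal type and even dimension \(4n\), everywhere unramified and with algebraic regular infinitesimal character (i.e. its eigenvalues are distinct integers, see Definitions (def:ICcal) and (def:Psi)). Assume either \(n=1\), \(n\) even, \(d\) even, or that the infinitesimal character satisfies a regularity condition (see Definition (def:bad_tau))." — existence and uniqueness of ρ^{SO}_{ψ,ι} : Gal_ℚ → SO_{4n}(ℚ̄_ℓ) with local-global compatibility at all p ≠ ℓ and of ρ^{GSpin}_{ψ,ι} : Gal_ℚ → GSpin_{4n}(ℚ̄_ℓ) (p0009:L21-25); the tensor-product decomposition of σ^{IH}_{ψ,ι} (p0010:L23-25; v2 Thm 7.1.3); THEOREM 2 (= v2 Cor. 7.2.2), for k_1 ≥ … ≥ k_n ≥ n+1 and an eigenform f ∈ S_k(Sp_{2n}(ℤ)): p0004:L27 "* There exists a unique continuous lift \(\rho_{f,\iota}^{\GSpin}: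 \GalQ \to \GSpin_{2n+1}(\Qellbar)\) of \(\rho_{f,\iota}^{\SO}\) which is unramified away from \(\ell\), crystalline at \(\ell\) and which satisfies \(\beta \circ \rho_{f,\iota}^{\GSpin} = \chi_\ell^{n(n+1)/2-\sum_{i=1}^n k_i}\) where \(\chi_\ell: \GalQ \to \Qell^\times\) is the \(\ell\)-adic cyclotomic character." p0004:L29 "* For any prime number \(p \neq \ell\) the semi-simplification of \(\rho_{f,\iota}^{\GSpin}(\Frob_p)\) belongs to \(\iota(c_p^\mathrm{arith}(f))\)." [and uniqueness, L31]; p0004:L35 "For \(n>2\) the existence of these Galois representations is new."; THEOREM 1 (with [CheLan]): p0003:L25 "For \(1 \leq n \leq 6\) and any prime number \(\ell\) the virtual representation \(e_c(\Acal_{n,\Qbar}, \Qell)\) of \(\GalQ\) (forgetting the Hecke action) is Tate, equivalently there exists a polynomial \(P_n \in \Z[X]\) such that for any prime power \(q\) we have \(|\Acal_n(\Fq)| = P_n(q)\)." [explicit polynomials], and |𝒜_7(𝔽_q)| explicit, not polynomial (p0003:L38-49); THEOREM 3 (= v2 Thm 9.1.1): BFG's genus-3 formula for the compactly supported Euler characteristic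 holds at the level of ℓ-adic Galois representations (statement in the line comment).  NOT part of the field (Arthur-free, recorded): Theorem 7 (= Cor. 8.1.27; Euler characteristics of GL_n, Franke's filtration) and Theorem 1.4.1 (= Thm 8.3.1; e_c(GSp_{2n}, 𝒳_n, V_λ) from e_IH, p0012:L24-25). -/
  TaibiEulerAn : Prop
  /-- C198: S. Canning – D. Petersen – O. Taïbi, *The low degree cohomology of compactifications of A_g*, arXiv:2601.05888 (v1 2026-01-09; PREPRINT) (corpus TeX `paper:arxiv-2601.05888`) [cite: CanningPetersenTaibi2026, Thms 1.3, 1.4 = 2.4, 1.7, Cor. 1.8, Thms 1.9–1.12, App. Thm 7.1 (p0004:L6-27; p0005:L23-42; p0006:L5-17; p0010:L1; p0024:L28-33)]: for g ≥ 1, A_g^{Sat} the Satake compactification, 𝕍_λ the lisse ℓ-adic sheaf of a dominant weight λ of Sp_{2g}, X_{g,s} the s-fold fibre product of the universal abelian variety and X̄_{g,s} its toroidal compactifications: THEOREM 1.3: p0004:L7 "We can explicitly compute $\IH^k(A_g^\Sat, \Qell)$ for all $g \geq 1$ and all $k \leq 23$. All cohomology is pure of Tate type, with the sole exception of $(g,k)=(7,22)$,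 in which case" IH^{22}(A_7^{Sat}, ℚ_ℓ) ≃ ℚ_ℓ(−11)^{⊕10} ⊕ Sym² S_ℓ⟨12⟩ p0004:L11 "In particular, $\IH^k(A_g^\Sat,\Q_\ell)$ vanishes for all odd $k \leq 23$ and all $g$."; THEOREM 1.4 (= Thm 2.4, with Tables): p0004:L19 "For all but finitely many pairs $(g,\lambda)$, there exists an isomorphism" IH^k(A_g^{Sat}, 𝕍_λ) ≅ H^k(Y_g, ℚ_ℓ) (λ = 0), 0 (λ ≠ 0), for all k+|λ| ≤ 23; p0004:L26-27 "We tabulate all exceptional cases $(g,\lambda)$ where (isom in thm IH) fails to hold, and in these cases we compute the semisimplification of $\IH^k(A_g^\Sat,\V_\lambda)$ for $k+|\lambda| \leq 23$. All summands are Tate twists of the Galois representations associated to the automorphic representations in Theorem (thm:ChenevierLannes) along with $\Delta_{23}^{(i)}$ ($i=1,2$, corresponding to the two eigenforms in $S_{24}(\SL_2(\Z))$), $\Delta_{23,7}$, and $\Delta_{23,9}$ in weight 23."; THEOREM 1.7: p0005:L24 "For $k\leq 23$ and for any nonsingular toroidal compactification $\Xbar_{g,s}$ of $X_{g,s}$,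 the semi-simplification of the Galois representation $H^k(\Xbar_{g,s},\Qellbar)$ is isomorphic to a direct sum of Tate twists of irreducible constituents of the Galois representations associated to the automorphic representations in Theorem (thm IH)."; COROLLARY 1.8 (p0005:L29, gr^W_k for any toroidal compactification); THEOREM 1.9: p0005:L34 "Let $g\geq 1$ and $\Xbar_{g,s}$ be a nonsingular toroidal compactification of $X_{g,s}$. Then $H^{\bullet}(\Xbar_{g,s},\Q_{\ell})$ is not Tate if and only if $s\geq c(g)$."; THEOREM 1.10: p0005:L42 "Let $g\geq 1$. The Galois representation $H^\bullet(X_{g,s},\Q_{\ell})$ is not Tate if and only if $s\geq c(g)$."; THEOREM 1.11 (p0006:L6, Hodge structures for k ≤ 23); THEOREM 1.12: p0006:L11 "Let $\Xbar_{g,s}$ be a nonsingular toroidal compactification of $X_{g,s}$. If $g\geq 3$, then $H^{k,0}(\Xbar_{g,s})=0$ for all $s\geq 0$ and $0<k\leq 21$ or $k=23$." [with the three cases for H^{22,0}, L13-17]; App. THEOREM 7.1 (p0024:L29-33: the (𝔰𝔭_{2g}, U(g))-cohomology representation decomposes over ψ ∈ Ψ̃(Sp_{2g}) into (half-)spin tensor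 products). -/
  CPTlowDegree : Prop

variable (ν : Nodes) (c : Consumers) (c₃₇ : Consumers37)

-- Verbatim, kept out of docstrings by the docstring lint (sentences naming a conj.).  C197 (`paper:arxiv-2510.00656`, v1):
-- abstract p0002:L4 "To this end we take the last steps of the Ihara-Langlands-Kottwitz method to compute the intersection cohomology of minimal compactifications of Siegel modular varieties in level one, following work of Kottwitz and Morel, proving an unconditional reformulation of Kottwitz' conjecture in this case.";
-- §1.3.6 p0010:L27 "This concludes the proof of our unconditional version of Kottwitz' conjecture (Conjecture (conj:Kottwitz)) for level one Siegel modular varieties." — « unconditional » =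
-- free of the Langlands group L_ℚ and of Arthur's conj. for GSp_{2n} (§1.3.1 p0006:L13 "using Arthur's conjectures (see [Kottwitz_AA])."; §1.3.3
-- p0007:L10 "Of course the spectral expansion is not currently known in a strict sense, because the existence of the Langlands group \(L_\Q\) itself is still conjectural."); v1 has NO status sentence
-- on the classification (§1.5 ends p0012:L51 with the acknowledgement); v2 (`IHAg.tex`, 2026-01-12) adds « \subsection{Disclaimer} » l.723-727, quoted in the
-- edge docstring below.  Theorem 3 p0005:L18-19 "Theorem 3 (Theorem (thm:BFG)). Conjecture 7.1 of [BFG] holds true at the level of \(\ell\)-adic Galois representations."; Kottwitz' conj. p0006:L27 "Conjecture 1 (Kottwitz' conjecture [Kottwitz_AA], in our simplified setting).";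
-- p0006:L40 "The Ihara-Langlands-Kottwitz method is a strategy to prove Conjecture (conj:Kottwitz), assuming the spectral expansion (“stable multiplicity formula”) of the stabilization of the trace formula for certain elliptic endoscopic groups of \(\Gbf\)."
-- C198 (`paper:arxiv-2601.05888`): App. A p0024:L3 "But Arthur gave in [arthur_unip] (relying on [vz]) a more conceptual description of the $L^2$-cohomology of a Shimura variety, conditional on the endoscopic classification of the discrete automorphic spectrum of the group underlying the Shimura datum."
-- / p0024:L4 "While this classification is not known in full generality for $\GSp_{2g}$, as we saw above in level one we can reduce the matter to the endoscopic classification for $\Sp_{2g}$." / p0024:L41 "Of course this is very similar to [taibi_ecAn], and indeed [arthur_unip] is the Hodge analogue of Kottwitz' conjecture [kottwitz] on $\ell$-adic étale intersection cohomology of minimal compactifications of Shimura varieties."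

/-- C197, the places the classification is invoked.  THE BOOK (Sp_{2n} and SO_{4n}, all ranks: endoscopic groups Sp_{2a} × SO_{4b}, parameters of every GL_m) — corpus v1: §1.1 "Putting together known results due to many mathematicians (Theorem (thm:existence_rho_SO), applied using Arthur's endoscopic classification for \(\Spbf_{2n}\): see [ChRe] or [Taibi_dimtrace])"[…] (p0004:L18); §1.3.3 p0007:L15-17 "Using this observation Arthur formulated and proved a spectral expansion [Arthur] which circumvents the hypothetical group \(L_\Q\), in terms of self-dual cuspidal automorphic representations for general linear groups. Arthur's proof relies on the stabilization of the (twisted) trace formula. Unfortunately it does not seem to be possible to proceed similarly for groups which are merely isogenous to classical groups."; p0008:L18 "So in this case we first need to pin down the “correct” one \(c_p(\psi_i)\) and prove a spectral expansion for split groups \(\SObf_{4m}\) in level one and for pseudo-coefficients of discrete series at the real place (Proposition (pro:refineSOeven)), slightly refining the specialization of Arthur's stable multiplicity formula in this setting (Arthur's results for even special orthogonal groups are all “up to outer automorphism”)." / p0008:L19-20 "We then pin down semi-simple conjugacy classes \(\cpsc(\psi_i)\) in spin groups and prove a spectral expansion for groups which are quotients of products of split groups \(\Spbf_{2a}\) and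 \(\SObf_{4b}\) under the same assumptions (Proposition (pro:lift_stab_mult)). These results rely on the stabilization of the trace formula and the (unconditional) automorphic counterpart to the property “\(L^1_\Z\) is simply connected” [ChRe]."; §3: p0019:L74-75 "Now this follows from Arthur's multiplicity formula ( [Arthur], see [Taibi_dimtrace] for the specialization to the everywhere unramified case) and the fact that there"[…] / p0021:L2 "Of course this uses Arthur's endoscopic classification [Arthur], specialized to level one (see [Taibi_dimtrace])." / p0023:L12-13 "classical groups as considered in [Arthur]. We need the analogue of the stable multiplicity formula [Arthur] for these isogenous groups." / p0023:L29-32 "Instead of [Xu] we will give an ad hoc argument using an elementary lifting result of Chenevier-Renard [ChRe] relating discrete automorphic spectra in level one for isogenous split semisimple groups over \(\Q\)." / p0076:L22 "This decomposition is already known for the action of the (smaller) Hecke algebra \(\Hcal_f^{\unr}(\Spbf_{2n})\) thanks to Arthur's endoscopic classification [Arthur] and the comparison [AMR] of Arthur packets for \(\Spbf_{2n,\R}\) with the more explicit Adams-Johnson packets when the infinitesimal character is regular algebraic, see [Taibi_dimtrace] or [ChRe]."; v2 locators (`IHAg.tex`): l.500 "Using this observation Arthur formulated and proved a spectral expansion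 \cite[Corollary 3.4.2 and Theorem 4.1.2]{Arthur} which circumvents the hypothetical group \(L_\Q\), in terms of self-dual cuspidal automorphic representations for general linear groups." / l.1195 "Now this follows from Arthur's multiplicity formula (\cite[Theorem" l.1196 "1.5.2]{Arthur}, see \cite[Theorem 4.1.2]{Taibi_dimtrace} for the" l.1197 "specialization to the everywhere unramified case) and the fact that there" / l.3501 "First we have \(\epsilon_{\psi'}(s_{\psi'}) = \epsilon_{\psi}(s s_{\psi})\) by \cite[Lemma 4.4.1]{Arthur}." / l.2193 "The lift \(\Lambda^*\) can also be constructed using the exterior square lift constructed by Kim \cite{Kim_exterior_sq_GL4} and \cite[Theorem 1.5.3 (a)]{Arthur}.".  THE STABILISATION (register node `Consumers.StabInner`; here for split groups AND for the inner forms of PGSO_{4n} split at every prime, definite when n is even — the ℓ-adic families of §6): p0019:L13-15 "This is a special case of the stabilization of the trace formula (see Global Theorem 2 and Lemma 7.3 (b) in [ArthurSTF1]), refined by infinitesimal characters as in [SFTT2]." / Theorem 3.2.3 (p0019:L42-50) p0019:L53-54 "This is deduced from the same references of the previous theorem, by the same argument."; the definite inner forms p0010:L2-5 p0010:L4 "Assume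 first that \(n\) is even in Theorem (theointro:even_spin_rep), so that a definite inner form \(\Hbf\) of \(\PGSObf_{4n}\) split at all primes exists." / p0010:L5 "One can associate a level one automorphic representation \(\Pi\) for \(\Hbf\) to the parameter \(\psi\) (Example (exam:mult_formula_definite)), and by \(\ell\)-adic interpolation, which is possible thanks to the fact that \(\Hbf\) is definite, we construct the “other half-spin” Galois representation \(\sigma_{\psi,\iota}^{\spin,-\epsilon}\).".  ROW B1 ([AMR]): p0020:L58-61 "The main result of [AMR] is equivalent to the assertion that \(\Lambda_{\dpsitau \circ \psi_\infty}\) is the restriction of \(\Lambda_{\dpsitau \circ \psi_\infty}^\AJ\) to \(I(\Gbf)^\theta\), which implies that the packets coincide and the associated characters are equal.".  ROW C3 ([ChRe], Mem. AMS 1121): v2 l.1513 "result of Chenevier-Renard \cite[Proposition 4.4]{ChRe} relating discrete" (the « elementary lifting result » for isogenous split semisimple ℤ-groups — UNSTARRED in the memoir, arXiv `propisog`), l.2164 "The fact that is induces a bijection in level one is \cite[Proposition 4.9]{ChRe}, whose proof also shows the relation \(\cpsc((\Sym^2 \pi)[1]) = c(\pi_p)\) in view of Remark \ref{rem:lift_nonendo}."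 [sic: « is induces »] (arXiv `symsq` = Proposition*), l.2178 "This bijection is characterized in \cite[Proposition 4.10]{ChRe} (which also handles the case \(w_1=w_2\) which we ignore in this paper)." (`tensdeux` = Proposition*), l.2192 "Again this is proved as \cite[Proposition 4.12]{ChRe} with Remark \ref{rem:lift_nonendo}." (`lambdadeux` = Proposition**), and \cite[(3.10)], [Prop. 3.6], [Lemmas 3.7, 3.15], [Prop. 1.8], [§3.9], [§9], [Lemma 9.1], [Lemma 9.2], [Prop. 9.5], [Appendix B]{ChRe} — both starred classes are consumed: BOTH C3 fields bound.  ROW C4 ([Taibi_dimtrace], ×25; Thm 4.1.2, Rem. 4.1.6, §4.2, §4.2.1, §4.2.2, §5, §5.1, §5.2, pp. 275, 309–310, 315): e.g. l.1228 "Recall from \cite[\S 4.2]{Taibi_dimtrace} that there is a certain quasi-split twisted Levi subgroup \(\Lbf^*_{\psi,\tau}\) of \(\Gbf_{\R}\) attached to \(\dpsitau \circ \psi_\infty\).".  ROWS C5, C6: l.313 "As a first application of our main results and \cite[Theorem 9.3.3]{CheLan} we obtain the following explicit formulas." (Theorem 1) / l.6990 "and for \(\lambda_1' + n' \leq 12\)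 the classification theorems \cite[Theorem 9.3.3]{CheLan} and \cite[Theorems 3 and 4]{ChenevierTaibi} tell us that each \(\pi_i\) belongs to an explicit (short) list of possibilities.".  NOT BOUND (arguments, reviews, comparisons): A3 [Taibi_mult] l.1351 "By the same argument as in the end of the proof of \cite[Theorem 4.0.1]{Taibi_mult} (which originates from \cite[\S 11]{Kottwitz_STFcusptemp}) and using that"[…] / l.2135 "Let us make explicit the character \(\langle \cdot, \pi_{\infty} \rangle\) of \(\Scal_{\varphi_\tau}\), omitting the details which may be found in \cite[Example 3.2.3]{Taibi_mult}."; C167 [TaiCC] l.4900 "The proof is almost identical to that of \cite[Corollary 4.0.2]{TaiCC}, which itself is a simpler version of the proof of Theorem 3.2.2 and Corollary 3.2.3 loc.\ cit.\ so we simply highlight the differences."; A7 [Xu] and C10/C11 [KretShin_…]: p0007:L18 "Xu Bin [Xu] obtained remarkable results towards a spectral expansion for groups such as \(\GSpbf_{2n}\), but a complete spectral expansion seems to be out of reach at the moment." / p0009:L12 "This strategy is similar to the one used by Kret and Shin in [KretShin_GSp]." / p0010:L8.  THE STATUS SENTENCE — v2 only, §1.6 « Disclaimer » (witness F1 of the cell's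 `DOWNSTREAM.md` §F): l.725 "The results of this paper rely on Arthur's endoscopic classification \cite{Arthur}, which is not yet completely unconditional." l.726 "Thanks to \cite{AGIKMS} the only remaining result to be proved is the (standard and non-standard) weighted fundamental lemma for Lie algebras over positive characteristic local fields (generalizing \cite{ChaLauII})." l.727 "On a positive note, we understand that Connor Halleck-Dub\'e is making good progress on this generalization, so one can be hopeful that the results of \cite{Arthur} will soon become unconditional." — v1 (the corpus text) has no such sentence and calls its reformulation of Kottwitz' conj. « unconditional » (abstract p0002:L4; §1.3.6 p0010:L27; line comment above).  Bibliography (`IHAg.bib` v2): l.2325 "title = {The {E}ndoscopic {C}lassification of {R}epresentations: {O}rthogonal and {S}ymplectic groups}," / l.1163 "title = {Paquets d'Arthur des groupes classiques et unitaires}," (= B1) / l.1929 "title = {Level one algebraic cusp forms of classical groups of small rank}," (= C3) / l.956 "title = {Dimensions of spaces of level one automorphic forms for split"[…] (= C4) / l.1281 "title = {Formes automorphes et voisins de Kneser des r\'eseaux de Niemeier}," (= C5) / l.66 "title = {Discrete series multiplicities for classical groups over {{\(\mathbb{Z}\)}} and level 1 algebraic cusp forms}," (= C6) / l.1010 "TITLE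 = {Arthur's multiplicity formula for certain inner forms of"[…] (= A3) / l.3 "title = {Local Intertwining Relations and Co-tempered ${A}$-packets of Classical Groups}," (AGIKMS, « arXiv:2410.13504 », no version).  Premises: the book (all ranks), the inner-form stabilisation node, rows B1, C3 (both fields), C4, C5, C6. [cite: Taibi2025EulerCharacteristic, §1.1 (p0004:L18), §1.3.3–1.3.5 (p0007:L15-18; p0008:L18-22; p0010:L2-8), §3 (p0019:L4-54, L74-80; p0021:L2; p0023:L12-37), §4 (p0076:L22); v2 IHAg.tex l.313, l.500, l.551, l.725-727, l.1195-1197, l.1228, l.1351, l.1513-1519, l.2135, l.2164, l.2178, l.2192-2193, l.3501, l.4900, l.6990] -/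
def E_TaibiEulerAn : Prop :=
  (∀ N, ν.Everything N) → c.StabInner → c.AMR → c.ChenevierRenardStar → c.ChenevierRenardStarStar → c.TaibiDim →
    c.ChenevierLannesStar → c.ChenevierTaibi → c₃₇.TaibiEulerAn

/-- C198, the places the classification is invoked (`paper:arxiv-2601.05888`, corpus TeX).  ROW C197 ([taibi_ecAn], 32 citations): §2 p0007:L19 "Theorem 4.7.2 in [taibi_ecAn] (using Remarks 4.3.6 and 4.3.7 loc. cit. to reduce to the case where the central character of $V_\lambda$ is trivial, and purity) decomposes"[…] ℚ̄_ℓ ⊗ ⊕_k IH^k(A_g^{Sat}, 𝕍_λ) p0007:L23 "as a (canonical) direct sum over a set $\tPsidut(\Sp_{2g})$ of formal Arthur–Langlands parameters"[…]; p0007:L34 "Proposition 3.4.7 loc. cit. associates to each $\psi_i = \pi_i[d_i]$ a family of semisimple conjugacy classes $(\cpsc(\psi_i))_p$ (indexed by all primes $p$) in a certain group isomorphic to $\Spin_{n_i d_i}(\C)$, such that the image by the standard representation of $\cpsc(\psi_i)$ has eigenvalues"[…]; §1.2 p0005:L13 "The bulk of the work in proving (thm IH) is in prior work of the third author [taibi_ecAn]."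 / p0004:L34 "But if an Arthur–Langlands parameter $\psi$ is built out of level $1$ cuspidal automorphic representations $\pi_0,\dots,\pi_r$, then in general the corresponding summand of intersection cohomology is not built directly from the Galois representations attached to $\pi_0,\dots,\pi_r$, but rather from lifts to $\GSpin$ groups of these standard Galois representations (see 1.3.4–6 of [taibi_ecAn])."; p0005:L37 "Note that the third author has proven that $\#A_g(\mathbb{F}_q)$ is a polynomial in $q$ when $g\leq 6$, computed the polynomials, and shown that $\#A_7(\mathbb{F}_q)$ is not polynomial in $q$ [taibi_ecAn].".  THE BOOK AND ROW B1 DIRECTLY (Appendix, Theorem 7.1 on (𝔤,K)-cohomology, behind Theorems 1.11, 1.12): p0024:L2 "Relying on Arthur's endoscopic classification [arthurclassification] for $\Sp_{2g,\Q}$, the identification of cohomological Arthur-Langlands packets for $\Sp_{2g}(\R)$ with the (more concrete) Adams-Johnson packets [AMR] and the explicit computation of $(\mathfrak{sp}_{2g},U(g))$-cohomology of irreducible unitary $(\mathfrak{sp}_{2g},U(g))$-modules [vz], one can in principle explicitly compute $H^\bullet_{(2)}(A_g, \V_\lambda)$ explicitly as a representation of $\mathbb{S}_\C$ (even adding the commuting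 action of the Hecke algebra $\mathcal{H}(\Sp_{2g}(\A_f), \Sp_{2g}(\Zhat))$)." / p0024:L5 "Simply paraphrasing [arthur_unip] (using Deligne's sign convention) yields Theorem (thm:Hodge_g_K_A_g) below, for which we need to recall a few notions." / proof of Theorem 7.1 p0024:L36 "As explained above this formula is proved by paraphrasing the proof of [arthur_unip] using Arthur's endoscopic classification for $\Sp_{2g}$ and [AMR], decomposing final representations into tensor products of (half-)spin representations exactly as in [taibi_ecAn]." (the full sentences on [arthur_unip] « conditional on the endoscopic classification » in the line comment above).  ROWS C5, C4, C6, C3 (§2, proof of Theorem 2.4): p0009:L20 "It follows from [chenevierlannes] that the case $r_i=3$ does not occur." / p0009:L31 "For $r_i \geq 6$ this imposes $w_1(\pi_i) \leq 8$ and this does not occur by [chenevierlannes]." / p0009:L32 "For $r_i \leq 5$ perusing the tables of self-dual algebraic regular cuspidal automorphic representations for $\GL_{n_i,\Q}$ of orthogonal type ( [taibi] or [cheneviertaibi]) shows that there is no such representation satisfying $\sum_{j=1}^{r_i} w_j(\pi_i) \leq 25$ if $r_i>3$." / p0009:L33 "(Presumably the cases $r_i \in \{4,5\}$ could also be ruled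 out using the method of [cheneviertaibi].)" / p0009:L34 "For $r_i \leq 3$ we find the following possibilities for $\pi_i$ (see [chenevierrenard] and [taibi_ecAn] for the three automorphic lifts involved):" / p0009:L87 "Recall from [chenevierrenard] that the symplectic root number $\epsilon(\tfrac{1}{2}, \pi_i \times \pi_j)$ is easily computed from the weights of $\pi_i$ and $\pi_j$."; §1.1 p0003:L17 "Recent work of Chenevier, Renard, Lannes, and Taïbi [chenevierrenard,chenevierlannes,taibi,cheneviertaibi] has shown that level one automorphic representations of small “motivic weight” can be completely classified, meaning that the Galois representations that should contribute to the low-degree cohomology of smooth proper Deligne–Mumford stacks over $\Spec \Z$ are classified as well." / p0003:L21 "See also [cheneviertaibi] for a simpler proof of [chenevierlannes], and partial results in motivic weights 23 and 24.".  NOT BOUND: [cg] = Chenevier – Gan arXiv:2510.21169 (census C100, untyped), only in Remark (rem:higher_wt) beyond weight 23: p0011:L14 "but thanks to results of Chenevier-Gan [cg] we can say more." / p0011:L16 "By Theorem 3.8, Theorem 3.10 and Proposition 7.11 of [cg] there exists a (unique) Arthur-Langlands parameter $\psi(\pi, \spin)$,"[…]; [taibi_massLF] « Forthcoming » (p0012:L3;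 p0025:L19); Faltings–Chai, AMRT, Looijenga, Saper–Stern, Borel, Hansen–Zavyalov, Clozel / Caraiani purity — Arthur-free, absorbed.  THE STATUS SENTENCE (§« Disclaimer », witness F2; same text as C197 v2): p0006:L31-33 "The results of this paper rely on Arthur's endoscopic classification [arthurclassification], which is not yet completely unconditional. Thanks to [AGIKMS] the only remaining result to be proved is the (standard and non-standard) weighted fundamental lemma for Lie algebras over positive characteristic local fields (generalizing [chaudouard_laumon_wfl2]). On a positive note, we understand that Connor Halleck-Dubé is making good progress on this generalization, so one can be hopeful that the results of [arthurclassification] will soon become unconditional.".  Bibliography: p0025:L27 "[taibi_ecAn] @article{taibi_ecAn, author = {Ta{\"{i}}bi, Olivier}, title = {The {E}uler characteristic of {$\ell$}-adic local systems on {$A_n$}}, journal = {arXiv preprint arXiv:2510.00656}, year = {2025}, }" (= C197, no version) / p0048:L19 "[arthurclassification] @book {arthurclassification, AUTHOR = {Arthur, James}, TITLE = {The endoscopic classification of representations. Orthogonal and symplectic groups},"[…] / p0025:L5 "[AMR] @article{AMR, author = {Arancibia, Nicol{\'a}s and Moeglin, Colette and Renard, David}, title = {Arthur packets for classical and unitary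 groups},"[…] (= B1) / p0070:L5 "[chenevierrenard] @article {chenevierrenard, AUTHOR = {Chenevier, Ga\"{e}tan and Renard, David}, TITLE = {Level one algebraic cusp forms of classical groups of small rank},"[…] (= C3) / p0070:L11 "[taibi] @article {taibi, AUTHOR = {Ta{\"i}bi, Olivier}, TITLE = {Dimensions of spaces of level one automorphic forms for split classical groups using the trace formula},"[…] (= C4) / p0070:L13 "[chenevierlannes] @book {chenevierlannes, AUTHOR = {Chenevier, Ga\"{e}tan and Lannes, Jean}, TITLE = {Automorphic forms and even unimodular lattices. Kneser neighbors of Niemeier lattices},"[…] (= C5, the English edition) / p0037:L13 "[cheneviertaibi] @article {cheneviertaibi, AUTHOR = {Chenevier, Ga\"{e}tan and Ta\"{\i}bi, Olivier}, TITLE = {Discrete series multiplicities for classical groups over {$\bf Z$} and level 1 algebraic cusp forms},"[…] (= C6) / p0077:L19 "[cg] @article{cg, title={Triality and Functoriality}, author={Chenevier, Ga\"etan and Gan, Wee Teck}, journal={arXiv preprint arXiv:2510.21169}, year={2025} }" (= C100).  Premises: the book (Sp_{2g}, all g), rows B1, C3 (single star; the double-starred lifts reach C198 through C197), C4, C5,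 C6, C197.  No Mok / KMSW citation. [cite: CanningPetersenTaibi2026, §1.1 (p0003:L17-21), §1.2 (p0004:L34; p0005:L13, L37), §2 (p0007:L19-44; p0009:L20-34, L87; p0010:L1-52; p0011:L14-16), Disclaimer (p0006:L29-33), App. (p0024:L2-5, L36-43), bibliography p0025:L3, L5, L19, L27, p0037:L13, p0048:L19, p0070:L5, L11, L13, p0077:L19] -/
def E_CPTlowDegree : Prop :=
  (∀ N, ν.Everything N) → c.AMR → c.ChenevierRenardStar → c.TaibiDim → c.ChenevierLannesStar → c.ChenevierTaibi →
    c₃₇.TaibiEulerAn → c₃₇.CPTlowDegree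

/-- The thirty-seventh tranche of implications. [cite: Taibi2025EulerCharacteristic, Thm 4 = v2 Thm 4.7.2; CanningPetersenTaibi2026, Thm 1.4 (each edge's source in its own docstring)] -/
structure Implications37 : Prop where
  taibiEulerAn : E_TaibiEulerAn ν c c₃₇
  cptLowDegree : E_CPTlowDegree ν c c₃₇

variable {ν c c₃₇}
variable {μ : Mok2015.Nodes} {κ : KMSW2014.Nodes}

/-- C197 given the book's outputs, the inner-form stabilisation node and rows B1, C3 (both), C4, C5, C6.
[cite: Taibi2025EulerCharacteristic, Thm 4 = v2 Thm 4.7.2 (bookkeeping proved here)] -/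
theorem taibiEulerAn_of_book_and_rows (T : Implications37 ν c c₃₇) (hν : ∀ N, ν.Everything N) (hS : c.StabInner)
    (h₁ : c.AMR) (h₃ : c.ChenevierRenardStar) (h₃₃ : c.ChenevierRenardStarStar) (h₄ : c.TaibiDim)
    (h₅ : c.ChenevierLannesStar) (h₆ : c.ChenevierTaibi) : c₃₇.TaibiEulerAn :=
  T.taibiEulerAn hν hS h₁ h₃ h₃₃ h₄ h₅ h₆

/-- C197 from the book's inputs: every premise is a first-tranche row fed by `…_of_leaves` theorems of `Downstream.lean`
(`stabInner_of_leaves` takes the published leaves and the unwritten weighted fundamental lemmas; the others every book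
leaf). [cite: Taibi2025EulerCharacteristic, Thms 1–6 with v2 Disclaimer l.725 (bookkeeping proved here)] -/
theorem taibiEulerAn_of_leaves (T : Implications37 ν c c₃₇) (I : Implications ν μ κ c) (A : BookInputs ν) :
    c₃₇.TaibiEulerAn :=
  T.taibiEulerAn A.everything (stabInner_of_leaves I A.published A.unwritten) (amr_of_leaves I A)
    (chenevierRenardStar_of_leaves I A) (chenevierRenardStarStar_of_leaves I A) (taibiDim_of_leaves I A)
    (chenevierLannes_of_leaves I A) (chenevierTaibi_of_leaves I A)

/-- C197 in conditional form, 2026, against its own v2 Disclaimer (« the only remaining result to be proved is the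
(standard and non-standard) weighted fundamental lemma … »): granting the book's internal derivations, supply edges and
every PUBLISHED leaf, the theorems on 𝒜_n and the GSpin-valued Galois representations are conditional on the 2024–2026
preprint layer (AGIKMS's LIR, CK26, KM26, [HD] — which the Disclaimer treats as achieved: « Thanks to [AGIKMS] ») and on
the general AND the non-standard weighted fundamental lemmas — BOTH named by the Disclaimer, a first among the register's
printed sentences. [cite: Taibi2025EulerCharacteristic, v2 §1.6 Disclaimer (IHAg.tex l.725-727) with Thm 4.7.2 (bookkeeping proved here)] -/
theorem taibiEulerAn_conditional_form (T : Implications37 ν c c₃₇) (I : Implications ν μ κ c) (B : ν.BookEdges)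
    (S : ν.SupplyEdges) (P : ν.PublishedLeaves) :
    ν.PreprintLeaves2026 → ν.WFL_general → ν.WFL_nonstandard → c₃₇.TaibiEulerAn :=
  fun hQ h6 h7 => taibiEulerAn_of_leaves T I ⟨B, S, P, hQ, ⟨h6, h7⟩⟩

/-- C198 given the book's outputs and rows B1, C3, C4, C5, C6, C197. [cite: CanningPetersenTaibi2026, Thm 1.4 (bookkeeping proved here)] -/
theorem cptLowDegree_of_book_and_rows (T : Implications37 ν c c₃₇) (hν : ∀ N, ν.Everything N) (h₁ : c.AMR)
    (h₃ : c.ChenevierRenardStar) (h₄ : c.TaibiDim) (h₅ : c.ChenevierLannesStar) (h₆ : c.ChenevierTaibi)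
    (h₇ : c₃₇.TaibiEulerAn) : c₃₇.CPTlowDegree :=
  T.cptLowDegree hν h₁ h₃ h₄ h₅ h₆ h₇

/-- C198 from the book's inputs (C197 through `taibiEulerAn_of_leaves`). [cite: CanningPetersenTaibi2026, Thms 1.3–1.12 (bookkeeping proved here)] -/
theorem cptLowDegree_of_leaves (T : Implications37 ν c c₃₇) (I : Implications ν μ κ c) (A : BookInputs ν) :
    c₃₇.CPTlowDegree :=
  T.cptLowDegree A.everything (amr_of_leaves I A) (chenevierRenardStar_of_leaves I A) (taibiDim_of_leaves I A)
    (chenevierLannes_of_leaves I A) (chenevierTaibi_of_leaves I A) (taibiEulerAn_of_leaves T I A)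

/-- C198 in conditional form, 2026, against its own Disclaimer (same text as C197 v2's): conditional on the book's
2024–2026 preprint layer and on the general AND the non-standard weighted fundamental lemmas — directly and, at second
order, through C197 and the level-one rows B1, C3–C6. [cite: CanningPetersenTaibi2026, Disclaimer p0006:L31-33 with Thm 1.4 (bookkeeping proved here)] -/
theorem cptLowDegree_conditional_form (T : Implications37 ν c c₃₇) (I : Implications ν μ κ c) (B : ν.BookEdges)
    (S : ν.SupplyEdges) (P : ν.PublishedLeaves) :
    ν.PreprintLeaves2026 → ν.WFL_general → ν.WFL_nonstandard → c₃₇.CPTlowDegree :=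
  fun hQ h6 h7 => cptLowDegree_of_leaves T I ⟨B, S, P, hQ, ⟨h6, h7⟩⟩

/-- Both rows of the tranche from the book's inputs; Mok and KMSW occur in no premise. [cite: Taibi2025EulerCharacteristic, Thm 4; CanningPetersenTaibi2026, Thm 1.4 (bookkeeping proved here)] -/
theorem thirtyseventh_of_inputs (T : Implications37 ν c c₃₇) (I : Implications ν μ κ c) (A : BookInputs ν) :
    c₃₇.TaibiEulerAn ∧ c₃₇.CPTlowDegree :=
  ⟨taibiEulerAn_of_leaves T I A, cptLowDegree_of_leaves T I A⟩

/-- The Taïbi block side by side with its Disclaimer: granting the book's derivations and every published leaf, both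
rows rest, as typed, on exactly the three leaf families the register keeps open in 2026 — the preprint layer and the two
weighted fundamental lemmas; the Disclaimer names the two lemmas and regards the preprint layer as supplied by AGIKMS.
[cite: Taibi2025EulerCharacteristic, v2 Disclaimer l.726; CanningPetersenTaibi2026, Disclaimer p0006:L32 (bookkeeping proved here)] -/
theorem witnesses37_conditional_form (T : Implications37 ν c c₃₇) (I : Implications ν μ κ c) (B : ν.BookEdges)
    (S : ν.SupplyEdges) (P : ν.PublishedLeaves) :
    ν.PreprintLeaves2026 → ν.WFL_general → ν.WFL_nonstandard → c₃₇.TaibiEulerAn ∧ c₃₇.CPTlowDegree :=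
  fun hQ h6 h7 => thirtyseventh_of_inputs T I ⟨B, S, P, hQ, ⟨h6, h7⟩⟩

end Downstream

end Literature.NumberTheory.Automorphic.Arthur2013
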